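import Literature.MathematicalPhysics.QuantumFieldTheory.Balaban1983to89.B9SectBCodedChainR3
import Literature.MathematicalPhysics.QuantumFieldTheory.Balaban1983to89.B9SectBCodedChainR4
import Literature.MathematicalPhysics.QuantumFieldTheory.Balaban1983to89.B9SectBStepL2FamilyTransferPos
import Literature.MathematicalPhysics.QuantumFieldTheory.Balaban1983to89.B9SectBL2StepRecordOn
import Literature.MathematicalPhysics.QuantumFieldTheory.Balaban1983to89.B9SectBCodedClassR
import Literature.MathematicalPhysics.QuantumFieldTheory.Balaban1983to89.B9SectBCodedChainR2
import Literature.MathematicalPhysics.QuantumFieldTheory.Balaban1983to89.B9SectBStepsKSCUBlocks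
import Literature.MathematicalPhysics.QuantumFieldTheory.Balaban1983to89.B9SectBH1ProbesY
import Literature.MathematicalPhysics.QuantumFieldTheory.Balaban1983to89.B9SectBH1FrameCodedY
import Literature.MathematicalPhysics.QuantumFieldTheory.Balaban1983to89.Node00.OpsYGauge
import Literature.MathematicalPhysics.QuantumFieldTheory.Balaban1983to89.B9Eq340HolderLipParSymY
import Literature.MathematicalPhysics.QuantumFieldTheory.Balaban1983to89.B9SectBCodedChainR1
import Literature.MathematicalPhysics.QuantumFieldTheory.Balaban1983to89.B9Eq359VarParBY
import Literature.MathematicalPhysics.QuantumFieldTheory.Balaban1983to89.B9SectBCodedClassGY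
import Literature.MathematicalPhysics.QuantumFieldTheory.Balaban1983to89.B9SectBCodedChainC37GY
import Literature.MathematicalPhysics.QuantumFieldTheory.Balaban1983to89.B9SectBE4FrameCodedY
import Literature.MathematicalPhysics.QuantumFieldTheory.Balaban1983to89.B9SectBE4H2GReadWriteY

/-!
# `Balaban1983to89.B9SectBCodedChainR5` — CASCADE-R BUNDLE 5∕7 (director-ym №279 GO-R; №277 (3) `hunitA` cure): the class-parametric twins
# `B9SectBL2StepRecordOnR`, `B9SectBStepsKSCUBlocksR`, `B9SectBH1FrameCodedYR`, `B9Eq340HolderLipParSymYR`, `B9SectBCodedClassGYR`, `B9SectBCodedChainC37GYR`, `B9SectBE4FrameCodedYR`, `B9SectBE4H2GReadWriteYR`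

statement-level skeleton of published theorems with citation tags; proofs where landed; nothing here is a claim about the
Yang–Mills mass gap

WHY A BUNDLE.  The minimal R-sub-path of №279 (3) is a 47-module dependency chain; post-accept olean builds are the latency of record today, so the
chain is filed as 7 layered modules instead of 47.  This module is the VERBATIM concatenation, in dependency order, of the 8 generated twin files
named above (each keeps its own namespace `…<Original>R`, its own honest twin header and a pointer to the original module documentation; consumers `open` the
namespaces exactly as they would the per-file twins).  Generated by dag-n06-c g16 (`mkbundle.py`, HOME `pub-ymgap-dag-n06-c/lean/g16/`).

HONEST SCOPE.  Re-typing bookkeeping; nothing of [B9] asserted beyond the originals; COUNT-NEUTRAL; N06 NOT discharged; nothing continuum ∕ OS ∕ mass gap ∕ Clay.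
-/

/-!
# `Balaban1983to89.B9SectBL2StepRecordOnR` — THE CLASS-PARAMETRIC TWIN of `B9SectBL2StepRecordOn` (CASCADE-R, director-ym №279 GO-R; №277 (3) `hunitA` cure; dag-n06-d SOCKET-(α) class question)

statement-level skeleton of published theorems with citation tags; proofs where landed; nothing here is a claim about the
Yang–Mills mass gap

WHAT THIS FILE IS.  The original module `B9SectBL2StepRecordOn` types its objects over MODULE 3's member carrier `bg9Y 𝔸 G x` (MODULE 2's small-cube class (3.35)).  This file RE-DECLARES, with UNCHANGED NAMES inside the namespace `…B9SectBL2StepRecordOnR`, exactly its 3 class-dependent declarations over the CLASS-PARAMETRIC carrier `B9SectBCodedClassR.bg9YC 𝔸 G P x` (`P : RegExtraY …` = the two cube conditions of (3.35)∕(3.36) as a parameter; `bg9Y 𝔸 G x = bg9YC 𝔸 G (extraY 𝔸 G) x` by `rfl`, so every declaration here specialises definitionally to its original; at the record's reading of PRINT's class, `P := extraYPb 𝔸 G`, the displayed laws `hreg335P` ((3.35) on plaquettes) and the class-keyed `hunitA` become theorems).  The text is the original's VERBATIM under the token surgery `bg9Y 𝔸 G ↦ bg9YC 𝔸 G P`,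 `NAME ↦ NAME P` for the class-dependent names (P the first explicit argument), and — №277 — the binder `hunitA` re-keyed from «all G-valued U» to «all (3.35)-regular U of the carrier» (`∀ j α₀ U, (bg9YC 𝔸 G P (f j)).Reg335 c35 α₀ U → IsUnit (deltaAY …)`).  Class-free declarations of the original are NOT copied: they are imported and used BY NAME (`open … hiding` the re-declared ones).  Generated by dag-n06-c g16's `gen.py` (HOME `pub-ymgap-dag-n06-c/lean/g16/`); the ORIGINAL MODULE DOCUMENTATION FOLLOWS VERBATIM and describes the mathematics.

HONEST SCOPE.  Re-typing bookkeeping; nothing of [B9] asserted beyond the original; COUNT-NEUTRAL; N06 NOT discharged; nothing continuum ∕ OS ∕ mass gap ∕ Clay.  Cell `pub-ymgap` (D-0062), Track A node N06 [B9], seat `pub-ymgap-dag-n06-c` g16, 2026-08-29.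
-/

/-! Module documentation: that of the original `Balaban1983to89.B9SectBL2StepRecordOn` applies verbatim to this twin (not repeated here). -/

noncomputable section

namespace Literature.MathematicalPhysics.QuantumFieldTheory.Balaban1983to89.B9SectBL2StepRecordOnR

open Literature.MathematicalPhysics.QuantumFieldTheory.Balaban1983to89.B9SectBCodedClassR (RegExtraY bg9YC)
open Literature.MathematicalPhysics.QuantumFieldTheory.Balaban1983to89.B9SectBL2StepRecordOn hiding hin_KSC₃_on_explicit houtL2_KSC₃_on stepL2Pos_record_on

open Literature.MathematicalPhysics.QuantumFieldTheory.Balaban1983to89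
open Literature.MathematicalPhysics.QuantumFieldTheory.Balaban1983to89.B6Ineq2142KLevelV1 (β)
open Literature.MathematicalPhysics.QuantumFieldTheory.Balaban1983to89.B9FromB6 (L2Block)
open Literature.MathematicalPhysics.QuantumFieldTheory.Balaban1983to89.B9Eq39Adjoint (fluct)
open Literature.MathematicalPhysics.QuantumFieldTheory.Balaban1983to89.B9SectBCodedCarrier (CCfg Coding pullK pullS)
open Literature.MathematicalPhysics.QuantumFieldTheory.Balaban1983to89.B9Eq360DeltaPrimeAY (AfldY mulY)
open Literature.MathematicalPhysics.QuantumFieldTheory.Balaban1983to89.B9PinMembersKLevelV1 (MemberY geo9Y bg9Y)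
open Literature.MathematicalPhysics.QuantumFieldTheory.Balaban1983to89.B9SectBGpLettersY (GVal)
open Literature.MathematicalPhysics.QuantumFieldTheory.Balaban1983to89.B9SectBGpFrameCodedYR (codingYx)
open Literature.MathematicalPhysics.QuantumFieldTheory.Balaban1983to89.B9SectBGpFrameCodedY (CplxLettersY)
open Literature.MathematicalPhysics.QuantumFieldTheory.Balaban1983to89.B9SectBGpReadingsYR (KSC)
open Literature.MathematicalPhysics.QuantumFieldTheory.Balaban1983to89.B9SectBGpTransferInYR (thms_KSC_base_of_pullK)
open Literature.MathematicalPhysics.QuantumFieldTheory.Balaban1983to89.B9SectBCodedChainGlobR (KSC₂ thms_KSC₂_base_iff)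
open Literature.MathematicalPhysics.QuantumFieldTheory.Balaban1983to89.B9SectBL2DictionaryYR (KSC₃)
open Literature.MathematicalPhysics.QuantumFieldTheory.Balaban1983to89.B9SectBL2SecondOrderYR (l2Block_KSC₃_base_of_record l2Block_record_at_W_of_KSC₃')
open Literature.MathematicalPhysics.QuantumFieldTheory.Balaban1983to89.B9SectBL2SecondOrderY (PlaqLawY convConst2L2 convConst2L2_nonneg cross2ConstL2 cross2ConstL2_nonneg)
open Literature.MathematicalPhysics.QuantumFieldTheory.Balaban1983to89.B9SectBL2TransferInY (crossConstL2 crossConstL2_nonneg)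
open Literature.MathematicalPhysics.QuantumFieldTheory.Balaban1983to89.B9SectBCodedChainL2R (thms_KSC₃_base_of_KSC₂ thms_mono_B₀)
open Literature.MathematicalPhysics.QuantumFieldTheory.Balaban1983to89.B9SectBCodedChainL2 (exists_thresholds_L2 l2Block_max_zero l2Block_weaken)
open Literature.MathematicalPhysics.QuantumFieldTheory.Balaban1983to89.B9SectBL2StepCodedOnR (stepL2Pos_KSC₃_on)
open Literature.MathematicalPhysics.QuantumFieldTheory.Balaban1983to89.B9SectBStepL2FamilyTransferPos (stepL2Pos_of_family_pos stepL2Pos_of_coded)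
open Literature.MathematicalPhysics.QuantumFieldTheory.Balaban1983to89.B9SectBStepWhole (StepL2Pos)
open Literature.MathematicalPhysics.QuantumFieldTheory.Balaban1983to89.B9GeoNbrCountKLevelV1 (exists_card_nbr_geo9Y_le_of_M)
open Literature.MathematicalPhysics.QuantumFieldTheory.Balaban1983to89.Node00 (SiteY BlkY IBondY CfgY SiteParY kernelFamilyS GpY)

variable {d ℓ : ℕ} {hd : 1 ≤ d + 1} {hL : Odd (ℓ + 1) ∧ 1 < ℓ + 1} {b₀ b₁ : ℝ} {Mstar : ℕ}
variable {𝔸 : Type} [NormedRing 𝔸] (P : RegExtraY d ℓ hd hL b₀ b₁ Mstar 𝔸) [NormedAlgebra ℂ 𝔸] [CompleteSpace 𝔸] [NormOneClass 𝔸] [FiniteDimensional ℝ 𝔸]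

variable {J : Type} (f : J → MemberY d ℓ hd hL b₀ b₁ Mstar) [∀ x : MemberY d ℓ hd hL b₀ b₁ Mstar, Fintype (geo9Y x).Site]
  [∀ x : MemberY d ℓ hd hL b₀ b₁ Mstar, DecidableEq (geo9Y x).Site] [∀ x : MemberY d ℓ hd hL b₀ b₁ Mstar, Nonempty (geo9Y x).Site]
  (c35 : ℝ) (G : Subgroup 𝔸ˣ) (par : ∀ j : J, SiteParY 𝔸 (f j).toKIdx) {ι : Type} [Fintype ι] [DecidableEq ι] (b : Module.Basis ι ℝ 𝔸)
  (ιB : ∀ j : J, BlkY (f j).toKIdx → IBondY (f j).toKIdx)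
  (C37 C38 : ∀ j : J, ℝ → CfgY 𝔸 (f j).toKIdx → AfldY 𝔸 (f j).toKIdx → Prop)

/-! ## §1  The input domination with explicit positive constants -/

omit [NormOneClass 𝔸] [∀ x : MemberY d ℓ hd hL b₀ b₁ Mstar, Nonempty (geo9Y x).Site] in
/-- ★ **`hin` FOR `KSC₃` WITH POSITIVE OUTPUT CONSTANTS** (input rate `δ₀ > 0`): at every (3.35)-regular base above the thresholds, the record family's
Theorem-3.1–3.3 block (read along the decoding) with constants `(B₀, δ₀, B_β, B_ε, B_εβ, B₁, δ₁)` gives `KSC₃`'s with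
`(max(c_in·max(B₀,0), 1) ∨ c_L·max(cross…)(max B₀ 0), δ₀/2, B_β, B_ε, B_εβ, B₁, δ₁)` — g7's (3.42) conversion (`thms_KSC_base_of_pullK`, neighbour count), the
augmented (3.46) member by `l2Block_KSC₃_base_of_record` under the plaquette law `hplaq`.
[cite: Balaban1985BackgroundPropagators, Thms 3.1–3.3 (3.42)–(3.48) pp.397–399, (3.35) p.396, p.398 (first remark); Balaban1984PropagatorsII, Lemma 2.1 p.234] -/
theorem hin_KSC₃_on_explicit (hι : ∀ (j : J) (s : BlkY (f j).toKIdx), β (f j).toKIdx.hN (f j).toKIdx.D (f j).toKIdx.hk (ιB j s) = s)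
    (hG1 : ∀ u : 𝔸ˣ, u ∈ G → ‖(u : 𝔸)‖ ≤ 1) {M₂ : ℝ} (hM₂ : 0 ≤ M₂) (hrepr : ∀ (v : 𝔸) (j : ι), |b.repr v j| ≤ M₂ * ‖v‖) (dC : ℕ)
    (GA : ∀ j : J, B9.KernelFamily (geo9Y (f j)) (codingYx P G (f j) (C37 j) (C38 j)).bg)
    (Cinv : ∀ j : J, B9.SiteKernel (geo9Y (f j)) (codingYx P G (f j) (C37 j) (C38 j)).bg)
    (hGA : ∀ (j : J) (c : (codingYx P G (f j) (C37 j) (C38 j)).bg.Cfg),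
      (∀ lam β' ζ, 0 ≤ (GA j).h1 c lam β' ζ) ∧ (∀ lam y, 0 ≤ (GA j).e4 c lam y) ∧ (∀ lam β' ζ, 0 ≤ (GA j).h2 c lam β' ζ))
    {cP : ℝ} (hcP : 0 ≤ cP)
    (hplaq : ∀ (j : J) (α₀ : ℝ) (U : CfgY 𝔸 (f j).toKIdx), (bg9YC 𝔸 G P (f j)).Reg335 c35 α₀ U → PlaqLawY (f j) (ιB j) cP U) :
    ∀ (B₀ δ₀ : ℝ) (Bβ Bε : ℝ → ℝ) (Bεβ : ℝ → ℝ → ℝ) (B₁ δ₁ : ℝ), 0 < B₀ → 0 < δ₀ → 0 < B₁ → 0 < δ₁ →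
      ∃ (Mi ai B₀' δ₀' : ℝ) (Bβ' Bε' : ℝ → ℝ) (Bεβ' : ℝ → ℝ → ℝ) (B₁' δ₁' : ℝ), 0 < ai ∧ 0 < B₀' ∧ 0 < δ₀' ∧ 0 < B₁' ∧ 0 < δ₁' ∧
        ∀ j : J, Mi ≤ (geo9Y (f j)).M → ∀ α₀ : ℝ, 0 < α₀ → (geo9Y (f j)).M * α₀ ≤ ai →
          ∀ c : (codingYx P G (f j) (C37 j) (C38 j)).bg.Cfg, (codingYx P G (f j) (C37 j) (C38 j)).bg.Reg335 c35 α₀ c →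
          B9.Thms31to33IneqAt dC (pullK (codingYx P G (f j) (C37 j) (C38 j))
              (kernelFamilyS (f j).toKIdx (bg9YC 𝔸 G P (f j)) (fun U => U) (GpY (f j).toKIdx (par j)) (par j))) (GA j) (Cinv j) B₀ δ₀ Bβ Bε Bεβ B₁ δ₁ c →
          B9.Thms31to33IneqAt dC (KSC₃ P G (f j) (par j) (C37 j) (C38 j)) (GA j) (Cinv j) B₀' δ₀' Bβ' Bε' Bεβ' B₁' δ₁' c := by
  intro B₀ δ₀ Bβ Bε Bεβ B₁ δ₁ hB₀ hδ₀ hB₁ hδ₁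
  obtain ⟨ML, mN, hcnt⟩ := exists_card_nbr_geo9Y_le_of_M (d := d) (ℓ := ℓ) (hd := hd) (hL := hL) (b₀ := b₀) (b₁ := b₁) (2 * ((d : ℝ) + 1))
  obtain ⟨d261, Mthr, hthr⟩ := exists_thresholds_L2 f
  set cIn : ℝ := ((ℓ + 1 : ℕ) : ℝ) * Real.exp (|δ₀| * (2 * ((d : ℝ) + 1))) + ((mN : ℝ) * (M₂ * ∑ j, ‖b j‖) * Real.exp (|δ₀| * (2 * ((d : ℝ) + 1))) + 1)
    with hcIn
  set Sb : ℝ := ∑ j, ‖b j‖ with hSb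
  set sι : ℝ := Real.sqrt (Fintype.card ι) with hsι
  set Λ : ℝ := ((ℓ : ℝ) + 1) ^ 4 with hΛ
  set BL : ℝ := (sι * M₂ * Sb) * max (crossConstL2 M₂ Sb sι d (d261 δ₀) δ₀ Λ (max B₀ 0)) (cross2ConstL2 cP M₂ Sb sι d (d261 δ₀) δ₀ Λ (max B₀ 0))
    with hBL
  have hΛ1 : 1 ≤ Λ := one_le_pow₀ (by linarith [(Nat.cast_nonneg ℓ : (0 : ℝ) ≤ ℓ)])
  have hSb0 : 0 ≤ Sb := Finset.sum_nonneg fun j _ => norm_nonneg _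
  have hsι0 : 0 ≤ sι := Real.sqrt_nonneg _
  have hBL0 : 0 ≤ BL := by
    have := crossConstL2_nonneg hM₂ hSb0 hsι0 d (d261 δ₀) δ₀ Λ (le_max_right B₀ 0)
    rw [hBL]; exact mul_nonneg (by positivity) (le_max_of_le_left this)
  refine ⟨max (max ML (2 * ((d : ℝ) + 1) + 1)) (Mthr δ₀), 1, max (max (cIn * max B₀ 0) 1) BL, min δ₀ (δ₀ / 2), Bβ, Bε, Bεβ, B₁, δ₁, one_pos,
    lt_max_of_lt_left (lt_max_of_lt_right one_pos), lt_min hδ₀ (half_pos hδ₀), hB₁, hδ₁, fun j hM α₀ hα₀ hMa c hreg hT => ?_⟩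
  obtain ⟨U, rfl, hU335⟩ := (codingYx P G (f j) (C37 j) (C38 j)).exists_of_bg_Reg335 hreg
  have hU : GVal G (f j).toKIdx U := hU335.1.1
  have hM2 : 2 * ((d : ℝ) + 1) < (geo9Y (f j)).M := by
    have := le_trans (le_max_right _ _) (le_trans (le_max_left _ _) hM); linarith
  have hML : ML ≤ (geo9Y (f j)).M := le_trans (le_max_left _ _) (le_trans (le_max_left _ _) hM)
  have hMt : Mthr δ₀ ≤ (geo9Y (f j)).M := le_trans (le_max_right _ _) hM
  obtain ⟨h261, hT1, -, -, hTi2⟩ := hthr j δ₀ hδ₀ hMt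
  -- the (3.42)–(3.45), (3.47) members: g7's conversion at the base (`KSC`), = `KSC₂`'s at a base
  have hK : B9.Thms31to33IneqAt dC (KSC P G (f j) (par j) (C37 j) (C38 j)) (GA j) (Cinv j) (cIn * max B₀ 0) δ₀ Bβ Bε Bεβ B₁ δ₁ (.base U) :=
    thms_KSC_base_of_pullK P G (f j) (par j) b (ιB j) (C37 j) (C38 j) (hι j) hG1 hU hM₂ hrepr hM2 (fun a => hcnt Mstar (f j) hML a) dC (GA j) (Cinv j) hT
  have hK2 : B9.Thms31to33IneqAt dC (KSC₂ P G (f j) (par j) (C37 j) (C38 j)) (GA j) (Cinv j) (max (cIn * max B₀ 0) 1) δ₀ Bβ Bε Bεβ B₁ δ₁ (.base U) :=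
    thms_mono_B₀ P G (f j) (C37 j) (C38 j) dC _ (GA j) (Cinv j) (le_max_left _ _)
      ((thms_KSC₂_base_iff P G (f j) (par j) (C37 j) (C38 j) dC (GA j) (Cinv j) _ δ₀ Bβ Bε Bεβ B₁ δ₁ U).2 hK)
  -- the augmented (3.46) member from the record's block at `U`
  have hL2 : L2Block (kernelFamilyS (f j).toKIdx (bg9YC 𝔸 G P (f j)) (fun U => U) (GpY (f j).toKIdx (par j)) (par j)) (max B₀ 0) δ₀ U :=
    l2Block_max_zero (f j) _ fun n lam hh y y' hc hs => hT.1.1.2.1 n lam hh y y' hc hs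
  have hK3 := l2Block_KSC₃_base_of_record P G (f j) (par j) b (ιB j) (C37 j) (C38 j) (hι j) hG1 hM₂ hrepr hδ₀ h261 hΛ1 hT1 hTi2 hcP (le_max_right B₀ 0)
    hU (hplaq j α₀ U hU335) hL2
  have h := thms_KSC₃_base_of_KSC₂ P G (f j) (par j) (C37 j) (C38 j) dC (GA j) (Cinv j) (le_trans zero_le_one (le_max_right _ _)) (hGA j _).1 (hGA j _).2.1
    (hGA j _).2.2 hK2 hBL0 (by rw [hBL, hSb, hsι]; exact hK3)
  exact h

/-! ## §2  The `L²` output domination at `U′U` -/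

omit [∀ x : MemberY d ℓ hd hL b₀ b₁ Mstar, Nonempty (geo9Y x).Site] in
/-- ★ **THE `L²` OUTPUT DOMINATION AT `U′U`**: for `(B, δ) > 0` and a cap `a`, above `Mthr δ` and for `α₁ ≦ min a (1/4)`, `KSC₃`'s (3.46) block at the product
gives the record family's (read along the decoding) with `(max (c_L·convConst2L2(B)) 1, δ/2)` — `B9SectBL2SecondOrderY.l2Block_record_at_W_of_KSC₃'` under the
plaquette law of the regular base. [cite: Balaban1985BackgroundPropagators, p.403 l.1–9, (3.46) p.398, (3.70) p.404, (3.74) p.405, p.404 (after (3.69))] -/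
theorem houtL2_KSC₃_on (hι : ∀ (j : J) (s : BlkY (f j).toKIdx), β (f j).toKIdx.hN (f j).toKIdx.D (f j).toKIdx.hk (ιB j s) = s)
    (hG1 : ∀ u : 𝔸ˣ, u ∈ G → ‖(u : 𝔸)‖ ≤ 1) {M₂ : ℝ} (hM₂ : 0 ≤ M₂) (hrepr : ∀ (v : 𝔸) (j : ι), |b.repr v j| ≤ M₂ * ‖v‖)
    {Cq : ℝ} (hC37 : ∀ j β' U a, C37 j β' U a → GVal G (f j).toKIdx U ∧ CplxLettersY G (f j) (par j) (ιB j) Cq β' U a)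
    {cP : ℝ} (hcP : 0 ≤ cP)
    (hplaq : ∀ (j : J) (α₀ : ℝ) (U : CfgY 𝔸 (f j).toKIdx), (bg9YC 𝔸 G P (f j)).Reg335 c35 α₀ U → PlaqLawY (f j) (ιB j) cP U) :
    ∀ (B δ a : ℝ), 0 < B → 0 < δ → 0 < a →
      ∃ (Mo ao a' B' δ' : ℝ), 0 < ao ∧ 0 < a' ∧ a' ≤ a ∧ 0 < B' ∧ 0 < δ' ∧
        ∀ j : J, Mo ≤ (geo9Y (f j)).M → ∀ α₀ : ℝ, 0 < α₀ → (geo9Y (f j)).M * α₀ ≤ ao →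
          ∀ c : (codingYx P G (f j) (C37 j) (C38 j)).bg.Cfg, (codingYx P G (f j) (C37 j) (C38 j)).bg.Reg335 c35 α₀ c →
          ∀ α₁ : ℝ, 0 < α₁ → α₁ ≤ a' → ∀ c' : (codingYx P G (f j) (C37 j) (C38 j)).bg.Cfg, (codingYx P G (f j) (C37 j) (C38 j)).bg.Cplx337 α₁ c c' →
          L2Block (KSC₃ P G (f j) (par j) (C37 j) (C38 j)) B δ ((codingYx P G (f j) (C37 j) (C38 j)).bg.mul c' c) →
          L2Block (pullK (codingYx P G (f j) (C37 j) (C38 j))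
            (kernelFamilyS (f j).toKIdx (bg9YC 𝔸 G P (f j)) (fun U => U) (GpY (f j).toKIdx (par j)) (par j))) B' δ' ((codingYx P G (f j) (C37 j) (C38 j)).bg.mul c' c) := by
  intro B δ a hB hδ ha
  obtain ⟨d261, Mthr, hthr⟩ := exists_thresholds_L2 f
  set Sb : ℝ := ∑ j, ‖b j‖ with hSb
  set sι : ℝ := Real.sqrt (Fintype.card ι) with hsι
  set Λ : ℝ := ((ℓ : ℝ) + 1) ^ 4 with hΛ
  set B'' : ℝ := (sι * M₂ * Sb) * convConst2L2 cP M₂ Sb sι d (d261 δ) δ Λ B with hB''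
  have hΛ0 : 0 ≤ Λ := by positivity
  have hSb0 : 0 ≤ Sb := Finset.sum_nonneg fun j _ => norm_nonneg _
  have hsι0 : 0 ≤ sι := Real.sqrt_nonneg _
  have hB''0 : 0 ≤ B'' := by
    have := (convConst2L2_nonneg (dL := d261 δ) (δ₀ := δ) hcP hM₂ hSb0 hsι0 d hΛ0 hB.le).2.2.2
    rw [hB'']; exact mul_nonneg (by positivity) this
  refine ⟨Mthr δ, 1, min a (1 / 4), max B'' 1, δ / 2, one_pos, lt_min ha (by norm_num), min_le_left _ _, lt_max_of_lt_right one_pos, half_pos hδ,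
    fun j hM α₀ hα₀ hMa c hreg α₁ hα₁ hα₁a c' h37 hL => ?_⟩
  obtain ⟨h261, hT1, hT2, hTi, hTi2⟩ := hthr j δ hδ hM
  obtain ⟨U, a', rfl, rfl, hC⟩ := (codingYx P G (f j) (C37 j) (C38 j)).exists_of_bg_Cplx337 h37
  have hα₁c : α₁ ≤ 1 / 4 := hα₁a.trans (min_le_right _ _)
  have hU335 : (bg9YC 𝔸 G P (f j)).Reg335 c35 α₀ U := hreg
  have hconv := l2Block_record_at_W_of_KSC₃' P G (f j) (par j) b (ιB j) (C37 j) (C38 j) (hι j) hG1 hM₂ hrepr (hC37 j) hδ h261 hΛ0 hT1 hT2 hTi hTi2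
    hcP hB.le hα₁c hC (hplaq j α₀ U hU335) hL
  intro n lam hh y y' hc hs
  have h := l2Block_weaken (f j) _ hB''0 (le_max_left B'' 1) (le_refl (δ / 2)) (by rw [hB'', hSb, hsι]; exact hconv) n lam hh y y' hc hs
  exact h

/-! ## §3  ★★★ The positive-input (3.46) block-step of the record family on a subfamily -/

/-- ★★★ **`StepL2Pos` OF THE RECORD FAMILY ON A SUBFAMILY** (input families: the record's `kernelFamilyS … (GpY par) par`, `GA`, `Cinv` over `bg9Y`; output:
the record's (3.46) block at `U′U`): from `B9SectBL2StepCodedOn.stepL2Pos_KSC₃_on` by `stepL2Pos_of_family_pos` (§1, §2) and `stepL2Pos_of_coded`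
(class implication `hclass`).  Displayed: `hplaq` (plaquette law of the regular bases), `hclass`, the frames' structural data.
[cite: Balaban1985BackgroundPropagators, Thm 3.1 (3.46) p.398, Thm 3.4 p.400, Sect. B pp.400–407, p.403 l.1–9, p.398 (first remark), p.404 (after (3.69)); Balaban1984PropagatorsII, Lemma 2.1 p.234, Prop. 2.6 p.247] -/
theorem stepL2Pos_record_on (hι : ∀ (j : J) (s : BlkY (f j).toKIdx), β (f j).toKIdx.hN (f j).toKIdx.D (f j).toKIdx.hk (ιB j s) = s)
    (hG1 : ∀ u : 𝔸ˣ, u ∈ G → ‖(u : 𝔸)‖ ≤ 1) (hpar : ∀ j (U : CfgY 𝔸 (f j).toKIdx), GVal G (f j).toKIdx U → ∀ z w, par j U z w ∈ G)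
    (hunit : ∀ j (U : CfgY 𝔸 (f j).toKIdx), GVal G (f j).toKIdx U → IsUnit (Node00.deltaPrimeAY (f j).toKIdx (par j) U))
    (dB : ℕ) (M₂ : ℝ) (hM₂ : 0 ≤ M₂) (hrepr : ∀ (v : 𝔸) (j : ι), |b.repr v j| ≤ M₂ * ‖v‖) (hcR : 0 < M₂ * ∑ j, ‖b j‖)
    (hcL : 0 < Real.sqrt (Fintype.card ι) * M₂ * ∑ j, ‖b j‖)
    (Cq : ℝ) (hCq : 0 ≤ Cq) (hC37 : ∀ j β' U a, C37 j β' U a → GVal G (f j).toKIdx U ∧ CplxLettersY G (f j) (par j) (ιB j) Cq β' U a)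
    (MInv aInv aW : ℝ) (hMInv : 0 < MInv) (haInv : 0 < aInv) (haW : 0 < aW)
    (GA : ∀ j : J, B9.KernelFamily (geo9Y (f j)) (bg9YC 𝔸 G P (f j))) (Cinv : ∀ j : J, B9.SiteKernel (geo9Y (f j)) (bg9YC 𝔸 G P (f j)))
    (hGA : ∀ (j : J) (U : (bg9YC 𝔸 G P (f j)).Cfg),
      (∀ lam β' ζ, 0 ≤ (GA j).h1 U lam β' ζ) ∧ (∀ lam y, 0 ≤ (GA j).e4 U lam y) ∧ (∀ lam β' ζ, 0 ≤ (GA j).h2 U lam β' ζ))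
    {cP : ℝ} (hcP : 0 ≤ cP)
    (hplaq : ∀ (j : J) (α₀ : ℝ) (U : CfgY 𝔸 (f j).toKIdx), (bg9YC 𝔸 G P (f j)).Reg335 c35 α₀ U → PlaqLawY (f j) (ιB j) cP U)
    {r αcap Mc ac : ℝ} (hr : 0 < r) (hcap : 0 < αcap) (hac : 0 < ac)
    (hclass : ∀ (j : J) (α₀ α₁ : ℝ) (U U' : (bg9YC 𝔸 G P (f j)).Cfg), Mc ≤ (geo9Y (f j)).M → 0 < α₀ → (geo9Y (f j)).M * α₀ ≤ ac →
      (bg9YC 𝔸 G P (f j)).Reg335 c35 α₀ U → 0 < α₁ → α₁ ≤ αcap → (bg9YC 𝔸 G P (f j)).Cplx337 α₁ U U' →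
      ∃ a : (codingYx P G (f j) (C37 j) (C38 j)).A,
        (codingYx P G (f j) (C37 j) (C38 j)).decA a = U' ∧ (codingYx P G (f j) (C37 j) (C38 j)).C37 (r * α₁) U a) :
    StepL2Pos dB c35 (fun j => geo9Y (f j)) (fun j => bg9YC 𝔸 G P (f j))
      (fun j => kernelFamilyS (f j).toKIdx (bg9YC 𝔸 G P (f j)) (fun U => U) (GpY (f j).toKIdx (par j)) (par j)) GA Cinv
      (fun j => kernelFamilyS (f j).toKIdx (bg9YC 𝔸 G P (f j)) (fun U => U) (GpY (f j).toKIdx (par j)) (par j)) := by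
  have hGA' : ∀ (j : J) (c : (codingYx P G (f j) (C37 j) (C38 j)).bg.Cfg),
      (∀ lam β' ζ, 0 ≤ (pullK (codingYx P G (f j) (C37 j) (C38 j)) (GA j)).h1 c lam β' ζ) ∧
      (∀ lam y, 0 ≤ (pullK (codingYx P G (f j) (C37 j) (C38 j)) (GA j)).e4 c lam y) ∧
      (∀ lam β' ζ, 0 ≤ (pullK (codingYx P G (f j) (C37 j) (C38 j)) (GA j)).h2 c lam β' ζ) := fun j c => hGA j _
  refine stepL2Pos_of_coded dB c35 (fun j => geo9Y (f j)) (fun j => bg9YC 𝔸 G P (f j))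
    (fun j => kernelFamilyS (f j).toKIdx (bg9YC 𝔸 G P (f j)) (fun U => U) (GpY (f j).toKIdx (par j)) (par j)) GA Cinv
    (fun j => codingYx P G (f j) (C37 j) (C38 j)) _ hr hcap hac hclass ?_
  exact stepL2Pos_of_family_pos dB c35 (fun j => geo9Y (f j)) (fun j => (codingYx P G (f j) (C37 j) (C38 j)).bg)
    (fun j => KSC₃ P G (f j) (par j) (C37 j) (C38 j))
    (fun j => pullK (codingYx P G (f j) (C37 j) (C38 j)) (kernelFamilyS (f j).toKIdx (bg9YC 𝔸 G P (f j)) (fun U => U) (GpY (f j).toKIdx (par j)) (par j)))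
    (fun j => pullK (codingYx P G (f j) (C37 j) (C38 j)) (GA j)) (fun j => pullK (codingYx P G (f j) (C37 j) (C38 j)) (GA j))
    (fun j => KSC₃ P G (f j) (par j) (C37 j) (C38 j))
    (fun j => pullK (codingYx P G (f j) (C37 j) (C38 j)) (kernelFamilyS (f j).toKIdx (bg9YC 𝔸 G P (f j)) (fun U => U) (GpY (f j).toKIdx (par j)) (par j)))
    (fun j => pullS (codingYx P G (f j) (C37 j) (C38 j)) (Cinv j))
    (hin_KSC₃_on_explicit P f c35 G par b ιB C37 C38 hι hG1 hM₂ hrepr dB _ _ hGA' hcP hplaq)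
    (houtL2_KSC₃_on P f c35 G par b ιB C37 C38 hι hG1 hM₂ hrepr hC37 hcP hplaq)
    (stepL2Pos_KSC₃_on P f c35 G b C37 C38 par ιB hι hG1 hpar hunit dB M₂ hM₂ hrepr hcR hcL Cq hCq hC37 MInv aInv aW hMInv haInv haW _ _)

end Literature.MathematicalPhysics.QuantumFieldTheory.Balaban1983to89.B9SectBL2StepRecordOnR

end

/-!
# `Balaban1983to89.B9SectBStepsKSCUBlocksR` — THE CLASS-PARAMETRIC TWIN of `B9SectBStepsKSCUBlocks` (CASCADE-R, director-ym №279 GO-R; №277 (3) `hunitA` cure; dag-n06-d SOCKET-(α) class question)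

statement-level skeleton of published theorems with citation tags; proofs where landed; nothing here is a claim about the
Yang–Mills mass gap

WHAT THIS FILE IS.  The original module `B9SectBStepsKSCUBlocks` types its objects over MODULE 3's member carrier `bg9Y 𝔸 G x` (MODULE 2's small-cube class (3.35)).  This file RE-DECLARES, with UNCHANGED NAMES inside the namespace `…B9SectBStepsKSCUBlocksR`, exactly its 16 class-dependent declarations over the CLASS-PARAMETRIC carrier `B9SectBCodedClassR.bg9YC 𝔸 G P x` (`P : RegExtraY …` = the two cube conditions of (3.35)∕(3.36) as a parameter; `bg9Y 𝔸 G x = bg9YC 𝔸 G (extraY 𝔸 G) x` by `rfl`, so every declaration here specialises definitionally to its original; at the record's reading of PRINT's class, `P := extraYPb 𝔸 G`, the displayed laws `hreg335P` ((3.35) on plaquettes) and the class-keyed `hunitA` become theorems).  The text is the original's VERBATIM under the token surgery `bg9Y 𝔸 G ↦ bg9YC 𝔸 G P`, `NAME ↦ NAME P` for the class-dependent names (P the first explicit argument), and — №277 — the binder `hunitA` re-keyed from «all G-valued U» to «all (3.35)-regular U of the carrier» (`∀ j α₀ U, (bg9YC 𝔸 G P (f j)).Reg335 c35 α₀ U →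 IsUnit (deltaAY …)`).  Class-free declarations of the original are NOT copied: they are imported and used BY NAME (`open … hiding` the re-declared ones).  Generated by dag-n06-c g16's `gen.py` (HOME `pub-ymgap-dag-n06-c/lean/g16/`); the ORIGINAL MODULE DOCUMENTATION FOLLOWS VERBATIM and describes the mathematics.

HONEST SCOPE.  Re-typing bookkeeping; nothing of [B9] asserted beyond the original; COUNT-NEUTRAL; N06 NOT discharged; nothing continuum ∕ OS ∕ mass gap ∕ Clay.  Cell `pub-ymgap` (D-0062), Track A node N06 [B9], seat `pub-ymgap-dag-n06-c` g16, 2026-08-29.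
-/

/-! Module documentation: that of the original `Balaban1983to89.B9SectBStepsKSCUBlocks` applies verbatim to this twin (not repeated here). -/

noncomputable section

namespace Literature.MathematicalPhysics.QuantumFieldTheory.Balaban1983to89.B9SectBStepsKSCUBlocksR

open Literature.MathematicalPhysics.QuantumFieldTheory.Balaban1983to89.B9SectBCodedClassR (RegExtraY bg9YC)
open Literature.MathematicalPhysics.QuantumFieldTheory.Balaban1983to89.B9SectBStepsKSCUBlocks hiding KSCU_e_eq_frozen KSCU_l2_eq_frozen KSCU_glob_eq_frozen KACU_holder_nonneg eBlock_frozen_of_KSC eBlock_KSCU_of_KSC globBlock_KSCU_of_eBlock_KSC KSCU_l2_le_KSC₃ l2Block_KSCU_of_KSC₃ houtE_KSCU_on houtEGlob_KSCU_on houtL2_KSCU_on stepEPos_KSCU_on stepGlobPos_KSCU_on hin_KSCU₃_on_pos stepL2Pos_KSCU_on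

open Literature.MathematicalPhysics.QuantumFieldTheory.Balaban1983to89
open Literature.MathematicalPhysics.QuantumFieldTheory.Balaban1983to89.B6KLevelCensusIndexV1 (KIdx kGeo)
open Literature.MathematicalPhysics.QuantumFieldTheory.Balaban1983to89.B6Ineq2142KLevelV1 (β)
open Literature.MathematicalPhysics.QuantumFieldTheory.Balaban1983to89.B9FromB6 (EBlock L2Block GlobBlock)
open Literature.MathematicalPhysics.QuantumFieldTheory.Balaban1983to89.B9SectBCodedCarrier (CCfg Coding pullK pullS)
open Literature.MathematicalPhysics.QuantumFieldTheory.Balaban1983to89.B9Eq360DeltaPrimeAY (AfldY)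
open Literature.MathematicalPhysics.QuantumFieldTheory.Balaban1983to89.B9PinMembersKLevelV1 (MemberY geo9Y bg9Y)
open Literature.MathematicalPhysics.QuantumFieldTheory.Balaban1983to89.B9SectBGpLettersY (GVal decY)
open Literature.MathematicalPhysics.QuantumFieldTheory.Balaban1983to89.B9SectBGpFrameCodedYR (codingYx)
open Literature.MathematicalPhysics.QuantumFieldTheory.Balaban1983to89.B9SectBGpFrameCodedY (CplxLettersY)
open Literature.MathematicalPhysics.QuantumFieldTheory.Balaban1983to89.B9SectBGpReadingsYR (KSC)
open Literature.MathematicalPhysics.QuantumFieldTheory.Balaban1983to89.B9SectBGpReadingsY (baseY etaS_eq_eta)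
open Literature.MathematicalPhysics.QuantumFieldTheory.Balaban1983to89.B9SectBGpReadingsYProdR (hasMajorant_letters_cc_of_eBlock)
open Literature.MathematicalPhysics.QuantumFieldTheory.Balaban1983to89.B9Ineq347SiteReadingY (globBlock_kernelFamilyS_of_eBlock)
open Literature.MathematicalPhysics.QuantumFieldTheory.Balaban1983to89.B9SectBCodedReadingsUR (KSCU KACU)
open Literature.MathematicalPhysics.QuantumFieldTheory.Balaban1983to89.B9SectBStepsKSCUR (KACU_members_base ineq342_346_347_congr thms_KSCU_base_iff hin_KSCU_on_pos)
open Literature.MathematicalPhysics.QuantumFieldTheory.Balaban1983to89.B9SectBGpTransferInYR (ineq343_345_congr)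
open Literature.MathematicalPhysics.QuantumFieldTheory.Balaban1983to89.B9SectBEGlobAnStepRecordOnR (stepEPos_KSC_on)
open Literature.MathematicalPhysics.QuantumFieldTheory.Balaban1983to89.B9SectBL2DictionaryYR (KSC₃)
open Literature.MathematicalPhysics.QuantumFieldTheory.Balaban1983to89.B9SectBL2DictionaryY (l2AugS)
open Literature.MathematicalPhysics.QuantumFieldTheory.Balaban1983to89.B9SectBL2TransferConvY (swap34 pref6_swap34 kernelFamilyS_l2_le_l2AugS)
open Literature.MathematicalPhysics.QuantumFieldTheory.Balaban1983to89.B9SectBL2SecondOrderY (PlaqLawY)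
open Literature.MathematicalPhysics.QuantumFieldTheory.Balaban1983to89.B9SectBL2StepRecordOnR (hin_KSC₃_on_explicit)
open Literature.MathematicalPhysics.QuantumFieldTheory.Balaban1983to89.B9SectBL2StepCodedOnR (stepL2Pos_KSC₃_on)
open Literature.MathematicalPhysics.QuantumFieldTheory.Balaban1983to89.B9SectBStepL2FamilyTransferPos (stepL2Pos_of_family_pos)
open Literature.MathematicalPhysics.QuantumFieldTheory.Balaban1983to89.B9SectBStepPosFamilyTransfer (stepEPos_of_family_pos stepPos_blk_of_family_pos)
open Literature.MathematicalPhysics.QuantumFieldTheory.Balaban1983to89.B9SectBStepWhole (StepEPos StepGlobPos StepL2Pos)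
open Literature.MathematicalPhysics.QuantumFieldTheory.Balaban1983to89.B9GeoNormsKLevelV1 (geo9K_wNorm_nonneg)
open Literature.MathematicalPhysics.QuantumFieldTheory.Balaban1983to89.Node00 (SiteY BlkY IBondY CfgY SiteParY BondParY BondOpY deltaPrimeAY kernelFamilyS
  kernelFamilyB GpY UboxY)
open Literature.MathematicalPhysics.QuantumFieldTheory.Balaban1983to89.Node00.OpsYRead342 (eBlock_kernelFamilyS_of_hasMajorant)
open Literature.MathematicalPhysics.QuantumFieldTheory.Balaban1983to89.Node00.OpsYHolderFar (holderQB_nonneg)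

variable {d ℓ : ℕ} {hd : 1 ≤ d + 1} {hL : Odd (ℓ + 1) ∧ 1 < ℓ + 1} {b₀ b₁ : ℝ} {Mstar : ℕ}
variable {𝔸 : Type} [NormedRing 𝔸] (P : RegExtraY d ℓ hd hL b₀ b₁ Mstar 𝔸) [NormedAlgebra ℂ 𝔸] [CompleteSpace 𝔸] [FiniteDimensional ℝ 𝔸]

/-! ## §1 At a fixed configuration the U-letter members are def-Y's one-configuration reading with the operator frozen -/

section Frozen

variable (G : Subgroup 𝔸ˣ) (x : MemberY d ℓ hd hL b₀ b₁ Mstar) (par : SiteParY 𝔸 x.toKIdx) (OA : BondOpY 𝔸 x.toKIdx) (parB : BondParY 𝔸 x.toKIdx)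
  (C37 C38 : ℝ → CfgY 𝔸 x.toKIdx → AfldY 𝔸 x.toKIdx → Prop)

omit [FiniteDimensional ℝ 𝔸] in
/-- the (3.42) member of `KSCU` at `c₀` IS that of `kernelFamilyS` with the letters along `base` and the operator frozen at `G′(dec c₀)` (`rfl`).
[cite: Balaban1985BackgroundPropagators, (3.42) p.397, p.403 l.1–9, bookkeeping] -/
theorem KSCU_e_eq_frozen (c₀ : (codingYx P G x C37 C38).bg.Cfg) (n : Fin 4) :
    (KSCU P G x par C37 C38).e n c₀ =
      (kernelFamilyS x.toKIdx (codingYx P G x C37 C38).bg (baseY x.toKIdx) (fun _ => GpY x.toKIdx par (decY x.toKIdx c₀)) par).e n c₀ := by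
  funext lam bb
  cases lam <;> rfl

omit [FiniteDimensional ℝ 𝔸] in
/-- the (3.46) member of `KSCU` at `c₀` IS the frozen reading's (`rfl`). [cite: Balaban1985BackgroundPropagators, (3.46) p.398, p.403 l.1–9, bookkeeping] -/
theorem KSCU_l2_eq_frozen (c₀ : (codingYx P G x C37 C38).bg.Cfg) (n : Fin 6) :
    (KSCU P G x par C37 C38).l2 n c₀ =
      (kernelFamilyS x.toKIdx (codingYx P G x C37 C38).bg (baseY x.toKIdx) (fun _ => GpY x.toKIdx par (decY x.toKIdx c₀)) par).l2 n c₀ := by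
  funext lam h
  cases lam <;> cases h <;> rfl

omit [FiniteDimensional ℝ 𝔸] in
/-- the (3.47) member of `KSCU` at `c₀` IS the frozen reading's (`rfl`). [cite: Balaban1985BackgroundPropagators, (3.47) p.398, p.403 l.1–9, bookkeeping] -/
theorem KSCU_glob_eq_frozen (c₀ : (codingYx P G x C37 C38).bg.Cfg) (n : Fin 4) :
    (KSCU P G x par C37 C38).glob n c₀ =
      (kernelFamilyS x.toKIdx (codingYx P G x C37 C38).bg (baseY x.toKIdx) (fun _ => GpY x.toKIdx par (decY x.toKIdx c₀)) par).glob n c₀ := by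
  funext lam γ
  cases lam <;> rfl

omit [FiniteDimensional ℝ 𝔸] in
/-- the Hölder members (3.43)–(3.45) of the bond-sector reading `KACU` are nonnegative (sups of norms ∕ Hölder quotients, `0` off the bond sector).
[cite: Balaban1985BackgroundPropagators, (3.43)–(3.45) p.398, (3.40) p.397, bookkeeping] -/
theorem KACU_holder_nonneg (c : (codingYx P G x C37 C38).bg.Cfg) :
    (∀ lam β' ζ, 0 ≤ (KACU P G x OA parB C37 C38).h1 c lam β' ζ) ∧ (∀ lam y, 0 ≤ (KACU P G x OA parB C37 C38).e4 c lam y) ∧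
      (∀ lam β' ζ, 0 ≤ (KACU P G x OA parB C37 C38).h2 c lam β' ζ) := by
  refine ⟨fun lam β' ζ => ?_, fun lam y => ?_, fun lam β' ζ => ?_⟩
  · rcases lam with f | J <;> rcases ζ with z | z
    · exact le_rfl
    · exact le_rfl
    · exact le_rfl
    · exact Real.iSup_nonneg fun E => le_max_of_le_left (Real.iSup_nonneg fun ν => holderQB_nonneg _ _ _ _ _)
  · rcases lam with f | J
    · exact le_rfl
    · exact Real.iSup_nonneg fun E => Real.iSup_nonneg fun ν => Real.iSup_nonneg fun μ => Real.iSup_nonneg fun w => norm_nonneg _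
  · rcases lam with f | J <;> rcases ζ with z | z
    · exact le_rfl
    · exact le_rfl
    · exact le_rfl
    · exact Real.iSup_nonneg fun E => Real.iSup_nonneg fun ν => Real.iSup_nonneg fun μ => holderQB_nonneg _ _ _ _ _

end Frozen

/-! ## §2 The dominations at one coded configuration: (3.42) by READ∕WRITE, (3.47) from (3.42), (3.46) among the augmented words -/

section Dominate

variable (G : Subgroup 𝔸ˣ) (x : MemberY d ℓ hd hL b₀ b₁ Mstar) (par : SiteParY 𝔸 x.toKIdx) {ι : Type} [Fintype ι] (b : Module.Basis ι ℝ 𝔸)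
  (ιB : BlkY x.toKIdx → IBondY x.toKIdx) (C37 C38 : ℝ → CfgY 𝔸 x.toKIdx → AfldY 𝔸 x.toKIdx → Prop)

/-- ★ **THE FROZEN READING's (3.42) BLOCK FROM THE AUGMENTED ONE, SAME CONFIGURATION, SAME RATE**: `EBlock KSC B₀ δ c` (`B₀ ≧ 0`) gives the (3.42) block
of `kernelFamilyS … base (G′(dec c) frozen) par` at `c` with constant `c_R·(c_R·B₀)`, `c_R = M₂Σ‖b_j‖` — READ the four U-letter block majorants
(`hasMajorant_letters_cc_of_eBlock`), WRITE them (`eBlock_kernelFamilyS_of_hasMajorant`, letters `UboxY (base c)`); no letter conversion.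
[cite: Balaban1985BackgroundPropagators, (3.42) p.397, p.403 l.1–9; Balaban1984PropagatorsII, (2.51)–(2.52) p.232] -/
theorem eBlock_frozen_of_KSC [Fintype (geo9Y x).Site] (hι : ∀ s : BlkY x.toKIdx, β x.toKIdx.hN x.toKIdx.D x.toKIdx.hk (ιB s) = s)
    {M₂ : ℝ} (hM₂ : 0 ≤ M₂) (hrepr : ∀ (v : 𝔸) (j : ι), |b.repr v j| ≤ M₂ * ‖v‖)
    {c : (codingYx P G x C37 C38).bg.Cfg} {B₀ δ : ℝ} (hB₀ : 0 ≤ B₀) (hE : EBlock (KSC P G x par C37 C38) B₀ δ c) :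
    EBlock (kernelFamilyS x.toKIdx (codingYx P G x C37 C38).bg (baseY x.toKIdx) (fun _ => GpY x.toKIdx par (decY x.toKIdx c)) par)
      (M₂ * (∑ j, ‖b j‖) * (M₂ * (∑ j, ‖b j‖) * B₀)) δ c := by
  obtain ⟨h0, h1, h2, h3⟩ := hasMajorant_letters_cc_of_eBlock P G x par b ιB C37 C38 (Rr := (0 : ℝ)) (Hp := True) hι M₂ hM₂ hrepr hB₀ hE
  have hSb : 0 ≤ ∑ j, ‖b j‖ := Finset.sum_nonneg fun j _ => norm_nonneg _
  have hBin : 0 ≤ M₂ * (∑ j, ‖b j‖) * B₀ := mul_nonneg (mul_nonneg hM₂ hSb) hB₀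
  letI : Fintype (B9GeoNormsKLevelV1.geo9K x.toKIdx).Site := ‹Fintype (geo9Y x).Site›
  exact eBlock_kernelFamilyS_of_hasMajorant x.toKIdx b (B := (codingYx P G x C37 C38).bg) (cfg := baseY x.toKIdx)
    (O := fun _ => GpY x.toKIdx par (decY x.toKIdx c)) (par := par) (U₁ := c) (Rr := (0 : ℝ)) (Hp := True) ιB hι hM₂ hrepr
    (η := (kGeo x.toKIdx).eta) (by rw [etaS_eq_eta]) (Uc := UboxY x.toKIdx (baseY x.toKIdx c)) rfl
    (((kGeo x.toKIdx).eta ^ 2) • (GpY x.toKIdx par (decY x.toKIdx c)).restrictScalars ℝ)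
    ((((kGeo x.toKIdx).eta ^ 2))⁻¹ • (Node00.lapSL x.toKIdx (baseY x.toKIdx c)).restrictScalars ℝ)
    (fun Λ' => rfl) (fun Λ' => by rw [LinearMap.smul_apply, LinearMap.restrictScalars_apply, Node00.lapSL_apply]) hBin
    h0 (fun μ => h1 (Sum.inl μ)) (fun μ => h2 (Sum.inr μ)) h3

/-- ★ **THE U-LETTER (3.42) BLOCK FROM THE AUGMENTED ONE, AT EVERY CODED CONFIGURATION, SAME RATE**: `EBlock KSC B₀ δ c → EBlock KSCU (c_R²·B₀) δ c`.
[cite: Balaban1985BackgroundPropagators, (3.42) p.397, Thm 3.4 p.400, p.403 l.1–9; Balaban1984PropagatorsII, (2.51)–(2.52) p.232] -/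
theorem eBlock_KSCU_of_KSC [Fintype (geo9Y x).Site] (hι : ∀ s : BlkY x.toKIdx, β x.toKIdx.hN x.toKIdx.D x.toKIdx.hk (ιB s) = s)
    {M₂ : ℝ} (hM₂ : 0 ≤ M₂) (hrepr : ∀ (v : 𝔸) (j : ι), |b.repr v j| ≤ M₂ * ‖v‖)
    {c : (codingYx P G x C37 C38).bg.Cfg} {B₀ δ : ℝ} (hB₀ : 0 ≤ B₀) (hE : EBlock (KSC P G x par C37 C38) B₀ δ c) :
    EBlock (KSCU P G x par C37 C38) (M₂ * (∑ j, ‖b j‖) * (M₂ * (∑ j, ‖b j‖) * B₀)) δ c := by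
  have hw := eBlock_frozen_of_KSC P G x par b ιB C37 C38 hι hM₂ hrepr hB₀ hE
  intro n lam y y' hs
  rw [KSCU_e_eq_frozen]
  exact hw n lam y y' hs

/-- ★ **THE U-LETTER (3.47) BLOCK FROM THE AUGMENTED (3.42) BLOCK, ONE THRESHOLD PER RATE**: for `δ > 0` there are `Mg`, `Cg ≧ 0` (g8's
`globBlock_kernelFamilyS_of_eBlock`: [4] Lemma 2.1 on the window `{δ} × [1/2, 1]`) such that above `Mg`, at every coded `c` and `B₀ ≧ 0`:
`EBlock KSC B₀ δ c → GlobBlock KSCU (c_R²·B₀·Cg) c` — print's remark «(3.47) follows from (3.42)» for the frozen reading.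
[cite: Balaban1985BackgroundPropagators, (3.47) p.398 + p.398 first remark, (3.42) p.397, p.403 l.1–9; Balaban1984PropagatorsII, Lemma 2.1 (2.60)–(2.61) p.234] -/
theorem globBlock_KSCU_of_eBlock_KSC [∀ x : MemberY d ℓ hd hL b₀ b₁ Mstar, Fintype (geo9Y x).Site] {δ : ℝ} (hδ : 0 < δ)
    {M₂ : ℝ} (hM₂ : 0 ≤ M₂) (hrepr : ∀ (v : 𝔸) (j : ι), |b.repr v j| ≤ M₂ * ‖v‖) :
    ∃ Mg Cg : ℝ, 0 ≤ Cg ∧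
      ∀ (x : MemberY d ℓ hd hL b₀ b₁ Mstar) (ιB : BlkY x.toKIdx → IBondY x.toKIdx),
        (∀ s : BlkY x.toKIdx, β x.toKIdx.hN x.toKIdx.D x.toKIdx.hk (ιB s) = s) → Mg ≤ (geo9Y x).M →
        ∀ (par : SiteParY 𝔸 x.toKIdx) (C37 C38 : ℝ → CfgY 𝔸 x.toKIdx → AfldY 𝔸 x.toKIdx → Prop) (c : (codingYx P G x C37 C38).bg.Cfg) (B₀ : ℝ),
          0 ≤ B₀ → EBlock (KSC P G x par C37 C38) B₀ δ c → GlobBlock (KSCU P G x par C37 C38) (M₂ * (∑ j, ‖b j‖) * (M₂ * (∑ j, ‖b j‖) * B₀) * Cg) c := by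
  obtain ⟨Mg, Cg, hCg, HG⟩ := globBlock_kernelFamilyS_of_eBlock (d := d) (ℓ := ℓ) (hd := hd) (hL := hL) (b₀ := b₀) (b₁ := b₁) (Mstar := Mstar)
    (𝔸 := 𝔸) hδ
  refine ⟨Mg, Cg, hCg, fun x ιB hι hM par C37 C38 c B₀ hB₀ hE => ?_⟩
  have hSb : 0 ≤ ∑ j, ‖b j‖ := Finset.sum_nonneg fun j _ => norm_nonneg _
  have hfz := eBlock_frozen_of_KSC P G x par b ιB C37 C38 hι hM₂ hrepr hB₀ hE
  have hglob := HG x ιB hι hM (codingYx P G x C37 C38).bg (baseY x.toKIdx) (fun _ => GpY x.toKIdx par (decY x.toKIdx c)) par c _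
    (mul_nonneg (mul_nonneg hM₂ hSb) (mul_nonneg (mul_nonneg hM₂ hSb) hB₀)) hfz
  intro n lam γ hγ₁ hγ₂
  rw [KSCU_glob_eq_frozen]
  exact hglob n lam γ hγ₁ hγ₂

/-- ★ **THE SIX U-LETTER `L²` MEMBERS ARE AMONG THE AUGMENTED WORDS OF `KSC₃`**: member `n` of `KSCU` at `c` ≦ member `swap34 n` of `KSC₃` at `c` (both read
the words with differences at `base c` and the operator `G′(dec c)`; print's 4th∕5th quantities are the frames' members in the other order).
[cite: Balaban1985BackgroundPropagators, Thm 3.1 (3.46) p.398, p.398 (first remark after Thm 3.1), p.403 l.1–9] -/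
theorem KSCU_l2_le_KSC₃ (c : (codingYx P G x C37 C38).bg.Cfg) (n : Fin 6) (lam : (geo9Y x).Loc) (h : (geo9Y x).Cut) :
    (KSCU P G x par C37 C38).l2 n c lam h ≤ (KSC₃ P G x par C37 C38).l2 (swap34 n) c lam h := by
  rw [KSCU_l2_eq_frozen]
  have hle := kernelFamilyS_l2_le_l2AugS x (B := (codingYx P G x C37 C38).bg) (baseY x.toKIdx) (fun _ => GpY x.toKIdx par (decY x.toKIdx c)) par n c lam h
  have heq : l2AugS x.toKIdx (B := (codingYx P G x C37 C38).bg) (fun c' => CCfg.base (baseY x.toKIdx c')) (fun _ => GpY x.toKIdx par (decY x.toKIdx c))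
      (swap34 n) c lam h = (KSC₃ P G x par C37 C38).l2 (swap34 n) c lam h := by
    cases lam <;> cases h <;> rfl
  exact hle.trans_eq heq

/-- ★ **THE U-LETTER (3.46) BLOCK FROM THE AUGMENTED ONE, SAME CONFIGURATION, SAME CONSTANTS.** [cite: Balaban1985BackgroundPropagators, Thm 3.1 (3.46) p.398, Thm 3.4 p.400, p.403 l.1–9] -/
theorem l2Block_KSCU_of_KSC₃ {c : (codingYx P G x C37 C38).bg.Cfg} {B₀ δ : ℝ} (hL2 : L2Block (KSC₃ P G x par C37 C38) B₀ δ c) :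
    L2Block (KSCU P G x par C37 C38) B₀ δ c := by
  intro n lam hh y y' hcut hsupp
  have h1 := hL2 (swap34 n) lam hh y y' hcut hsupp
  rw [pref6_swap34] at h1
  exact (KSCU_l2_le_KSC₃ P G x par C37 C38 c n lam hh).trans h1

end Dominate

/-! ## §3 The family-level output dominations and the three block-steps of `(KSCU, KACU, C⁻¹)` -/

section Steps

variable {J : Type} (f : J → MemberY d ℓ hd hL b₀ b₁ Mstar) [∀ x : MemberY d ℓ hd hL b₀ b₁ Mstar, Fintype (geo9Y x).Site]
  (c35 : ℝ) (G : Subgroup 𝔸ˣ) (par : ∀ j : J, SiteParY 𝔸 (f j).toKIdx) (OA : ∀ j : J, BondOpY 𝔸 (f j).toKIdx)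
  (parB : ∀ j : J, BondParY 𝔸 (f j).toKIdx) {ι : Type} [Fintype ι] (b : Module.Basis ι ℝ 𝔸)
  (ιB : ∀ j : J, BlkY (f j).toKIdx → IBondY (f j).toKIdx)
  (C37 C38 : ∀ j : J, ℝ → CfgY 𝔸 (f j).toKIdx → AfldY 𝔸 (f j).toKIdx → Prop)
  (Cinv : ∀ j : J, B9.SiteKernel (geo9Y (f j)) (bg9YC 𝔸 G P (f j)))

/-- ★ **THE (3.42) OUTPUT DOMINATION FOR `KSCU`, NO THRESHOLD, SAME RATE** (input `KSC`'s block at the product, output `KSCU`'s with `c_R²·B`).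
[cite: Balaban1985BackgroundPropagators, (3.42) p.397, Thm 3.4 p.400, p.403 l.1–9] -/
theorem houtE_KSCU_on (hι : ∀ (j : J) (s : BlkY (f j).toKIdx), β (f j).toKIdx.hN (f j).toKIdx.D (f j).toKIdx.hk (ιB j s) = s)
    {M₂ : ℝ} (hM₂ : 0 ≤ M₂) (hrepr : ∀ (v : 𝔸) (j : ι), |b.repr v j| ≤ M₂ * ‖v‖) (hcR : 0 < M₂ * ∑ j, ‖b j‖) :
    ∀ (B δ a : ℝ), 0 < B → 0 < δ → 0 < a →
      ∃ (Mo ao a' B' δ' : ℝ), 0 < ao ∧ 0 < a' ∧ a' ≤ a ∧ 0 < B' ∧ 0 < δ' ∧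
        ∀ j : J, Mo ≤ (geo9Y (f j)).M → ∀ α₀ : ℝ, 0 < α₀ → (geo9Y (f j)).M * α₀ ≤ ao →
          ∀ c : (codingYx P G (f j) (C37 j) (C38 j)).bg.Cfg, (codingYx P G (f j) (C37 j) (C38 j)).bg.Reg335 c35 α₀ c →
          ∀ α₁ : ℝ, 0 < α₁ → α₁ ≤ a' → ∀ c' : (codingYx P G (f j) (C37 j) (C38 j)).bg.Cfg, (codingYx P G (f j) (C37 j) (C38 j)).bg.Cplx337 α₁ c c' →
          EBlock (KSC P G (f j) (par j) (C37 j) (C38 j)) B δ ((codingYx P G (f j) (C37 j) (C38 j)).bg.mul c' c) →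
          EBlock (KSCU P G (f j) (par j) (C37 j) (C38 j)) B' δ' ((codingYx P G (f j) (C37 j) (C38 j)).bg.mul c' c) :=
  fun B δ a hB hδ ha => ⟨0, 1, a, M₂ * (∑ j, ‖b j‖) * (M₂ * (∑ j, ‖b j‖) * B), δ, one_pos, ha, le_rfl, mul_pos hcR (mul_pos hcR hB), hδ,
    fun j _ _ _ _ _ _ _ _ _ _ _ hE => eBlock_KSCU_of_KSC P G (f j) (par j) b (ιB j) (C37 j) (C38 j) (hι j) hM₂ hrepr hB.le hE⟩

/-- ★ **THE (3.47) OUTPUT RECOVERED FROM THE (3.42) OUTPUT FOR `KSCU`** (threshold `Mg(δ)` of g8's Lemma-2.1 window; constant `max (c_R²·B·Cg) 1`).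
[cite: Balaban1985BackgroundPropagators, (3.47) p.398 + p.398 first remark, Thm 3.4 p.400, p.403 l.1–9; Balaban1984PropagatorsII, Lemma 2.1 p.234] -/
theorem houtEGlob_KSCU_on (hι : ∀ (j : J) (s : BlkY (f j).toKIdx), β (f j).toKIdx.hN (f j).toKIdx.D (f j).toKIdx.hk (ιB j s) = s)
    {M₂ : ℝ} (hM₂ : 0 ≤ M₂) (hrepr : ∀ (v : 𝔸) (j : ι), |b.repr v j| ≤ M₂ * ‖v‖) :
    ∀ (B δ a : ℝ), 0 < B → 0 < δ → 0 < a →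
      ∃ (Mo ao a' B' : ℝ), 0 < ao ∧ 0 < a' ∧ a' ≤ a ∧ 0 < B' ∧
        ∀ j : J, Mo ≤ (geo9Y (f j)).M → ∀ α₀ : ℝ, 0 < α₀ → (geo9Y (f j)).M * α₀ ≤ ao →
          ∀ c : (codingYx P G (f j) (C37 j) (C38 j)).bg.Cfg, (codingYx P G (f j) (C37 j) (C38 j)).bg.Reg335 c35 α₀ c →
          ∀ α₁ : ℝ, 0 < α₁ → α₁ ≤ a' → ∀ c' : (codingYx P G (f j) (C37 j) (C38 j)).bg.Cfg, (codingYx P G (f j) (C37 j) (C38 j)).bg.Cplx337 α₁ c c' →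
          EBlock (KSC P G (f j) (par j) (C37 j) (C38 j)) B δ ((codingYx P G (f j) (C37 j) (C38 j)).bg.mul c' c) →
          GlobBlock (KSCU P G (f j) (par j) (C37 j) (C38 j)) B' ((codingYx P G (f j) (C37 j) (C38 j)).bg.mul c' c) := by
  intro B δ a hB hδ ha
  obtain ⟨Mg, Cg, -, HG⟩ := globBlock_KSCU_of_eBlock_KSC P (d := d) (ℓ := ℓ) (hd := hd) (hL := hL) (b₀ := b₀) (b₁ := b₁) (Mstar := Mstar) G b hδ hM₂ hrepr
  refine ⟨Mg, 1, a, max (M₂ * (∑ j, ‖b j‖) * (M₂ * (∑ j, ‖b j‖) * B) * Cg) 1, one_pos, ha, le_rfl, lt_max_of_lt_right one_pos,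
    fun j hM _ _ _ _ _ _ _ _ _ _ hE => ?_⟩
  have hglob := HG (f j) (ιB j) (hι j) hM (par j) (C37 j) (C38 j) _ B hB.le hE
  intro n lam γ hγ₁ hγ₂
  exact (hglob n lam γ hγ₁ hγ₂).trans (mul_le_mul_of_nonneg_right (le_max_left _ _) (geo9K_wNorm_nonneg (f j).toKIdx γ lam))

omit [∀ x : MemberY d ℓ hd hL b₀ b₁ Mstar, Fintype (geo9Y x).Site] in
/-- ★ **THE (3.46) OUTPUT DOMINATION FOR `KSCU`, NO THRESHOLD, SAME CONSTANTS** (input `KSC₃`'s block at the product).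
[cite: Balaban1985BackgroundPropagators, Thm 3.1 (3.46) p.398, Thm 3.4 p.400, p.403 l.1–9] -/
theorem houtL2_KSCU_on :
    ∀ (B δ a : ℝ), 0 < B → 0 < δ → 0 < a →
      ∃ (Mo ao a' B' δ' : ℝ), 0 < ao ∧ 0 < a' ∧ a' ≤ a ∧ 0 < B' ∧ 0 < δ' ∧
        ∀ j : J, Mo ≤ (geo9Y (f j)).M → ∀ α₀ : ℝ, 0 < α₀ → (geo9Y (f j)).M * α₀ ≤ ao →
          ∀ c : (codingYx P G (f j) (C37 j) (C38 j)).bg.Cfg, (codingYx P G (f j) (C37 j) (C38 j)).bg.Reg335 c35 α₀ c →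
          ∀ α₁ : ℝ, 0 < α₁ → α₁ ≤ a' → ∀ c' : (codingYx P G (f j) (C37 j) (C38 j)).bg.Cfg, (codingYx P G (f j) (C37 j) (C38 j)).bg.Cplx337 α₁ c c' →
          L2Block (KSC₃ P G (f j) (par j) (C37 j) (C38 j)) B δ ((codingYx P G (f j) (C37 j) (C38 j)).bg.mul c' c) →
          L2Block (KSCU P G (f j) (par j) (C37 j) (C38 j)) B' δ' ((codingYx P G (f j) (C37 j) (C38 j)).bg.mul c' c) :=
  fun B δ a hB hδ ha => ⟨0, 1, a, B, δ, one_pos, ha, le_rfl, hB, hδ, fun j _ _ _ _ _ _ _ _ _ _ _ hL2 => l2Block_KSCU_of_KSC₃ P G (f j) (par j) (C37 j) (C38 j) hL2⟩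

/-- ★★ **`StepEPos` OF `KSCU` over the coded carrier** (input families `(KSCU, KACU, pullS C⁻¹)`; output `KSCU`'s (3.42) block at the product): the coded step
`stepEPos_KSC_on` (with `GA := KACU`, `Cinv := pullS C⁻¹`) transported by `stepEPos_of_family_pos` — `hin_KSCU_on_pos`, `houtE_KSCU_on`.
Displayed: the root frame's structural data (as `B9SectBEGlobAnStepRecordOn`); no plaquette law, no class implication (we stay over the coded carrier).
[cite: Balaban1985BackgroundPropagators, Thm 3.1 (3.42) p.397, Thm 3.4 p.400, (3.60)–(3.64) p.402, p.403 l.1–9, (3.35)–(3.37) p.396; Balaban1984PropagatorsII, Lemma 2.1 p.234, (2.51) p.232] -/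
theorem stepEPos_KSCU_on [∀ x : MemberY d ℓ hd hL b₀ b₁ Mstar, DecidableEq (geo9Y x).Site] [∀ x : MemberY d ℓ hd hL b₀ b₁ Mstar, Nonempty (geo9Y x).Site]
    [NormOneClass 𝔸] [DecidableEq ι]
    (hι : ∀ (j : J) (s : BlkY (f j).toKIdx), β (f j).toKIdx.hN (f j).toKIdx.D (f j).toKIdx.hk (ιB j s) = s)
    (hG1 : ∀ u : 𝔸ˣ, u ∈ G → ‖(u : 𝔸)‖ ≤ 1) (hpar : ∀ j (U : CfgY 𝔸 (f j).toKIdx), GVal G (f j).toKIdx U → ∀ z w, par j U z w ∈ G)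
    (hunit : ∀ j (U : CfgY 𝔸 (f j).toKIdx), GVal G (f j).toKIdx U → IsUnit (deltaPrimeAY (f j).toKIdx (par j) U))
    (dB : ℕ) (M₂ : ℝ) (hM₂ : 0 ≤ M₂) (hrepr : ∀ (v : 𝔸) (j : ι), |b.repr v j| ≤ M₂ * ‖v‖) (hcR : 0 < M₂ * ∑ j, ‖b j‖)
    (Cq : ℝ) (hCq : 0 ≤ Cq) (hC37 : ∀ j β' U a, C37 j β' U a → GVal G (f j).toKIdx U ∧ CplxLettersY G (f j) (par j) (ιB j) Cq β' U a)
    (MInv aInv aW : ℝ) (hMInv : 0 < MInv) (haInv : 0 < aInv) (haW : 0 < aW) :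
    StepEPos dB c35 (fun j => geo9Y (f j)) (fun j => (codingYx P G (f j) (C37 j) (C38 j)).bg)
      (fun j => KSCU P G (f j) (par j) (C37 j) (C38 j)) (fun j => KACU P G (f j) (OA j) (parB j) (C37 j) (C38 j))
      (fun j => pullS (codingYx P G (f j) (C37 j) (C38 j)) (Cinv j)) (fun j => KSCU P G (f j) (par j) (C37 j) (C38 j)) :=
  stepEPos_of_family_pos dB c35 (fun j => geo9Y (f j)) (fun j => (codingYx P G (f j) (C37 j) (C38 j)).bg)
    (fun j => KSC P G (f j) (par j) (C37 j) (C38 j)) (fun j => KSCU P G (f j) (par j) (C37 j) (C38 j))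
    (fun j => KACU P G (f j) (OA j) (parB j) (C37 j) (C38 j)) (fun j => KACU P G (f j) (OA j) (parB j) (C37 j) (C38 j))
    (fun j => pullS (codingYx P G (f j) (C37 j) (C38 j)) (Cinv j))
    (fun j => KSC P G (f j) (par j) (C37 j) (C38 j)) (fun j => KSCU P G (f j) (par j) (C37 j) (C38 j))
    (hin_KSCU_on_pos P f c35 G par OA parB b ιB C37 C38 Cinv hι hG1 hM₂ hrepr dB)
    (houtE_KSCU_on P f c35 G par b ιB C37 C38 hι hM₂ hrepr hcR)
    (stepEPos_KSC_on P f c35 G par b ιB C37 C38 hι hG1 hpar hunit dB M₂ hM₂ hrepr hcR Cq hCq hC37 MInv aInv aW hMInv haInv haW _ _)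

/-- ★★ **`StepGlobPos` OF `KSCU` over the coded carrier** — the (3.47) block at the product recovered from the coded (3.42) step by the generic transfer with
CHANGED output statement (`stepPos_blk_of_family_pos`: `EBlock KSC ↦ GlobBlock KSCU`, `houtEGlob_KSCU_on`).
[cite: Balaban1985BackgroundPropagators, Thm 3.1 (3.47) p.398 + p.398 first remark, Thm 3.4 p.400, p.402 («all the statements (3.42)–(3.47) for G′(U′U)»), p.403 l.1–9; Balaban1984PropagatorsII, Lemma 2.1 p.234] -/
theorem stepGlobPos_KSCU_on [∀ x : MemberY d ℓ hd hL b₀ b₁ Mstar, DecidableEq (geo9Y x).Site] [∀ x : MemberY d ℓ hd hL b₀ b₁ Mstar, Nonempty (geo9Y x).Site]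
    [NormOneClass 𝔸] [DecidableEq ι]
    (hι : ∀ (j : J) (s : BlkY (f j).toKIdx), β (f j).toKIdx.hN (f j).toKIdx.D (f j).toKIdx.hk (ιB j s) = s)
    (hG1 : ∀ u : 𝔸ˣ, u ∈ G → ‖(u : 𝔸)‖ ≤ 1) (hpar : ∀ j (U : CfgY 𝔸 (f j).toKIdx), GVal G (f j).toKIdx U → ∀ z w, par j U z w ∈ G)
    (hunit : ∀ j (U : CfgY 𝔸 (f j).toKIdx), GVal G (f j).toKIdx U → IsUnit (deltaPrimeAY (f j).toKIdx (par j) U))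
    (dB : ℕ) (M₂ : ℝ) (hM₂ : 0 ≤ M₂) (hrepr : ∀ (v : 𝔸) (j : ι), |b.repr v j| ≤ M₂ * ‖v‖) (hcR : 0 < M₂ * ∑ j, ‖b j‖)
    (Cq : ℝ) (hCq : 0 ≤ Cq) (hC37 : ∀ j β' U a, C37 j β' U a → GVal G (f j).toKIdx U ∧ CplxLettersY G (f j) (par j) (ιB j) Cq β' U a)
    (MInv aInv aW : ℝ) (hMInv : 0 < MInv) (haInv : 0 < aInv) (haW : 0 < aW) :
    StepGlobPos dB c35 (fun j => geo9Y (f j)) (fun j => (codingYx P G (f j) (C37 j) (C38 j)).bg)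
      (fun j => KSCU P G (f j) (par j) (C37 j) (C38 j)) (fun j => KACU P G (f j) (OA j) (parB j) (C37 j) (C38 j))
      (fun j => pullS (codingYx P G (f j) (C37 j) (C38 j)) (Cinv j)) (fun j => KSCU P G (f j) (par j) (C37 j) (C38 j)) := by
  refine stepPos_blk_of_family_pos dB c35 (fun j => geo9Y (f j)) (fun j => (codingYx P G (f j) (C37 j) (C38 j)).bg)
    (fun j => KSC P G (f j) (par j) (C37 j) (C38 j)) (fun j => KSCU P G (f j) (par j) (C37 j) (C38 j))
    (fun j => KACU P G (f j) (OA j) (parB j) (C37 j) (C38 j)) (fun j => KACU P G (f j) (OA j) (parB j) (C37 j) (C38 j))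
    (fun j => pullS (codingYx P G (f j) (C37 j) (C38 j)) (Cinv j))
    (C₁ := ℝ × ℝ) (C₂ := ℝ) (pos₁ := fun c => 0 < c.1 ∧ 0 < c.2) (pos₂ := fun c => 0 < c)
    (Blk₁ := fun c j W => EBlock (KSC P G (f j) (par j) (C37 j) (C38 j)) c.1 c.2 W)
    (Blk₂ := fun c j W => GlobBlock (KSCU P G (f j) (par j) (C37 j) (C38 j)) c W)
    (hin_KSCU_on_pos P f c35 G par OA parB b ιB C37 C38 Cinv hι hG1 hM₂ hrepr dB) (fun c hc a ha => ?_)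
    (stepEPos_KSC_on P f c35 G par b ιB C37 C38 hι hG1 hpar hunit dB M₂ hM₂ hrepr hcR Cq hCq hC37 MInv aInv aW hMInv haInv haW _ _)
  obtain ⟨Mo, ao, a', B', hao, ha', ha'a, hB', H⟩ := houtEGlob_KSCU_on P f c35 G par b ιB C37 C38 hι hM₂ hrepr c.1 c.2 a hc.1 hc.2 ha
  exact ⟨Mo, ao, a', B', hao, ha', ha'a, hB', H⟩

/-- ★ **`hin` FOR THE `L²` STEP WITH POSITIVE OUTPUT CONSTANTS** (input families `(KSCU, KACU, pullS C⁻¹)`; output `KSC₃` with the shared `KACU`, `pullS C⁻¹`):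
at a (3.35)-regular base the block is the record's read along the decoding (`thms_KSCU_base_iff`), then `B9SectBL2StepRecordOn.hin_KSC₃_on_explicit` (the
augmented (3.46) member under the plaquette law of the regular base); `KACU`'s Hölder members are nonnegative (§1).
[cite: Balaban1985BackgroundPropagators, Thms 3.1–3.3 (3.42)–(3.48) pp.397–399, (3.35) p.396, p.398 (first remark), p.404 (after (3.69)); Balaban1984PropagatorsII, Lemma 2.1 p.234] -/
theorem hin_KSCU₃_on_pos [∀ x : MemberY d ℓ hd hL b₀ b₁ Mstar, DecidableEq (geo9Y x).Site] [DecidableEq ι]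
    (hι : ∀ (j : J) (s : BlkY (f j).toKIdx), β (f j).toKIdx.hN (f j).toKIdx.D (f j).toKIdx.hk (ιB j s) = s)
    (hG1 : ∀ u : 𝔸ˣ, u ∈ G → ‖(u : 𝔸)‖ ≤ 1) {M₂ : ℝ} (hM₂ : 0 ≤ M₂) (hrepr : ∀ (v : 𝔸) (j : ι), |b.repr v j| ≤ M₂ * ‖v‖) (dC : ℕ)
    {cP : ℝ} (hcP : 0 ≤ cP)
    (hplaq : ∀ (j : J) (α₀ : ℝ) (U : CfgY 𝔸 (f j).toKIdx), (bg9YC 𝔸 G P (f j)).Reg335 c35 α₀ U → PlaqLawY (f j) (ιB j) cP U) :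
    ∀ (B₀ δ₀ : ℝ) (Bβ Bε : ℝ → ℝ) (Bεβ : ℝ → ℝ → ℝ) (B₁ δ₁ : ℝ), 0 < B₀ → 0 < δ₀ → 0 < B₁ → 0 < δ₁ →
      ∃ (Mi ai B₀' δ₀' : ℝ) (Bβ' Bε' : ℝ → ℝ) (Bεβ' : ℝ → ℝ → ℝ) (B₁' δ₁' : ℝ), 0 < ai ∧ 0 < B₀' ∧ 0 < δ₀' ∧ 0 < B₁' ∧ 0 < δ₁' ∧
        ∀ j : J, Mi ≤ (geo9Y (f j)).M → ∀ α₀ : ℝ, 0 < α₀ → (geo9Y (f j)).M * α₀ ≤ ai →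
          ∀ c : (codingYx P G (f j) (C37 j) (C38 j)).bg.Cfg, (codingYx P G (f j) (C37 j) (C38 j)).bg.Reg335 c35 α₀ c →
          B9.Thms31to33IneqAt dC (KSCU P G (f j) (par j) (C37 j) (C38 j)) (KACU P G (f j) (OA j) (parB j) (C37 j) (C38 j))
              (pullS (codingYx P G (f j) (C37 j) (C38 j)) (Cinv j)) B₀ δ₀ Bβ Bε Bεβ B₁ δ₁ c →
          B9.Thms31to33IneqAt dC (KSC₃ P G (f j) (par j) (C37 j) (C38 j)) (KACU P G (f j) (OA j) (parB j) (C37 j) (C38 j))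
              (pullS (codingYx P G (f j) (C37 j) (C38 j)) (Cinv j)) B₀' δ₀' Bβ' Bε' Bεβ' B₁' δ₁' c := by
  intro B₀ δ₀ Bβ Bε Bεβ B₁ δ₁ hB₀ hδ₀ hB₁ hδ₁
  obtain ⟨Mi, ai, B₀', δ₀', Bβ', Bε', Bεβ', B₁', δ₁', hai, hB₀', hδ₀', hB₁', hδ₁', H⟩ :=
    hin_KSC₃_on_explicit P f c35 G par b ιB C37 C38 hι hG1 hM₂ hrepr dC (fun j => KACU P G (f j) (OA j) (parB j) (C37 j) (C38 j))
      (fun j => pullS (codingYx P G (f j) (C37 j) (C38 j)) (Cinv j)) (fun j c => KACU_holder_nonneg P G (f j) (OA j) (parB j) (C37 j) (C38 j) c)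
      hcP hplaq B₀ δ₀ Bβ Bε Bεβ B₁ δ₁ hB₀ hδ₀ hB₁ hδ₁
  refine ⟨Mi, ai, B₀', δ₀', Bβ', Bε', Bεβ', B₁', δ₁', hai, hB₀', hδ₀', hB₁', hδ₁', fun j hM α₀ hα₀ hMa c hreg hT => ?_⟩
  obtain ⟨U, rfl, -⟩ := (codingYx P G (f j) (C37 j) (C38 j)).exists_of_bg_Reg335 hreg
  refine H j hM α₀ hα₀ hMa _ hreg ?_
  obtain ⟨⟨h42, h43⟩, hC, ⟨g42, g43⟩⟩ := (thms_KSCU_base_iff P G (f j) (par j) (OA j) (parB j) (C37 j) (C38 j) dC (Cinv j) B₀ δ₀ Bβ Bε Bεβ B₁ δ₁ U).1 hT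
  obtain ⟨ae, ah1, ae4, ah2, al2, ag⟩ := KACU_members_base P G (f j) (OA j) (parB j) (C37 j) (C38 j) U
  exact ⟨⟨h42, h43⟩, hC, ⟨ineq342_346_347_congr P G (f j) (C37 j) (C38 j) _ _ (fun n => (ae n).symm) (fun n => (al2 n).symm)
    (fun n => (ag n).symm) B₀ δ₀ g42, ineq343_345_congr P G (f j) (C37 j) (C38 j) _ _ ah1.symm ae4.symm ah2.symm Bβ Bε Bεβ δ₀ g43⟩⟩

/-- ★★ **`StepL2Pos` OF `KSCU` over the coded carrier** (all six (3.46) members; input families `(KSCU, KACU, pullS C⁻¹)`): the coded step `stepL2Pos_KSC₃_on`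
(gen 9, with `GA := KACU`, `Cinv := pullS C⁻¹`) transported by `stepL2Pos_of_family_pos` — `hin_KSCU₃_on_pos`, `houtL2_KSCU_on`.  Displayed: the root
frame's structural data and the plaquette law `hplaq` of the regular base (exactly as `B9SectBL2StepRecordOn.stepL2Pos_record_on`).
[cite: Balaban1985BackgroundPropagators, Thm 3.1 (3.46) p.398, Thm 3.4 p.400, (3.63)–(3.67) pp.402–403, p.403 l.1–9, p.404 (after (3.69)); Balaban1984PropagatorsII, Prop. 2.6 (2.140)–(2.141) p.247, Lemma 2.1 p.234] -/
theorem stepL2Pos_KSCU_on [∀ x : MemberY d ℓ hd hL b₀ b₁ Mstar, DecidableEq (geo9Y x).Site] [∀ x : MemberY d ℓ hd hL b₀ b₁ Mstar, Nonempty (geo9Y x).Site]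
    [NormOneClass 𝔸] [DecidableEq ι]
    (hι : ∀ (j : J) (s : BlkY (f j).toKIdx), β (f j).toKIdx.hN (f j).toKIdx.D (f j).toKIdx.hk (ιB j s) = s)
    (hG1 : ∀ u : 𝔸ˣ, u ∈ G → ‖(u : 𝔸)‖ ≤ 1) (hpar : ∀ j (U : CfgY 𝔸 (f j).toKIdx), GVal G (f j).toKIdx U → ∀ z w, par j U z w ∈ G)
    (hunit : ∀ j (U : CfgY 𝔸 (f j).toKIdx), GVal G (f j).toKIdx U → IsUnit (deltaPrimeAY (f j).toKIdx (par j) U))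
    (dB : ℕ) (M₂ : ℝ) (hM₂ : 0 ≤ M₂) (hrepr : ∀ (v : 𝔸) (j : ι), |b.repr v j| ≤ M₂ * ‖v‖) (hcR : 0 < M₂ * ∑ j, ‖b j‖)
    (hcL : 0 < Real.sqrt (Fintype.card ι) * M₂ * ∑ j, ‖b j‖)
    (Cq : ℝ) (hCq : 0 ≤ Cq) (hC37 : ∀ j β' U a, C37 j β' U a → GVal G (f j).toKIdx U ∧ CplxLettersY G (f j) (par j) (ιB j) Cq β' U a)
    (MInv aInv aW : ℝ) (hMInv : 0 < MInv) (haInv : 0 < aInv) (haW : 0 < aW) {cP : ℝ} (hcP : 0 ≤ cP)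
    (hplaq : ∀ (j : J) (α₀ : ℝ) (U : CfgY 𝔸 (f j).toKIdx), (bg9YC 𝔸 G P (f j)).Reg335 c35 α₀ U → PlaqLawY (f j) (ιB j) cP U) :
    StepL2Pos dB c35 (fun j => geo9Y (f j)) (fun j => (codingYx P G (f j) (C37 j) (C38 j)).bg)
      (fun j => KSCU P G (f j) (par j) (C37 j) (C38 j)) (fun j => KACU P G (f j) (OA j) (parB j) (C37 j) (C38 j))
      (fun j => pullS (codingYx P G (f j) (C37 j) (C38 j)) (Cinv j)) (fun j => KSCU P G (f j) (par j) (C37 j) (C38 j)) :=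
  stepL2Pos_of_family_pos dB c35 (fun j => geo9Y (f j)) (fun j => (codingYx P G (f j) (C37 j) (C38 j)).bg)
    (fun j => KSC₃ P G (f j) (par j) (C37 j) (C38 j)) (fun j => KSCU P G (f j) (par j) (C37 j) (C38 j))
    (fun j => KACU P G (f j) (OA j) (parB j) (C37 j) (C38 j)) (fun j => KACU P G (f j) (OA j) (parB j) (C37 j) (C38 j))
    (fun j => KSC₃ P G (f j) (par j) (C37 j) (C38 j)) (fun j => KSCU P G (f j) (par j) (C37 j) (C38 j))
    (fun j => pullS (codingYx P G (f j) (C37 j) (C38 j)) (Cinv j))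
    (hin_KSCU₃_on_pos P f c35 G par OA parB b ιB C37 C38 Cinv hι hG1 hM₂ hrepr dB hcP hplaq)
    (houtL2_KSCU_on P f c35 G par C37 C38)
    (stepL2Pos_KSC₃_on P f c35 G b C37 C38 par ιB hι hG1 hpar hunit dB M₂ hM₂ hrepr hcR hcL Cq hCq hC37 MInv aInv aW hMInv haInv haW _ _)

end Steps

end Literature.MathematicalPhysics.QuantumFieldTheory.Balaban1983to89.B9SectBStepsKSCUBlocksR

end

/-!
# `Balaban1983to89.B9SectBH1FrameCodedYR` — THE CLASS-PARAMETRIC TWIN of `B9SectBH1FrameCodedY` (CASCADE-R, director-ym №279 GO-R; №277 (3) `hunitA` cure; dag-n06-d SOCKET-(α) class question)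

statement-level skeleton of published theorems with citation tags; proofs where landed; nothing here is a claim about the
Yang–Mills mass gap

WHAT THIS FILE IS.  The original module `B9SectBH1FrameCodedY` types its objects over MODULE 3's member carrier `bg9Y 𝔸 G x` (MODULE 2's small-cube class (3.35)).  This file RE-DECLARES, with UNCHANGED NAMES inside the namespace `…B9SectBH1FrameCodedYR`, exactly its 15 class-dependent declarations over the CLASS-PARAMETRIC carrier `B9SectBCodedClassR.bg9YC 𝔸 G P x` (`P : RegExtraY …` = the two cube conditions of (3.35)∕(3.36) as a parameter; `bg9Y 𝔸 G x = bg9YC 𝔸 G (extraY 𝔸 G) x` by `rfl`, so every declaration here specialises definitionally to its original; at the record's reading of PRINT's class, `P := extraYPb 𝔸 G`, the displayed laws `hreg335P` ((3.35) on plaquettes) and the class-keyed `hunitA` become theorems).  The text is the original's VERBATIM under the token surgery `bg9Y 𝔸 G ↦ bg9YC 𝔸 G P`, `NAME ↦ NAME P` for the class-dependent names (P the first explicit argument), and — №277 — the binder `hunitA` re-keyed from «all G-valued U» to «all (3.35)-regular U of the carrier» (`∀ j α₀ U, (bg9YC 𝔸 G P (f j)).Reg335 c35 α₀ U → IsUnit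 (deltaAY …)`).  Class-free declarations of the original are NOT copied: they are imported and used BY NAME (`open … hiding` the re-declared ones).  Generated by dag-n06-c g16's `gen.py` (HOME `pub-ymgap-dag-n06-c/lean/g16/`); the ORIGINAL MODULE DOCUMENTATION FOLLOWS VERBATIM and describes the mathematics.

HONEST SCOPE.  Re-typing bookkeeping; nothing of [B9] asserted beyond the original; COUNT-NEUTRAL; N06 NOT discharged; nothing continuum ∕ OS ∕ mass gap ∕ Clay.  Cell `pub-ymgap` (D-0062), Track A node N06 [B9], seat `pub-ymgap-dag-n06-c` g16, 2026-08-29.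
-/

/-! Module documentation: that of the original `Balaban1983to89.B9SectBH1FrameCodedY` applies verbatim to this twin (not repeated here). -/

noncomputable section

namespace Literature.MathematicalPhysics.QuantumFieldTheory.Balaban1983to89.B9SectBH1FrameCodedYR

open Literature.MathematicalPhysics.QuantumFieldTheory.Balaban1983to89.B9SectBCodedClassR (RegExtraY bg9YC)
open Literature.MathematicalPhysics.QuantumFieldTheory.Balaban1983to89.B9SectBH1FrameCodedY hiding KSC₅ KSC₅_e KSC₅_h1 KSC₅_h1_inl KSC₅_h1_off eBlock_KSC₅_iff h1Block_KSC₅_iff KSC₅_members_base read342Y_KSC₅ write342Y_KSC₅ h1_transfer_KSC₅ h1Frame₃CodedOn stepH1Pos_KSC₅_on hin_KSC₅_on_pos stepH1Pos_KSCU_on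

open B6RandomWalk (HasMajorant hasMajorant_mono BlockSupp)
open B6KLevelCensusIndexV1 (KIdx kGeo)
open B6Ineq2142KLevelV1 (β beta_level)
open B6Prop22KLevelTorusCensusEta (nKT nKT_pos hqTP hqTP_nonneg lenT_le_one geoTP_len)
open B9Thm34Ext (toB6)
open B9FromB6 (EBlock H1Block)
open B9Eq352DivFormLetters (conj coordEquiv gradLetterF gradLetterB)
open B9Eq352GradLetters (diffLetter diffLetter_inl diffLetter_inr)
open B9Thm34SectBUniformR1 (thm34_Gp_uniform)
open B9Thm34HolderGpUniformR1 (thm34_Gp_holderLeft_uniform thm34_Gp_holderRight_uniform)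
open B9SectBGpStepAtLettersV2 (GpFrame₂)
open B9SectBStepWhole (StepPos StepH1Pos)
open B9SectBCodedCarrier (CCfg Coding pullK pullS)
open B9Eq360DeltaPrimeAY (AfldY blkY)
open B9PinMembersKLevelV1 (MemberY geo9Y bg9Y)
open B9SectBGpLettersY (GVal decY coordC blkC GopC letters_base_of_gVal norm_le_one_and_inv_of_mem stencil0_geo9K)
open B9SectBGpFrameCodedYR (codingYx Read342Y Write342Y)
open B9SectBGpFrameCodedY (CplxLettersY)
open B9SectBGpReadingsYR (KSC read342Y_KSC write342Y_KSC)
open B9SectBGpReadingsY (baseY etaS_eq_eta)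
open B9SectBCodedReadingsUR (KSCU KACU)
open B9SectBStepsKSCUR (KACU_members_base ineq342_346_347_congr thms_KSCU_base_iff hin_KSCU_on_pos)
open B9SectBGpTransferInYR (ineq343_345_congr)
open B9SectBCodedChainOnSubfamilyR (gpFrame₂CodedOn)
open B9SectBStepPosFamilyTransfer (stepH1Pos_of_family_pos)
open B9RWSumsReadsNbr (nbr mem_nbr)
open B9GeoNbrCountKLevelV1 (exists_card_nbr_geo9Y_le_of_M)
open B9GeoLemma21KLevelV1 (geo9Y_dist_triangle geo9Y_len_pos)
open B9RWSums347DefiniteFacesWindow (geo9Y_dist_nonneg)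
open B9GeoNormsKLevelModelSignsV1 (modelSignsOn_geo9K)
open Node00 (SiteY BlkY IBondY CfgY BallY SiteParY BondParY BondOpY liftY deltaPrimeAY kernelFamilyS GpY UboxY shiftY etaS cdS cdsS cdS_smul toKT)
open Node00.OpsYRead342 (geo9K_len_congr geo9K_dist_congr)
open B9Ineq349SiteComposite (cdSL cdsSL cdSL_apply cdsSL_apply etaS_pos supBlkS'_le)
open B9SectBH1ReadWriteY (wordS quotS h1ReadT quotS_nonneg h1ReadT_le_of_probes)
open B9SectBH1ProbesY (probeH probeH_apply norm_probeH quotS_wordS_eq Gsc symm_conj_G symm_gradF_G symm_G_negGradB symm_G_gradF cutH_inl_nonneg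
  cutH_inl_eq HolderLipY quot_undiff_le quotL_blockSupp_le quotR_blockSupp_le quotRF_cross_symm_le norm_symm_apply_le_of_hasMajorant
  blockSupp_coordEquiv_liftY)

/-! ## §1 The (3.43) frame with the (3.42) input constant displayed in the writing function -/

section Frame

universe u

variable {I : Type} (d : ℕ) (c35 : ℝ) (geo : I → B9.Geometry) (bg : I → B9.Backgrounds)
  (Gp : ∀ i, B9.KernelFamily (geo i) (bg i))
  {𝔸 : Type u} [NormedRing 𝔸] [NormedAlgebra ℂ 𝔸] [CompleteSpace 𝔸] {ι : Type} [Fintype ι] [DecidableEq ι]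
  (b : Module.Basis ι ℝ 𝔸) (κ : Type) [Fintype κ]
  (S : I → Type) [∀ i, Fintype (S i)] [∀ i, DecidableEq (S i)]
  [∀ i, Fintype (geo i).Site] [∀ i, DecidableEq (geo i).Site] [∀ i, Nonempty (geo i).Site]

variable {d c35 geo bg Gp b κ S}

end Frame

/-! ## §2 The family `KSC₅` (augmented (3.42) reading, U-letter Hölder member) and its (3.42) dictionaries -/

variable {d ℓ : ℕ} {hd : 1 ≤ d + 1} {hL : Odd (ℓ + 1) ∧ 1 < ℓ + 1} {b₀ b₁ : ℝ} {Mstar : ℕ}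
variable {𝔸 : Type} [NormedRing 𝔸] (P : RegExtraY d ℓ hd hL b₀ b₁ Mstar 𝔸) [NormedAlgebra ℂ 𝔸] [CompleteSpace 𝔸] [FiniteDimensional ℝ 𝔸]

section Family

variable (G : Subgroup 𝔸ˣ) (x : MemberY d ℓ hd hL b₀ b₁ Mstar) (par : SiteParY 𝔸 x.toKIdx) {ι : Type} [Fintype ι] (b : Module.Basis ι ℝ 𝔸)
  (ιB : BlkY x.toKIdx → IBondY x.toKIdx) (C37 C38 : ℝ → CfgY 𝔸 x.toKIdx → AfldY 𝔸 x.toKIdx → Prop)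

/-- ★ **`KSC₅`** — g7's augmented coded reading `KSC` of NODE 00's `G′` with the Hölder member REPLACED by the U-letter one of `KSCU` (R13-U1: the operator
`G′(dec c)`, the differences and the transporter of `base c`). The family the (3.43) frame is instantiated for.
[cite: Balaban1985BackgroundPropagators, (3.42)–(3.43) pp.397–398, Thm 3.4 p.400, p.403 l.1–9] -/
def KSC₅ : B9.KernelFamily (geo9Y x) (codingYx P G x C37 C38).bg :=
  { KSC P G x par C37 C38 with h1 := (KSCU P G x par C37 C38).h1 }

omit [FiniteDimensional ℝ 𝔸] in
/-- the (3.42) member of `KSC₅` is `KSC`'s (`rfl`). [cite: Balaban1985BackgroundPropagators, (3.42) p.397, bookkeeping] -/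
theorem KSC₅_e : (KSC₅ P G x par C37 C38).e = (KSC P G x par C37 C38).e := rfl

omit [FiniteDimensional ℝ 𝔸] in
/-- the (3.43) member of `KSC₅` is `KSCU`'s (`rfl`). [cite: Balaban1985BackgroundPropagators, (3.43) p.398, bookkeeping] -/
theorem KSC₅_h1 : (KSC₅ P G x par C37 C38).h1 = (KSCU P G x par C37 C38).h1 := rfl

omit [FiniteDimensional ℝ 𝔸] in
/-- the (3.43) member of `KSC₅` on site arguments: the U-letter reading `h1ReadT (G′(dec c)) (par (base c)) (base c)` (`rfl`).
[cite: Balaban1985BackgroundPropagators, (3.43) p.398, p.403 l.4–7, bookkeeping] -/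
theorem KSC₅_h1_inl (c : (codingYx P G x C37 C38).bg.Cfg) (f : SiteY x.toKIdx → ℝ) (α : ℝ) (z : SiteY x.toKIdx → ℝ) :
    (KSC₅ P G x par C37 C38).h1 c (.inl f) α (.inl z) =
      h1ReadT x.toKIdx (GpY x.toKIdx par (decY x.toKIdx c)) (par (baseY x.toKIdx c)) (baseY x.toKIdx c) f α z := rfl

omit [FiniteDimensional ℝ 𝔸] in
/-- the (3.43) member of `KSC₅` vanishes off the (site argument, site cut-off) sector (`rfl` ×3).
[cite: Balaban1985BackgroundPropagators, (3.43) p.398, bookkeeping] -/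
theorem KSC₅_h1_off (c : (codingYx P G x C37 C38).bg.Cfg) (α : ℝ) :
    (∀ (f : SiteY x.toKIdx → ℝ) (zb : Node00.FBondY x.toKIdx → ℝ), (KSC₅ P G x par C37 C38).h1 c (.inl f) α (.inr zb) = 0) ∧
    (∀ (J : Node00.FBondY x.toKIdx → ℝ) (ζ : (geo9Y x).Cut), (KSC₅ P G x par C37 C38).h1 c (.inr J) α ζ = 0) := by
  refine ⟨fun f zb => rfl, fun J ζ => ?_⟩
  rcases ζ with z | z <;> rfl

omit [FiniteDimensional ℝ 𝔸] in
/-- the (3.42) block of `KSC₅` IS that of `KSC`. [cite: Balaban1985BackgroundPropagators, (3.42) p.397, bookkeeping] -/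
theorem eBlock_KSC₅_iff {B₀ δ : ℝ} (c : (codingYx P G x C37 C38).bg.Cfg) :
    EBlock (KSC₅ P G x par C37 C38) B₀ δ c ↔ EBlock (KSC P G x par C37 C38) B₀ δ c := by
  rw [EBlock, EBlock, KSC₅_e]

omit [FiniteDimensional ℝ 𝔸] in
/-- the (3.43) block of `KSC₅` IS that of `KSCU`. [cite: Balaban1985BackgroundPropagators, (3.43) p.398, bookkeeping] -/
theorem h1Block_KSC₅_iff {Bβ : ℝ → ℝ} {δ : ℝ} (c : (codingYx P G x C37 C38).bg.Cfg) :
    H1Block (KSC₅ P G x par C37 C38) Bβ δ c ↔ H1Block (KSCU P G x par C37 C38) Bβ δ c := by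
  rw [H1Block, H1Block, KSC₅_h1]

omit [FiniteDimensional ℝ 𝔸] in
/-- at a BASE configuration every member of `KSC₅` is `KSC`'s (the Hölder readings agree: `dec (base U) = base (base U) = U`).
[cite: Balaban1985BackgroundPropagators, (3.42)–(3.47) pp.397–398, bookkeeping] -/
theorem KSC₅_members_base (U : CfgY 𝔸 x.toKIdx) :
    (∀ n, (KSC₅ P G x par C37 C38).e n (.base U) = (KSC P G x par C37 C38).e n (.base U)) ∧
    (KSC₅ P G x par C37 C38).h1 (.base U) = (KSC P G x par C37 C38).h1 (.base U) ∧
    (KSC₅ P G x par C37 C38).e4 (.base U) = (KSC P G x par C37 C38).e4 (.base U) ∧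
    (KSC₅ P G x par C37 C38).h2 (.base U) = (KSC P G x par C37 C38).h2 (.base U) ∧
    (∀ n, (KSC₅ P G x par C37 C38).l2 n (.base U) = (KSC P G x par C37 C38).l2 n (.base U)) ∧
    (∀ n, (KSC₅ P G x par C37 C38).glob n (.base U) = (KSC P G x par C37 C38).glob n (.base U)) := by
  refine ⟨fun _ => rfl, ?_, rfl, rfl, fun _ => rfl, fun _ => rfl⟩
  funext lam α ζ
  rcases lam with f | J <;> rcases ζ with z | z <;> rfl

variable [Fintype (geo9Y x).Site]

/-- the (3.42) reading dictionary of `KSC₅` is `KSC`'s. [cite: Balaban1985BackgroundPropagators, (3.42) p.397; Balaban1984PropagatorsII, (2.51) p.232] -/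
theorem read342Y_KSC₅ (hι : ∀ s : BlkY x.toKIdx, β x.toKIdx.hN x.toKIdx.D x.toKIdx.hk (ιB s) = s)
    (M₂ : ℝ) (hM₂ : 0 ≤ M₂) (hrepr : ∀ (v : 𝔸) (j : ι), |b.repr v j| ≤ M₂ * ‖v‖) (c35 MInv aInv : ℝ) :
    Read342Y P G x par b ιB C37 C38 (KSC₅ P G x par C37 C38) c35 (M₂ * ∑ j, ‖b j‖) MInv aInv 0 True :=
  fun α₀ U B₀ δ hM hα₀ hMa hreg hB₀ hδ hE =>
    read342Y_KSC P G x par b ιB C37 C38 hι M₂ hM₂ hrepr c35 MInv aInv α₀ U B₀ δ hM hα₀ hMa hreg hB₀ hδ ((eBlock_KSC₅_iff P G x par C37 C38 _).1 hE)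

omit [FiniteDimensional ℝ 𝔸] in
/-- the (3.42) writing dictionary of `KSC₅` is `KSC`'s. [cite: Balaban1985BackgroundPropagators, (3.42) p.397, p.403; Balaban1984PropagatorsII, (2.51) p.232] -/
theorem write342Y_KSC₅ (hι : ∀ s : BlkY x.toKIdx, β x.toKIdx.hN x.toKIdx.D x.toKIdx.hk (ιB s) = s)
    (M₂ : ℝ) (hM₂ : 0 ≤ M₂) (hrepr : ∀ (v : 𝔸) (j : ι), |b.repr v j| ≤ M₂ * ‖v‖) (aW : ℝ) (hC37 : ∀ β' U a, C37 β' U a → GVal G x.toKIdx U) :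
    Write342Y P G x par b ιB C37 C38 (KSC₅ P G x par C37 C38) (fun B _ => (M₂ * ∑ j, ‖b j‖) * B + 1) (fun δ => δ) aW 0 True :=
  fun U a α₁ B δ hα₁ hα₁W h37 hB hδ hG hDG hGD hLG =>
    (eBlock_KSC₅_iff P G x par C37 C38 _).2 (write342Y_KSC P G x par b ιB C37 C38 hι M₂ hM₂ hrepr aW hC37 U a α₁ B δ hα₁ hα₁W h37 hB hδ hG hDG hGD hLG)

end Family

/-! ## §3 ★★ The transfer field of the (3.43) frame PROVED at def-Y's letters for `KSC₅` -/

section Transfer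

variable [NormOneClass 𝔸] (c35 : ℝ) (G : Subgroup 𝔸ˣ) (x : MemberY d ℓ hd hL b₀ b₁ Mstar) (par : SiteParY 𝔸 x.toKIdx) {ι : Type} [Fintype ι]
  (b : Module.Basis ι ℝ 𝔸) (ιB : BlkY x.toKIdx → IBondY x.toKIdx) [Fintype (geo9Y x).Site]
  (C37 C38 : ℝ → CfgY 𝔸 x.toKIdx → AfldY 𝔸 x.toKIdx → Prop)

omit [FiniteDimensional ℝ 𝔸] in
set_option maxHeartbeats 800000 in
/-- ★★ **THE TRANSFER FIELD OF THE (3.43) FRAME, PROVED FOR `KSC₅` AT def-Y's LETTERS** (see the module header for the proof plan): from r06's per-probe left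
and right Hölder transfers for the letters of the member (hypotheses `HL`, `HR`, the shapes of `H1Frame₃.h1_transfer`), the (3.42) majorants at the base
(`hread`), the (3.42)∕(3.43) blocks of `KSC₅` at the base, the transporter law `HolderLipY` at the regular base and the neighbour count, the (3.43) block of
`KSC₅` at the coded product with `(wH5 … B₀ B_L B_R δc Bβ, 9δc∕10)`.
[cite: Balaban1985BackgroundPropagators, Thm 3.4 p.400, (3.43) p.398, (3.40) p.397, p.403 l.1–9, (3.60)–(3.65) pp.402–403; Balaban1984PropagatorsII, (2.51)–(2.52) p.232, Lemma 2.1 p.234] -/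
theorem h1_transfer_KSC₅ (hι : ∀ s : BlkY x.toKIdx, β x.toKIdx.hN x.toKIdx.D x.toKIdx.hk (ιB s) = s)
    (hG1 : ∀ u : 𝔸ˣ, u ∈ G → ‖(u : 𝔸)‖ ≤ 1) (hpar : ∀ U : CfgY 𝔸 x.toKIdx, GVal G x.toKIdx U → ∀ z w, par U z w ∈ G)
    {M₂ : ℝ} (hM₂ : 0 ≤ M₂) (hrepr : ∀ (v : 𝔸) (j : ι), |b.repr v j| ≤ M₂ * ‖v‖)
    {cLip : ℝ} (hcLip : 0 ≤ cLip) (hLip : ∀ (α₀ : ℝ) (U : CfgY 𝔸 x.toKIdx), (bg9YC 𝔸 G P x).Reg335 c35 α₀ U → HolderLipY x.toKIdx cLip (par U) U)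
    {MInv : ℝ} {mN : ℕ} (hnbr : MInv ≤ (geo9Y x).M → ∀ y' : IBondY x.toKIdx, (nbr (geo9Y x) (2 * ((d : ℝ) + 1)) y').card ≤ mN)
    {cR aInv aW : ℝ} (hcR : 0 < cR) (hread : Read342Y P G x par b ιB C37 C38 (KSC₅ P G x par C37 C38) c35 cR MInv aInv 0 True)
    (α₀ : ℝ) (c c' : (codingYx P G x C37 C38).bg.Cfg) (α₁ B₀ BL BR δ δc : ℝ) (Bβ : ℝ → ℝ)
    (hM : MInv ≤ (geo9Y x).M) (hα₀ : 0 < α₀) (hMa : (geo9Y x).M * α₀ ≤ aInv) (hreg : (codingYx P G x C37 C38).bg.Reg335 c35 α₀ c)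
    (_hα₁ : 0 < α₁) (_haW : α₁ ≤ aW) (h37 : (codingYx P G x C37 C38).bg.Cplx337 α₁ c c') (hB₀ : 0 < B₀) (hBL : 0 ≤ BL) (hBR : 0 ≤ BR)
    (hδ : 0 < δ) (hδc : 0 < δc) (hδcδ : δc ≤ δ)
    (hE : EBlock (KSC₅ P G x par C37 C38) B₀ δ c) (hH1 : H1Block (KSC₅ P G x par C37 C38) Bβ δ c)
    (HL : ∀ (D : Module.End ℝ (SiteY x.toKIdx × ι → ℝ)) (Φ : (SiteY x.toKIdx → 𝔸) →ₗ[ℝ] 𝔸) (y : IBondY x.toKIdx) (p₀ : SiteY x.toKIdx × ι),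
      blkC x.toKIdx ιB p₀.1 = y → ∀ (β Bh cζ : ℝ), 0 ≤ Bh → 0 ≤ cζ →
        (∀ (y' : IBondY x.toKIdx) (μ : SiteY x.toKIdx × ι → ℝ) (M : ℝ),
          BlockSupp (g := toB6 (geo9Y x) (0 : ℝ) True) (fun p : SiteY x.toKIdx × ι => blkC x.toKIdx ιB p.1) μ y' M →
          ‖Φ ((coordEquiv b).symm (D (GopC x.toKIdx par b c μ)))‖ ≤
            Bh * (geo9Y x).len y ^ (1 - β) * cζ * Real.exp (-(δc * (geo9Y x).dist y y')) * M) →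
        ∀ (y' : IBondY x.toKIdx) (μ : SiteY x.toKIdx × ι → ℝ) (M : ℝ),
          BlockSupp (g := toB6 (geo9Y x) (0 : ℝ) True) (fun p : SiteY x.toKIdx × ι => blkC x.toKIdx ιB p.1) μ y' M →
          ‖Φ ((coordEquiv b).symm (D (GopC x.toKIdx par b ((codingYx P G x C37 C38).bg.mul c' c) μ)))‖ ≤
            BL * Bh * (geo9Y x).len y ^ (1 - β) * cζ * Real.exp (-(9 / 10 * δc * (geo9Y x).dist y y')) * M)
    (HR : ∀ (D : Module.End ℝ (SiteY x.toKIdx × ι → ℝ)),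
      HasMajorant (g := toB6 (geo9Y x) (0 : ℝ) True) (fun p : SiteY x.toKIdx × ι => blkC x.toKIdx ιB p.1) (GopC x.toKIdx par b c * D)
        (fun a a' => cR * B₀ * (geo9Y x).len a * Real.exp (-(δc * (geo9Y x).dist a a'))) →
      ∀ (Φ : (SiteY x.toKIdx → 𝔸) →ₗ[ℝ] 𝔸) (y : IBondY x.toKIdx) (p₀ : SiteY x.toKIdx × ι), blkC x.toKIdx ιB p₀.1 = y →
      ∀ (β Bh cζ : ℝ), 0 ≤ Bh → 0 ≤ cζ →
        (∀ (y' : IBondY x.toKIdx) (μ : SiteY x.toKIdx × ι → ℝ) (M : ℝ),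
          BlockSupp (g := toB6 (geo9Y x) (0 : ℝ) True) (fun p : SiteY x.toKIdx × ι => blkC x.toKIdx ιB p.1) μ y' M →
          ‖Φ ((coordEquiv b).symm (GopC x.toKIdx par b c μ))‖ ≤
            Bh * (geo9Y x).len y ^ (2 - β) * cζ * Real.exp (-(δc * (geo9Y x).dist y y')) * M) →
        (∀ (k : Fin (d + 1) ⊕ Fin (d + 1)) (y' : IBondY x.toKIdx) (μ : SiteY x.toKIdx × ι → ℝ) (M : ℝ),
          BlockSupp (g := toB6 (geo9Y x) (0 : ℝ) True) (fun p : SiteY x.toKIdx × ι => blkC x.toKIdx ιB p.1) μ y' M →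
          ‖Φ ((coordEquiv b).symm
              ((GopC x.toKIdx par b c * conj b (diffLetter (shiftY x.toKIdx) (coordC G x.toKIdx c) ((((geo9Y x).eta : ℂ))⁻¹) k)) μ))‖ ≤
            Bh * (geo9Y x).len y ^ (1 - β) * cζ * Real.exp (-(δc * (geo9Y x).dist y y')) * M) →
        (∀ (y' : IBondY x.toKIdx) (μ : SiteY x.toKIdx × ι → ℝ) (M : ℝ),
          BlockSupp (g := toB6 (geo9Y x) (0 : ℝ) True) (fun p : SiteY x.toKIdx × ι => blkC x.toKIdx ιB p.1) μ y' M →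
          ‖Φ ((coordEquiv b).symm ((GopC x.toKIdx par b c * D) μ))‖ ≤
            Bh * (geo9Y x).len y ^ (1 - β) * cζ * Real.exp (-(δc * (geo9Y x).dist y y')) * M) →
        ∀ (y' : IBondY x.toKIdx) (μ : SiteY x.toKIdx × ι → ℝ) (M : ℝ),
          BlockSupp (g := toB6 (geo9Y x) (0 : ℝ) True) (fun p : SiteY x.toKIdx × ι => blkC x.toKIdx ιB p.1) μ y' M →
          ‖Φ ((coordEquiv b).symm ((GopC x.toKIdx par b ((codingYx P G x C37 C38).bg.mul c' c) * D) μ))‖ ≤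
            BR * Bh * (geo9Y x).len y ^ (1 - β) * cζ * Real.exp (-(9 / 10 * δc * (geo9Y x).dist y y')) * M) :
    H1Block (KSC₅ P G x par C37 C38) (wH5 (2 * ((d : ℝ) + 1)) (∑ j, ‖b j‖) M₂ cR cLip mN B₀ BL BR δc Bβ) (9 / 10 * δc)
      ((codingYx P G x C37 C38).bg.mul c' c) := by
  classical
  letI : Fintype (B9GeoNormsKLevelV1.geo9K x.toKIdx).Site := ‹Fintype (geo9Y x).Site›
  -- the coded pair is (base U, mult a); the product is `prod U a`
  obtain ⟨U, a, rfl, rfl, hCa⟩ := (codingYx P G x C37 C38).exists_of_bg_Cplx337 h37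
  have hU335 : (bg9YC 𝔸 G P x).Reg335 c35 α₀ U := by
    obtain ⟨U', h1, h2⟩ := (codingYx P G x C37 C38).exists_of_bg_Reg335 hreg
    cases h1
    exact h2
  have hU : GVal G x.toKIdx U := hU335.1.1
  -- notation and elementary facts
  set Sb : ℝ := ∑ j, ‖b j‖ with hSb
  have hSb0 : 0 ≤ Sb := Finset.sum_nonneg fun j _ => norm_nonneg _
  set TU : (SiteY x.toKIdx → 𝔸) →ₗ[ℂ] (SiteY x.toKIdx → 𝔸) := GpY x.toKIdx par U with hTU
  set TW : (SiteY x.toKIdx → 𝔸) →ₗ[ℂ] (SiteY x.toKIdx → 𝔸) := GpY x.toKIdx par (decY x.toKIdx (.prod U a)) with hTW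
  have hη : 0 < etaS x.toKIdx := etaS_pos x.toKIdx
  have hco : coordC G x.toKIdx (.base U) = UboxY x.toKIdx U := (letters_base_of_gVal G x.toKIdx par hU).1
  have hGopU : GopC x.toKIdx par b (.base U) = conj b (Gsc x.toKIdx TU) := by
    show conj b (((kGeo x.toKIdx).eta ^ 2) • (GpY x.toKIdx par U).restrictScalars ℝ) = conj b ((etaS x.toKIdx ^ 2) • TU.restrictScalars ℝ)
    rw [etaS_eq_eta]
  have hGopW : GopC x.toKIdx par b ((codingYx P G x C37 C38).bg.mul (.mult a) (.base U)) = conj b (Gsc x.toKIdx TW) := by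
    show conj b (((kGeo x.toKIdx).eta ^ 2) • (GpY x.toKIdx par (decY x.toKIdx (.prod U a))).restrictScalars ℝ) = conj b ((etaS x.toKIdx ^ 2) • TW.restrictScalars ℝ)
    rw [etaS_eq_eta]
  have hDk : ∀ k : Fin (d + 1) ⊕ Fin (d + 1),
      diffLetter (shiftY x.toKIdx) (coordC G x.toKIdx (.base U)) ((((geo9Y x).eta : ℂ))⁻¹) k = diffLetter (shiftY x.toKIdx) (UboxY x.toKIdx U) ((((etaS x.toKIdx : ℝ) : ℂ))⁻¹) k := by
    intro k
    show diffLetter (shiftY x.toKIdx) (coordC G x.toKIdx (.base U)) ((((kGeo x.toKIdx).eta : ℝ) : ℂ))⁻¹ k = _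
    rw [hco, etaS_eq_eta]
  have hUu : ∀ (μ : Fin (d + 1)) (w : SiteY x.toKIdx), ‖((UboxY x.toKIdx U μ w : 𝔸ˣ) : 𝔸)‖ ≤ 1 ∧ ‖(((UboxY x.toKIdx U μ w)⁻¹ : 𝔸ˣ) : 𝔸)‖ ≤ 1 :=
    fun μ w => norm_le_one_and_inv_of_mem G hG1 (hU μ _)
  have hparU : ∀ z w : SiteY x.toKIdx, ‖((par U z w : 𝔸ˣ) : 𝔸)‖ ≤ 1 ∧ ‖(((par U z w)⁻¹ : 𝔸ˣ) : 𝔸)‖ ≤ 1 :=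
    fun z w => norm_le_one_and_inv_of_mem G hG1 (hpar U hU z w)
  have hLipU : HolderLipY x.toKIdx cLip (par U) U := hLip α₀ U hU335
  have hnbrU := hnbr hM
  have hdd : 0 ≤ 2 * ((d : ℝ) + 1) := by positivity
  -- the (3.42) majorants of the letters at the base (rate δ)
  obtain ⟨hm0, hm1, hm2, -⟩ := hread α₀ U B₀ δ hM hα₀ hMa hU335 hB₀ hδ hE
  have hm1' : ∀ ν : Fin (d + 1), HasMajorant (g := toB6 (geo9Y x) (0 : ℝ) True) (fun p : SiteY x.toKIdx × ι => blkC x.toKIdx ιB p.1)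
      (conj b (gradLetterF (shiftY x.toKIdx) (UboxY x.toKIdx U) ((((etaS x.toKIdx : ℝ) : ℂ))⁻¹) ν) * conj b (Gsc x.toKIdx TU))
      (fun a a' => cR * B₀ * (geo9Y x).len a * Real.exp (-(δ * (geo9Y x).dist a a'))) := by
    intro ν
    have h := hm1 (Sum.inl ν)
    rwa [hDk, diffLetter_inl, hGopU] at h
  -- the output block
  intro α lam ζ y y' hα0 hα1 hζ hlam
  have hW5 : 0 ≤ wH5 (2 * ((d : ℝ) + 1)) Sb M₂ cR cLip mN B₀ BL BR δc Bβ α :=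
    wH5_nonneg mN Bβ hSb0 hM₂ hcR.le hcLip hB₀.le hBL hBR α
  have hleny : 0 < (geo9Y x).len y := geo9Y_len_pos x y
  have hcutH : 0 ≤ (geo9Y x).cutH α ζ := (modelSignsOn_geo9K x.toKIdx).cutH_nonneg α ζ
  have hsupN : 0 ≤ (geo9Y x).supNorm lam := (modelSignsOn_geo9K x.toKIdx).supNorm_nonneg lam
  have hRHS : 0 ≤ wH5 (2 * ((d : ℝ) + 1)) Sb M₂ cR cLip mN B₀ BL BR δc Bβ α * (geo9Y x).len y ^ (1 - α) * (geo9Y x).cutH α ζ *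
      Real.exp (-(9 / 10 * δc * (geo9Y x).dist y y')) * (geo9Y x).supNorm lam :=
    mul_nonneg (mul_nonneg (mul_nonneg (mul_nonneg hW5 (Real.rpow_nonneg hleny.le _)) hcutH) (Real.exp_pos _).le) hsupN
  -- only (site argument, site cut-off) is nontrivial
  rcases lam with f | J
  swap
  · rw [(KSC₅_h1_off P G x par C37 C38 _ α).2 J ζ]; exact hRHS
  rcases ζ with ζ₀ | zb
  swap
  · rw [(KSC₅_h1_off P G x par C37 C38 _ α).1 f zb]; exact hRHS
  -- the U-letter reading of `G′(U′U)` at the base `U`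
  rw [KSC₅_h1_inl]
  show h1ReadT x.toKIdx TW (par U) U f α ζ₀ ≤ _
  have hζ' : ∀ w, ζ₀ w ≠ 0 → blkY x.toKIdx w = β x.toKIdx.hN x.toKIdx.D x.toKIdx.hk y := hζ
  -- trivial cut-off: every probe vanishes
  by_cases hζ0 : ∀ w, ζ₀ w = 0
  · refine h1ReadT_le_of_probes x.toKIdx TW (par U) U f α ζ₀ hRHS (fun E μ z z' _ => ?_) (fun E μ z z' _ => ?_) <;>
    · rw [quotS_wordS_eq, probeH_apply]
      simp only [hζ0, Complex.ofReal_zero, zero_smul, B9Eq39Adjoint.R_zero, sub_zero, smul_zero, norm_zero]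
      exact hRHS
  push Not at hζ0
  obtain ⟨w₀, hw₀⟩ := hζ0
  -- the anchor: the labelled block of `w₀ ∈ supp ζ`
  set y₁ : IBondY x.toKIdx := blkC x.toKIdx ιB w₀ with hy₁
  have hy₁β : β x.toKIdx.hN x.toKIdx.D x.toKIdx.hk y₁ = β x.toKIdx.hN x.toKIdx.D x.toKIdx.hk y := by
    show β x.toKIdx.hN x.toKIdx.D x.toKIdx.hk (ιB (blkY x.toKIdx w₀)) = _; rw [hι, hζ' w₀ hw₀]
  have hblk : ∀ w, blkY x.toKIdx w = β x.toKIdx.hN x.toKIdx.D x.toKIdx.hk y → blkC x.toKIdx ιB w = y₁ := by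
    intro w hw; show ιB (blkY x.toKIdx w) = ιB (blkY x.toKIdx w₀); rw [hw, hζ' w₀ hw₀]
  have hlen : (geo9Y x).len y₁ = (geo9Y x).len y := geo9K_len_congr x.toKIdx hy₁β
  have hdist : ∀ t : IBondY x.toKIdx, (geo9Y x).dist y₁ t = (geo9Y x).dist y t := fun t => geo9K_dist_congr x.toKIdx hy₁β rfl
  set yL : IBondY x.toKIdx := ιB (β x.toKIdx.hN x.toKIdx.D x.toKIdx.hk y') with hyL
  have hdistL : (geo9Y x).dist y₁ yL = (geo9Y x).dist y y' := geo9K_dist_congr x.toKIdx hy₁β (hι _)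
  have hlen1 : (geo9Y x).len y₁ ≤ 1 := by rw [hy₁, len_blkC_eq x ιB hι]; exact pow_level_mul_etaS_le_one x _
  have hleny₁ : 0 < (geo9Y x).len y₁ := geo9Y_len_pos x y₁
  haveI : Nontrivial 𝔸 := NormOneClass.nontrivial
  obtain ⟨j₀⟩ := b.index_nonempty
  have hp₀ : blkC x.toKIdx ιB ((w₀, j₀) : SiteY x.toKIdx × ι).1 = y₁ := rfl
  -- constants
  set cζ : ℝ := (geo9Y x).cutH α (Sum.inl ζ₀) with hcζ
  have hcζ0 : 0 ≤ cζ := hcutH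
  have hcζeq : cζ = hqTP (toKT x.toKIdx) α ζ₀ + (toKT x.toKIdx).supF ζ₀ := cutH_inl_eq x.toKIdx α ζ₀
  set Bp : ℝ := max (Bβ α) 0 with hBp
  have hBp0 : 0 ≤ Bp := le_max_right _ _
  set BhL : ℝ := Sb * Bp with hBhL
  have hBhL0 : 0 ≤ BhL := mul_nonneg hSb0 hBp0
  set BhR : ℝ := Sb * (cR * B₀ * (1 + cLip) + Bp * (1 + (mN : ℝ) * (M₂ * Sb) * Real.exp (δc * (2 * ((d : ℝ) + 1))))) with hBhR
  have hBhR0 : 0 ≤ BhR := by positivity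
  -- the (3.43) block at the base, READ: reading bounds for scalar inputs supported in a block, at the call rate δc
  set Wf : IBondY x.toKIdx → ℝ := fun a' => Bp * (geo9Y x).len y₁ ^ (1 - α) * cζ * Real.exp (-(δc * (geo9Y x).dist y₁ a')) with hWf
  have hWf0 : ∀ a', 0 ≤ Wf a' := fun a' =>
    mul_nonneg (mul_nonneg (mul_nonneg hBp0 (Real.rpow_nonneg hleny₁.le _)) hcζ0) (Real.exp_pos _).le
  have hreadU : ∀ (g : SiteY x.toKIdx → ℝ) (a' : IBondY x.toKIdx), (geo9Y x).suppIn (Sum.inl g) a' →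
      h1ReadT x.toKIdx TU (par U) U g α ζ₀ ≤ Wf a' * (geo9Y x).supNorm (Sum.inl g) := by
    intro g a' hg
    have h := hH1 α (Sum.inl g) (Sum.inl ζ₀) y a' hα0 hα1 hζ hg
    rw [KSC₅_h1_inl] at h
    have hN : 0 ≤ (geo9Y x).supNorm (Sum.inl g) := (modelSignsOn_geo9K x.toKIdx).supNorm_nonneg _
    refine (show h1ReadT x.toKIdx TU (par U) U g α ζ₀ ≤ _ from h).trans ?_
    rw [← hlen, ← hdist]
    have hP : 0 ≤ (geo9Y x).len y₁ ^ (1 - α) * cζ := mul_nonneg (Real.rpow_nonneg hleny₁.le _) hcζ0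
    have hexp : Real.exp (-(δ * (geo9Y x).dist y₁ a')) ≤ Real.exp (-(δc * (geo9Y x).dist y₁ a')) :=
      Real.exp_le_exp.2 (by nlinarith [geo9Y_dist_nonneg x y₁ a'])
    calc Bβ α * (geo9Y x).len y₁ ^ (1 - α) * (geo9Y x).cutH α (Sum.inl ζ₀) * Real.exp (-(δ * (geo9Y x).dist y₁ a')) *
          (geo9Y x).supNorm (Sum.inl g)
        = Bβ α * (((geo9Y x).len y₁ ^ (1 - α) * cζ) * Real.exp (-(δ * (geo9Y x).dist y₁ a')) * (geo9Y x).supNorm (Sum.inl g)) := by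
          rw [hcζ]; ring
      _ ≤ Bp * (((geo9Y x).len y₁ ^ (1 - α) * cζ) * Real.exp (-(δc * (geo9Y x).dist y₁ a')) * (geo9Y x).supNorm (Sum.inl g)) := by
          refine mul_le_mul (le_max_left _ _) ?_ (mul_nonneg (mul_nonneg hP (Real.exp_pos _).le) hN) hBp0
          exact mul_le_mul_of_nonneg_right (mul_le_mul_of_nonneg_left hexp hP) hN
      _ = Wf a' * (geo9Y x).supNorm (Sum.inl g) := by rw [hWf]; ring
  -- the block support of the coordinates of the output input `f ⊗ E`
  have hBS : ∀ {E : 𝔸}, ‖E‖ ≤ 1 → BlockSupp (g := toB6 (geo9Y x) (0 : ℝ) True) (fun p : SiteY x.toKIdx × ι => blkC x.toKIdx ιB p.1)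
      (coordEquiv b (liftY f E)) yL (M₂ * (geo9Y x).supNorm (Sum.inl f)) := fun hE1 =>
    blockSupp_coordEquiv_liftY x.toKIdx b ιB hM₂ hrepr f y' hlam hE1
  ------------------------------------------------------------------
  -- LEFT WORDS: `ζη∇_{U,ν}G′(U′U)(f ⊗ E)`
  ------------------------------------------------------------------
  have hLeft : ∀ (E : BallY 𝔸) (ν : Fin (d + 1)) (z z' : SiteY x.toKIdx), z ≠ z' →
      quotS x.toKIdx (par U) α (wordS x.toKIdx ζ₀ (cdSL x.toKIdx U ν ∘ₗ TW) (liftY f (E : 𝔸))) z z' ≤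
        BL * BhL * (geo9Y x).len y₁ ^ (1 - α) * cζ * Real.exp (-(9 / 10 * δc * (geo9Y x).dist y₁ yL)) * (M₂ * (geo9Y x).supNorm (Sum.inl f)) := by
    intro E ν z z' hne
    have hE1 : ‖(E : 𝔸)‖ ≤ 1 := mem_closedBall_zero_iff.1 E.2
    set D : Module.End ℝ (SiteY x.toKIdx × ι → ℝ) := conj b (gradLetterF (shiftY x.toKIdx) (UboxY x.toKIdx U) ((((etaS x.toKIdx : ℝ) : ℂ))⁻¹) ν) with hD
    set Φ : (SiteY x.toKIdx → 𝔸) →ₗ[ℝ] 𝔸 := probeH x.toKIdx (par U) α ζ₀ z z' with hΦ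
    -- the premise at the base
    have prem : ∀ (y'' : IBondY x.toKIdx) (μ : SiteY x.toKIdx × ι → ℝ) (M : ℝ),
        BlockSupp (g := toB6 (geo9Y x) (0 : ℝ) True) (fun p : SiteY x.toKIdx × ι => blkC x.toKIdx ιB p.1) μ y'' M →
        ‖Φ ((coordEquiv b).symm (D (GopC x.toKIdx par b (.base U) μ)))‖ ≤
          BhL * (geo9Y x).len y₁ ^ (1 - α) * cζ * Real.exp (-(δc * (geo9Y x).dist y₁ y'')) * M := by
      intro y'' μ M hμ
      calc ‖Φ ((coordEquiv b).symm (D (GopC x.toKIdx par b (.base U) μ)))‖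
          = quotS x.toKIdx (par U) α (wordS x.toKIdx ζ₀ (cdSL x.toKIdx U ν ∘ₗ TU) ((coordEquiv b).symm μ)) z z' := by
            rw [quotS_wordS_eq, hGopU, ← Module.End.mul_apply, hD, symm_gradF_G]; rfl
        _ ≤ Sb * (Wf y'' * M) := quotL_blockSupp_le x.toKIdx b ιB TU (par U) U hι hM₂ hrepr α ζ₀ hWf0 hreadU hμ ν hne
        _ = BhL * (geo9Y x).len y₁ ^ (1 - α) * cζ * Real.exp (-(δc * (geo9Y x).dist y₁ y'')) * M := by rw [hWf, hBhL]; ring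
    have concl := HL D Φ y₁ (w₀, j₀) hp₀ α BhL cζ hBhL0 hcζ0 prem yL (coordEquiv b (liftY f (E : 𝔸))) _ (hBS hE1)
    calc quotS x.toKIdx (par U) α (wordS x.toKIdx ζ₀ (cdSL x.toKIdx U ν ∘ₗ TW) (liftY f (E : 𝔸))) z z'
        = ‖Φ ((coordEquiv b).symm (D (GopC x.toKIdx par b ((codingYx P G x C37 C38).bg.mul (.mult a) (.base U)) (coordEquiv b (liftY f (E : 𝔸))))))‖ := by
          rw [quotS_wordS_eq, hGopW, ← Module.End.mul_apply, hD, symm_gradF_G, LinearEquiv.symm_apply_apply]; rfl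
      _ ≤ _ := concl
  ------------------------------------------------------------------
  -- RIGHT WORDS: `ζηG′(U′U)∇*_{U,ν}(f ⊗ E)`
  ------------------------------------------------------------------
  have hRight : ∀ (E : BallY 𝔸) (ν : Fin (d + 1)) (z z' : SiteY x.toKIdx), z ≠ z' →
      quotS x.toKIdx (par U) α (wordS x.toKIdx ζ₀ (TW ∘ₗ cdsSL x.toKIdx U ν) (liftY f (E : 𝔸))) z z' ≤
        BR * BhR * (geo9Y x).len y₁ ^ (1 - α) * cζ * Real.exp (-(9 / 10 * δc * (geo9Y x).dist y₁ yL)) * (M₂ * (geo9Y x).supNorm (Sum.inl f)) := by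
    intro E ν z z' hne
    have hE1 : ‖(E : 𝔸)‖ ≤ 1 := mem_closedBall_zero_iff.1 E.2
    -- the right letter IN THE FRAME's SYNTAX
    set D' : Module.End ℝ (SiteY x.toKIdx × ι → ℝ) := conj b (diffLetter (shiftY x.toKIdx) (coordC G x.toKIdx (.base U)) ((((geo9Y x).eta : ℂ))⁻¹) (Sum.inr ν))
      with hD'
    have hD'U : D' = conj b (-gradLetterB (shiftY x.toKIdx) (UboxY x.toKIdx U) ((((etaS x.toKIdx : ℝ) : ℂ))⁻¹) ν) := by rw [hD', hDk, diffLetter_inr]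
    set Φ : (SiteY x.toKIdx → 𝔸) →ₗ[ℝ] 𝔸 := probeH x.toKIdx (par U) α ζ₀ z z' with hΦ
    -- (1) the (3.42)₃ majorant of `G′(U)D′` at the call rate
    have hmaj : HasMajorant (g := toB6 (geo9Y x) (0 : ℝ) True) (fun p : SiteY x.toKIdx × ι => blkC x.toKIdx ιB p.1) (GopC x.toKIdx par b (.base U) * D')
        (fun a a' => cR * B₀ * (geo9Y x).len a * Real.exp (-(δc * (geo9Y x).dist a a'))) := by
      refine hasMajorant_mono _ (hm2 (Sum.inr ν)) fun a a' => ?_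
      refine mul_le_mul_of_nonneg_left (Real.exp_le_exp.2 (by nlinarith [geo9Y_dist_nonneg x a a'])) ?_
      exact mul_nonneg (mul_pos hcR hB₀).le (geo9Y_len_pos x a).le
    -- (2) the right-word premise at a backward letter (shared by (b′)-inr and (c′))
    have hbinr : ∀ (ν' : Fin (d + 1)) (y'' : IBondY x.toKIdx) (μ : SiteY x.toKIdx × ι → ℝ) (M : ℝ),
        BlockSupp (g := toB6 (geo9Y x) (0 : ℝ) True) (fun p : SiteY x.toKIdx × ι => blkC x.toKIdx ιB p.1) μ y'' M →
        ‖Φ ((coordEquiv b).symm ((GopC x.toKIdx par b (.base U) *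
            conj b (diffLetter (shiftY x.toKIdx) (coordC G x.toKIdx (.base U)) ((((geo9Y x).eta : ℂ))⁻¹) (Sum.inr ν'))) μ))‖ ≤
          BhR * (geo9Y x).len y₁ ^ (1 - α) * cζ * Real.exp (-(δc * (geo9Y x).dist y₁ y'')) * M := by
      intro ν' y'' μ M hμ
      have hfac : 0 ≤ (geo9Y x).len y₁ ^ (1 - α) * cζ * Real.exp (-(δc * (geo9Y x).dist y₁ y'')) * M :=
        mul_nonneg (mul_nonneg (mul_nonneg (Real.rpow_nonneg hleny₁.le _) hcζ0) (Real.exp_pos _).le) hμ.nonneg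
      calc ‖Φ ((coordEquiv b).symm ((GopC x.toKIdx par b (.base U) *
              conj b (diffLetter (shiftY x.toKIdx) (coordC G x.toKIdx (.base U)) ((((geo9Y x).eta : ℂ))⁻¹) (Sum.inr ν'))) μ))‖
          = quotS x.toKIdx (par U) α (wordS x.toKIdx ζ₀ (TU ∘ₗ cdsSL x.toKIdx U ν') ((coordEquiv b).symm μ)) z z' := by
            rw [quotS_wordS_eq, hDk, diffLetter_inr, hGopU, symm_G_negGradB, map_neg, norm_neg]; rfl
        _ ≤ Sb * (Wf y'' * M) := quotR_blockSupp_le x.toKIdx b ιB TU (par U) U hι hM₂ hrepr α ζ₀ hWf0 hreadU hμ ν' hne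
        _ = (Sb * Bp) * ((geo9Y x).len y₁ ^ (1 - α) * cζ * Real.exp (-(δc * (geo9Y x).dist y₁ y'')) * M) := by rw [hWf]; ring
        _ ≤ BhR * ((geo9Y x).len y₁ ^ (1 - α) * cζ * Real.exp (-(δc * (geo9Y x).dist y₁ y'')) * M) := by
            refine mul_le_mul_of_nonneg_right ?_ hfac
            rw [hBhR]
            refine mul_le_mul_of_nonneg_left ?_ hSb0
            have h1 : 0 ≤ cR * B₀ * (1 + cLip) := by positivity
            have h2 : Bp ≤ Bp * (1 + (mN : ℝ) * (M₂ * Sb) * Real.exp (δc * (2 * ((d : ℝ) + 1)))) :=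
              le_mul_of_one_le_right hBp0 (le_add_of_nonneg_right (by positivity))
            linarith
        _ = BhR * (geo9Y x).len y₁ ^ (1 - α) * cζ * Real.exp (-(δc * (geo9Y x).dist y₁ y'')) * M := by ring
    -- (3) premise (a′): the undifferentiated probe (`probe_undiff_le`)
    have hm0' : HasMajorant (g := toB6 (geo9Y x) (0 : ℝ) True) (fun p : SiteY x.toKIdx × ι => blkC x.toKIdx ιB p.1) (conj b (Gsc x.toKIdx TU))
        (fun a a' => cR * B₀ * (geo9Y x).len a ^ 2 * Real.exp (-(δ * (geo9Y x).dist a a'))) := by rw [← hGopU]; exact hm0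
    have prema : ∀ (y'' : IBondY x.toKIdx) (μ : SiteY x.toKIdx × ι → ℝ) (M : ℝ),
        BlockSupp (g := toB6 (geo9Y x) (0 : ℝ) True) (fun p : SiteY x.toKIdx × ι => blkC x.toKIdx ιB p.1) μ y'' M →
        ‖Φ ((coordEquiv b).symm (GopC x.toKIdx par b (.base U) μ))‖ ≤
          BhR * (geo9Y x).len y₁ ^ (2 - α) * cζ * Real.exp (-(δc * (geo9Y x).dist y₁ y'')) * M := by
      intro y'' μ M hμ
      have h := probe_undiff_le x par b ιB hι hcLip hLipU hparU TU (mul_pos hcR hB₀).le hδcδ hm0' hm1' hα0 hα1.le ζ₀ hζ' hw₀ hμ hne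
      rw [hGopU]
      refine h.trans ?_
      have hfac : 0 ≤ (geo9Y x).len y₁ ^ (2 - α) * cζ * Real.exp (-(δc * (geo9Y x).dist y₁ y'')) * M :=
        mul_nonneg (mul_nonneg (mul_nonneg (Real.rpow_nonneg hleny₁.le _) hcζ0) (Real.exp_pos _).le) hμ.nonneg
      have hle : Sb * (cR * B₀ * (1 + cLip)) ≤ BhR := by
        rw [hBhR]
        exact mul_le_mul_of_nonneg_left (le_add_of_nonneg_right (by positivity)) hSb0
      calc (Sb * (cR * B₀ * (1 + cLip))) * (geo9Y x).len y₁ ^ (2 - α) * cζ * Real.exp (-(δc * (geo9Y x).dist y₁ y'')) * M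
          = (Sb * (cR * B₀ * (1 + cLip))) * ((geo9Y x).len y₁ ^ (2 - α) * cζ * Real.exp (-(δc * (geo9Y x).dist y₁ y'')) * M) := by ring
        _ ≤ BhR * ((geo9Y x).len y₁ ^ (2 - α) * cζ * Real.exp (-(δc * (geo9Y x).dist y₁ y'')) * M) := mul_le_mul_of_nonneg_right hle hfac
        _ = _ := by ring
    -- (4) premise (b′): every letter `∇♯_k` on the right of `G′(U)` (forward letters through the CROSS read `probe_cross_le`)
    have premb : ∀ (k : Fin (d + 1) ⊕ Fin (d + 1)) (y'' : IBondY x.toKIdx) (μ : SiteY x.toKIdx × ι → ℝ) (M : ℝ),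
        BlockSupp (g := toB6 (geo9Y x) (0 : ℝ) True) (fun p : SiteY x.toKIdx × ι => blkC x.toKIdx ιB p.1) μ y'' M →
        ‖Φ ((coordEquiv b).symm ((GopC x.toKIdx par b (.base U) *
            conj b (diffLetter (shiftY x.toKIdx) (coordC G x.toKIdx (.base U)) ((((geo9Y x).eta : ℂ))⁻¹) k)) μ))‖ ≤
          BhR * (geo9Y x).len y₁ ^ (1 - α) * cζ * Real.exp (-(δc * (geo9Y x).dist y₁ y'')) * M := by
      intro k y'' μ M hμ
      rcases k with ν' | ν'
      · have h := probe_cross_le x par b ιB hι hM₂ hrepr hUu hnbrU TU α ζ₀ hBp0 hcζ0 hδc hreadU hμ ν' hne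
        rw [hDk, diffLetter_inl, hGopU]
        refine h.trans ?_
        have hfac : 0 ≤ (geo9Y x).len y₁ ^ (1 - α) * cζ * Real.exp (-(δc * (geo9Y x).dist y₁ y'')) * M :=
          mul_nonneg (mul_nonneg (mul_nonneg (Real.rpow_nonneg hleny₁.le _) hcζ0) (Real.exp_pos _).le) hμ.nonneg
        have hle : Sb * (Bp * ((mN : ℝ) * (M₂ * Sb) * Real.exp (δc * (2 * ((d : ℝ) + 1))))) ≤ BhR := by
          rw [hBhR]
          refine mul_le_mul_of_nonneg_left ?_ hSb0
          have h1 : 0 ≤ cR * B₀ * (1 + cLip) := by positivity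
          have h2 : Bp * ((mN : ℝ) * (M₂ * Sb) * Real.exp (δc * (2 * ((d : ℝ) + 1)))) ≤
              Bp * (1 + (mN : ℝ) * (M₂ * Sb) * Real.exp (δc * (2 * ((d : ℝ) + 1)))) :=
            mul_le_mul_of_nonneg_left (le_add_of_nonneg_left zero_le_one) hBp0
          linarith
        calc (∑ j, ‖b j‖) * (Bp * ((mN : ℝ) * (M₂ * ∑ j, ‖b j‖) * Real.exp (δc * (2 * ((d : ℝ) + 1))))) *
              ((geo9Y x).len y₁ ^ (1 - α) * cζ * Real.exp (-(δc * (geo9Y x).dist y₁ y'')) * M)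
            ≤ BhR * ((geo9Y x).len y₁ ^ (1 - α) * cζ * Real.exp (-(δc * (geo9Y x).dist y₁ y'')) * M) := mul_le_mul_of_nonneg_right hle hfac
          _ = _ := by ring
      · exact hbinr ν' y'' μ M hμ
    -- (5) premise (c′) and the conclusion of the right transfer
    have concl := HR D' hmaj Φ y₁ (w₀, j₀) hp₀ α BhR cζ hBhR0 hcζ0 prema premb (fun y'' μ M hμ => by rw [hD']; exact hbinr ν y'' μ M hμ)
      yL (coordEquiv b (liftY f (E : 𝔸))) _ (hBS hE1)
    calc quotS x.toKIdx (par U) α (wordS x.toKIdx ζ₀ (TW ∘ₗ cdsSL x.toKIdx U ν) (liftY f (E : 𝔸))) z z'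
        = ‖Φ ((coordEquiv b).symm ((GopC x.toKIdx par b ((codingYx P G x C37 C38).bg.mul (.mult a) (.base U)) * D')
            (coordEquiv b (liftY f (E : 𝔸)))))‖ := by
          rw [quotS_wordS_eq, hD'U, hGopW, symm_G_negGradB, LinearEquiv.symm_apply_apply, map_neg, norm_neg]; rfl
      _ ≤ _ := concl
  ------------------------------------------------------------------
  -- WRITE the (3.43) block of the reading at the product
  ------------------------------------------------------------------
  have hfacN : 0 ≤ (geo9Y x).len y ^ (1 - α) * cζ * Real.exp (-(9 / 10 * δc * (geo9Y x).dist y y')) * (geo9Y x).supNorm (Sum.inl f) :=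
    mul_nonneg (mul_nonneg (mul_nonneg (Real.rpow_nonneg hleny.le _) hcζ0) (Real.exp_pos _).le) hsupN
  have hfinal : ∀ {Bside Bh : ℝ}, 0 ≤ Bside → 0 ≤ Bh → M₂ * (Bside * Bh) ≤ wH5 (2 * ((d : ℝ) + 1)) Sb M₂ cR cLip mN B₀ BL BR δc Bβ α →
      Bside * Bh * (geo9Y x).len y₁ ^ (1 - α) * cζ * Real.exp (-(9 / 10 * δc * (geo9Y x).dist y₁ yL)) * (M₂ * (geo9Y x).supNorm (Sum.inl f)) ≤
        wH5 (2 * ((d : ℝ) + 1)) Sb M₂ cR cLip mN B₀ BL BR δc Bβ α * (geo9Y x).len y ^ (1 - α) * (geo9Y x).cutH α (Sum.inl ζ₀) *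
          Real.exp (-(9 / 10 * δc * (geo9Y x).dist y y')) * (geo9Y x).supNorm (Sum.inl f) := by
    intro Bside Bh hBs hBh hle
    rw [hlen, hdistL, ← hcζ]
    calc Bside * Bh * (geo9Y x).len y ^ (1 - α) * cζ * Real.exp (-(9 / 10 * δc * (geo9Y x).dist y y')) * (M₂ * (geo9Y x).supNorm (Sum.inl f))
        = (M₂ * (Bside * Bh)) * ((geo9Y x).len y ^ (1 - α) * cζ * Real.exp (-(9 / 10 * δc * (geo9Y x).dist y y')) * (geo9Y x).supNorm (Sum.inl f)) := by
          ring
      _ ≤ wH5 (2 * ((d : ℝ) + 1)) Sb M₂ cR cLip mN B₀ BL BR δc Bβ α *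
            ((geo9Y x).len y ^ (1 - α) * cζ * Real.exp (-(9 / 10 * δc * (geo9Y x).dist y y')) * (geo9Y x).supNorm (Sum.inl f)) :=
          mul_le_mul_of_nonneg_right hle hfacN
      _ = _ := by ring
  have hwL : M₂ * (BL * BhL) ≤ wH5 (2 * ((d : ℝ) + 1)) Sb M₂ cR cLip mN B₀ BL BR δc Bβ α := by
    show M₂ * (BL * (Sb * Bp)) ≤ M₂ * (BL * (Sb * max (Bβ α) 0) + BR * (Sb * (cR * B₀ * (1 + cLip) + max (Bβ α) 0 *
      (1 + (mN : ℝ) * (M₂ * Sb) * Real.exp (δc * (2 * ((d : ℝ) + 1)))))))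
    rw [← hBp]
    exact mul_le_mul_of_nonneg_left (le_add_of_nonneg_right (by positivity)) hM₂
  have hwR : M₂ * (BR * BhR) ≤ wH5 (2 * ((d : ℝ) + 1)) Sb M₂ cR cLip mN B₀ BL BR δc Bβ α := by
    show M₂ * (BR * BhR) ≤ M₂ * (BL * (Sb * max (Bβ α) 0) + BR * (Sb * (cR * B₀ * (1 + cLip) + max (Bβ α) 0 *
      (1 + (mN : ℝ) * (M₂ * Sb) * Real.exp (δc * (2 * ((d : ℝ) + 1)))))))
    rw [← hBp, ← hBhR]
    exact mul_le_mul_of_nonneg_left (le_add_of_nonneg_left (by positivity)) hM₂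
  exact h1ReadT_le_of_probes x.toKIdx TW (par U) U f α ζ₀ hRHS
    (fun E ν z z' hne => (hLeft E ν z z' hne).trans (hfinal hBL hBhL0 hwL))
    (fun E ν z z' hne => (hRight E ν z z' hne).trans (hfinal hBR hBhR0 hwR))

end Transfer

/-! ## §4 ★★ The frame instance over the coded carriers of a subfamily and the (3.43) block-steps -/

section Steps

variable [NormOneClass 𝔸] {J : Type} (f : J → MemberY d ℓ hd hL b₀ b₁ Mstar) [∀ x : MemberY d ℓ hd hL b₀ b₁ Mstar, Fintype (geo9Y x).Site]
  [instDS : ∀ x : MemberY d ℓ hd hL b₀ b₁ Mstar, DecidableEq (geo9Y x).Site] [instNE : ∀ x : MemberY d ℓ hd hL b₀ b₁ Mstar, Nonempty (geo9Y x).Site]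
  (c35 : ℝ) (G : Subgroup 𝔸ˣ) (par : ∀ j : J, SiteParY 𝔸 (f j).toKIdx) (OA : ∀ j : J, BondOpY 𝔸 (f j).toKIdx)
  (parB : ∀ j : J, BondParY 𝔸 (f j).toKIdx) {ι : Type} [Fintype ι] [DecidableEq ι] (b : Module.Basis ι ℝ 𝔸)
  (ιB : ∀ j : J, BlkY (f j).toKIdx → IBondY (f j).toKIdx)
  (C37 C38 : ∀ j : J, ℝ → CfgY 𝔸 (f j).toKIdx → AfldY 𝔸 (f j).toKIdx → Prop)
  (Cinv : ∀ j : J, B9.SiteKernel (geo9Y (f j)) (bg9YC 𝔸 G P (f j)))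

/-- ★★ **THE (3.43) FRAME OVER THE CODED CARRIERS OF A SUBFAMILY, INHABITED FOR `KSC₅`**: the root frame `gpFrame₂CodedOn` (dictionaries `read342Y_KSC₅` ∕
`write342Y_KSC₅`, reading constant `c_R = M₂Σ‖b_j‖`), the writing function `wH5`, `wHδ δc = 9δc∕10`, and the transfer field `h1_transfer_KSC₅`.  Displayed beyond
the root frame's data: the transporter law `hLip` (`Reg335 ⇒ HolderLipY c_Lip (par U) U`) and the neighbour count `hnbr` above the frame's threshold `MInv`.
[cite: Balaban1985BackgroundPropagators, Thm 3.4 p.400, (3.43) p.398, p.403 l.1–9, (3.60)–(3.65) pp.402–403; Balaban1984PropagatorsII, Lemma 2.1 p.234, (2.51)–(2.52) p.232] -/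
noncomputable def h1Frame₃CodedOn (hι : ∀ (j : J) (s : BlkY (f j).toKIdx), β (f j).toKIdx.hN (f j).toKIdx.D (f j).toKIdx.hk (ιB j s) = s)
    (hG1 : ∀ u : 𝔸ˣ, u ∈ G → ‖(u : 𝔸)‖ ≤ 1) (hpar : ∀ j (U : CfgY 𝔸 (f j).toKIdx), GVal G (f j).toKIdx U → ∀ z w, par j U z w ∈ G)
    (hunit : ∀ j (U : CfgY 𝔸 (f j).toKIdx), GVal G (f j).toKIdx U → IsUnit (deltaPrimeAY (f j).toKIdx (par j) U))
    (dB : ℕ) (M₂ : ℝ) (hM₂ : 0 ≤ M₂) (hrepr : ∀ (v : 𝔸) (j : ι), |b.repr v j| ≤ M₂ * ‖v‖) (hcR : 0 < M₂ * ∑ j, ‖b j‖)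
    (Cq : ℝ) (hCq : 0 ≤ Cq) (hC37 : ∀ j β' U a, C37 j β' U a → GVal G (f j).toKIdx U ∧ CplxLettersY G (f j) (par j) (ιB j) Cq β' U a)
    (MInv aInv aW : ℝ) (hMInv : 0 < MInv) (haInv : 0 < aInv) (haW : 0 < aW)
    {cLip : ℝ} (hcLip : 0 ≤ cLip)
    (hLip : ∀ (j : J) (α₀ : ℝ) (U : CfgY 𝔸 (f j).toKIdx), (bg9YC 𝔸 G P (f j)).Reg335 c35 α₀ U → HolderLipY (f j).toKIdx cLip (par j U) U)
    {mN : ℕ} (hnbr : ∀ j : J, MInv ≤ (geo9Y (f j)).M → ∀ y' : IBondY (f j).toKIdx, (nbr (geo9Y (f j)) (2 * ((d : ℝ) + 1)) y').card ≤ mN) :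
    H1Frame₃ c35 (fun j => geo9Y (f j)) (fun j => (codingYx P G (f j) (C37 j) (C38 j)).bg) (fun j => KSC₅ P G (f j) (par j) (C37 j) (C38 j)) b
      (Fin (d + 1)) (fun j => SiteY (f j).toKIdx) :=
  { gpFrame₂CodedOn P f c35 G b C37 C38 par ιB (fun j => KSC₅ P G (f j) (par j) (C37 j) (C38 j)) hι hG1 hpar hunit dB M₂ hM₂ hrepr Cq hCq hC37
      (M₂ * ∑ j, ‖b j‖) hcR (fun B _ => (M₂ * ∑ j, ‖b j‖) * B + 1) (fun B _ hB _ => by positivity) (fun δ => δ) (fun δ hδ => hδ)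
      MInv aInv aW hMInv haInv haW (fun j => read342Y_KSC₅ P G (f j) (par j) b (ιB j) (C37 j) (C38 j) (hι j) M₂ hM₂ hrepr c35 MInv aInv)
      (fun j => write342Y_KSC₅ P G (f j) (par j) b (ιB j) (C37 j) (C38 j) (hι j) M₂ hM₂ hrepr aW fun β' U a h => (hC37 j β' U a h).1) with
    wH := fun B₀ BL BR δc Bβ => wH5 (2 * ((d : ℝ) + 1)) (∑ j, ‖b j‖) M₂ (M₂ * ∑ j, ‖b j‖) cLip mN B₀ BL BR δc Bβ
    wHδ := fun δc => 9 / 10 * δc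
    wHδ_pos := fun δc hδc => by positivity
    h1_transfer := fun j α₀ c c' α₁ B₀ BL BR δ δc Bβ hM hα₀ hMa hreg hα₁ haW' h37 hB₀ hBL hBR hδ hδc hδcδ hE hH1 HL HR =>
      h1_transfer_KSC₅ P c35 G (f j) (par j) b (ιB j) (C37 j) (C38 j) (hι j) hG1 (hpar j) hM₂ hrepr hcLip (hLip j) (hnbr j) hcR
        (read342Y_KSC₅ P G (f j) (par j) b (ιB j) (C37 j) (C38 j) (hι j) M₂ hM₂ hrepr c35 MInv aInv)
        α₀ c c' α₁ B₀ BL BR δ δc Bβ hM hα₀ hMa hreg hα₁ haW' h37 hB₀ hBL hBR hδ hδc hδcδ hE hH1 HL HR }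

/-- ★★ **`StepH1Pos` OF `KSC₅` OVER THE CODED CARRIERS** (any shared `GA`, `Cinv` over the coded background): `stepH1Pos_of_h1Frame₃` on `h1Frame₃CodedOn`.
[cite: Balaban1985BackgroundPropagators, Thm 3.4 p.400, Thm 3.1 (3.43) p.398, (3.60)–(3.65) pp.402–403; Balaban1984PropagatorsII, Lemma 2.1 p.234] -/
theorem stepH1Pos_KSC₅_on (hι : ∀ (j : J) (s : BlkY (f j).toKIdx), β (f j).toKIdx.hN (f j).toKIdx.D (f j).toKIdx.hk (ιB j s) = s)
    (hG1 : ∀ u : 𝔸ˣ, u ∈ G → ‖(u : 𝔸)‖ ≤ 1) (hpar : ∀ j (U : CfgY 𝔸 (f j).toKIdx), GVal G (f j).toKIdx U → ∀ z w, par j U z w ∈ G)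
    (hunit : ∀ j (U : CfgY 𝔸 (f j).toKIdx), GVal G (f j).toKIdx U → IsUnit (deltaPrimeAY (f j).toKIdx (par j) U))
    (dB : ℕ) (M₂ : ℝ) (hM₂ : 0 ≤ M₂) (hrepr : ∀ (v : 𝔸) (j : ι), |b.repr v j| ≤ M₂ * ‖v‖) (hcR : 0 < M₂ * ∑ j, ‖b j‖)
    (Cq : ℝ) (hCq : 0 ≤ Cq) (hC37 : ∀ j β' U a, C37 j β' U a → GVal G (f j).toKIdx U ∧ CplxLettersY G (f j) (par j) (ιB j) Cq β' U a)
    (MInv aInv aW : ℝ) (hMInv : 0 < MInv) (haInv : 0 < aInv) (haW : 0 < aW)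
    {cLip : ℝ} (hcLip : 0 ≤ cLip)
    (hLip : ∀ (j : J) (α₀ : ℝ) (U : CfgY 𝔸 (f j).toKIdx), (bg9YC 𝔸 G P (f j)).Reg335 c35 α₀ U → HolderLipY (f j).toKIdx cLip (par j U) U)
    {mN : ℕ} (hnbr : ∀ j : J, MInv ≤ (geo9Y (f j)).M → ∀ y' : IBondY (f j).toKIdx, (nbr (geo9Y (f j)) (2 * ((d : ℝ) + 1)) y').card ≤ mN)
    (GA : ∀ j : J, B9.KernelFamily (geo9Y (f j)) (codingYx P G (f j) (C37 j) (C38 j)).bg)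
    (CinvC : ∀ j : J, B9.SiteKernel (geo9Y (f j)) (codingYx P G (f j) (C37 j) (C38 j)).bg) :
    StepH1Pos dB c35 (fun j => geo9Y (f j)) (fun j => (codingYx P G (f j) (C37 j) (C38 j)).bg) (fun j => KSC₅ P G (f j) (par j) (C37 j) (C38 j)) GA CinvC
      (fun j => KSC₅ P G (f j) (par j) (C37 j) (C38 j)) :=
  stepH1Pos_of_h1Frame₃ (d := dB)
    (h1Frame₃CodedOn P f c35 G par b ιB C37 C38 hι hG1 hpar hunit dB M₂ hM₂ hrepr hcR Cq hCq hC37 MInv aInv aW hMInv haInv haW hcLip hLip hnbr) GA CinvC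

omit [NormOneClass 𝔸] [FiniteDimensional ℝ 𝔸] [DecidableEq ι] instDS instNE in
/-- ★ **`hin` FOR `KSC₅` WITH POSITIVE OUTPUT CONSTANTS** (input families `(KSCU, KACU, pullS Cinv)`): g11's `hin_KSCU_on_pos` (output `KSC`) followed by the
base congruence `KSC ↦ KSC₅` (every member agrees at a base). [cite: Balaban1985BackgroundPropagators, Thms 3.1–3.3 (3.42)–(3.48) pp.397–399, (3.35) p.396; Balaban1984PropagatorsII, (2.51) p.232] -/
theorem hin_KSC₅_on_pos (hι : ∀ (j : J) (s : BlkY (f j).toKIdx), β (f j).toKIdx.hN (f j).toKIdx.D (f j).toKIdx.hk (ιB j s) = s)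
    (hG1 : ∀ u : 𝔸ˣ, u ∈ G → ‖(u : 𝔸)‖ ≤ 1) {M₂ : ℝ} (hM₂ : 0 ≤ M₂) (hrepr : ∀ (v : 𝔸) (j : ι), |b.repr v j| ≤ M₂ * ‖v‖) (dC : ℕ) :
    ∀ (B₀ δ₀ : ℝ) (Bβ Bε : ℝ → ℝ) (Bεβ : ℝ → ℝ → ℝ) (B₁ δ₁ : ℝ), 0 < B₀ → 0 < δ₀ → 0 < B₁ → 0 < δ₁ →
      ∃ (Mi ai B₀' δ₀' : ℝ) (Bβ' Bε' : ℝ → ℝ) (Bεβ' : ℝ → ℝ → ℝ) (B₁' δ₁' : ℝ), 0 < ai ∧ 0 < B₀' ∧ 0 < δ₀' ∧ 0 < B₁' ∧ 0 < δ₁' ∧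
        ∀ j : J, Mi ≤ (geo9Y (f j)).M → ∀ α₀ : ℝ, 0 < α₀ → (geo9Y (f j)).M * α₀ ≤ ai →
          ∀ c : (codingYx P G (f j) (C37 j) (C38 j)).bg.Cfg, (codingYx P G (f j) (C37 j) (C38 j)).bg.Reg335 c35 α₀ c →
          B9.Thms31to33IneqAt dC (KSCU P G (f j) (par j) (C37 j) (C38 j)) (KACU P G (f j) (OA j) (parB j) (C37 j) (C38 j))
              (pullS (codingYx P G (f j) (C37 j) (C38 j)) (Cinv j)) B₀ δ₀ Bβ Bε Bεβ B₁ δ₁ c →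
          B9.Thms31to33IneqAt dC (KSC₅ P G (f j) (par j) (C37 j) (C38 j)) (KACU P G (f j) (OA j) (parB j) (C37 j) (C38 j))
              (pullS (codingYx P G (f j) (C37 j) (C38 j)) (Cinv j)) B₀' δ₀' Bβ' Bε' Bεβ' B₁' δ₁' c := by
  intro B₀ δ₀ Bβ Bε Bεβ B₁ δ₁ hB₀ hδ₀ hB₁ hδ₁
  obtain ⟨Mi, ai, B₀', δ₀', Bβ', Bε', Bεβ', B₁', δ₁', hai, hB₀', hδ₀', hB₁', hδ₁', H⟩ :=
    hin_KSCU_on_pos P f c35 G par OA parB b ιB C37 C38 Cinv hι hG1 hM₂ hrepr dC B₀ δ₀ Bβ Bε Bεβ B₁ δ₁ hB₀ hδ₀ hB₁ hδ₁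
  refine ⟨Mi, ai, B₀', δ₀', Bβ', Bε', Bεβ', B₁', δ₁', hai, hB₀', hδ₀', hB₁', hδ₁', fun j hM α₀ hα₀ hMa c hreg hT => ?_⟩
  obtain ⟨U, rfl, -⟩ := (codingYx P G (f j) (C37 j) (C38 j)).exists_of_bg_Reg335 hreg
  obtain ⟨⟨h42, h43⟩, hC, hG⟩ := H j hM α₀ hα₀ hMa _ hreg hT
  obtain ⟨se, sh1, se4, sh2, sl2, sg⟩ := KSC₅_members_base P G (f j) (par j) (C37 j) (C38 j) U
  exact ⟨⟨ineq342_346_347_congr P G (f j) (C37 j) (C38 j) _ _ (fun n => (se n).symm) (fun n => (sl2 n).symm) (fun n => (sg n).symm) _ _ h42,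
    ineq343_345_congr P G (f j) (C37 j) (C38 j) _ _ sh1.symm se4.symm sh2.symm _ _ _ _ h43⟩, hC, hG⟩

/-- ★★ **`StepH1Pos` OF `KSCU` OVER THE CODED CARRIER — THE (3.43) MEMBER OF THE SECT.-B STEP OF RECORD IN PRINT's READING (R13-U1), G′ SIDE** (input
families `(KSCU, KACU, pullS Cinv)`, output `KSCU`'s (3.43) block at the product): `stepH1Pos_KSC₅_on` (with `GA := KACU`, `Cinv := pullS Cinv`) transported by
`stepH1Pos_of_family_pos` — `hin_KSC₅_on_pos`, identity output (`KSC₅.h1 = KSCU.h1`).  The neighbour count is taken above its own threshold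
(`exists_card_nbr_geo9Y_le_of_M`, folded into the frame's `MInv`).  Displayed beyond `B9SectBStepsKSCUBlocks.stepEPos_KSCU_on`'s data: the transporter law
`hLip` (`Reg335 ⇒ HolderLipY c_Lip (par U) U`).
[cite: Balaban1985BackgroundPropagators, Thm 3.4 p.400, Thm 3.1 (3.43) p.398, (3.40) p.397, p.403 l.1–9, (3.60)–(3.65) pp.402–403, (3.35)–(3.37) p.396; Balaban1984PropagatorsII, Lemma 2.1 p.234, (2.51)–(2.52) p.232] -/
theorem stepH1Pos_KSCU_on (hι : ∀ (j : J) (s : BlkY (f j).toKIdx), β (f j).toKIdx.hN (f j).toKIdx.D (f j).toKIdx.hk (ιB j s) = s)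
    (hG1 : ∀ u : 𝔸ˣ, u ∈ G → ‖(u : 𝔸)‖ ≤ 1) (hpar : ∀ j (U : CfgY 𝔸 (f j).toKIdx), GVal G (f j).toKIdx U → ∀ z w, par j U z w ∈ G)
    (hunit : ∀ j (U : CfgY 𝔸 (f j).toKIdx), GVal G (f j).toKIdx U → IsUnit (deltaPrimeAY (f j).toKIdx (par j) U))
    (dB : ℕ) (M₂ : ℝ) (hM₂ : 0 ≤ M₂) (hrepr : ∀ (v : 𝔸) (j : ι), |b.repr v j| ≤ M₂ * ‖v‖) (hcR : 0 < M₂ * ∑ j, ‖b j‖)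
    (Cq : ℝ) (hCq : 0 ≤ Cq) (hC37 : ∀ j β' U a, C37 j β' U a → GVal G (f j).toKIdx U ∧ CplxLettersY G (f j) (par j) (ιB j) Cq β' U a)
    (MInv aInv aW : ℝ) (hMInv : 0 < MInv) (haInv : 0 < aInv) (haW : 0 < aW)
    {cLip : ℝ} (hcLip : 0 ≤ cLip)
    (hLip : ∀ (j : J) (α₀ : ℝ) (U : CfgY 𝔸 (f j).toKIdx), (bg9YC 𝔸 G P (f j)).Reg335 c35 α₀ U → HolderLipY (f j).toKIdx cLip (par j U) U) :
    StepH1Pos dB c35 (fun j => geo9Y (f j)) (fun j => (codingYx P G (f j) (C37 j) (C38 j)).bg)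
      (fun j => KSCU P G (f j) (par j) (C37 j) (C38 j)) (fun j => KACU P G (f j) (OA j) (parB j) (C37 j) (C38 j))
      (fun j => pullS (codingYx P G (f j) (C37 j) (C38 j)) (Cinv j)) (fun j => KSCU P G (f j) (par j) (C37 j) (C38 j)) := by
  obtain ⟨ML, mN, hcnt⟩ := exists_card_nbr_geo9Y_le_of_M (d := d) (ℓ := ℓ) (hd := hd) (hL := hL) (b₀ := b₀) (b₁ := b₁) (2 * ((d : ℝ) + 1))
  have hMInv' : 0 < max MInv ML := lt_max_of_lt_left hMInv
  have hnbr : ∀ j : J, max MInv ML ≤ (geo9Y (f j)).M → ∀ y' : IBondY (f j).toKIdx, (nbr (geo9Y (f j)) (2 * ((d : ℝ) + 1)) y').card ≤ mN :=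
    fun j hM y' => hcnt Mstar (f j) (le_trans (le_max_right _ _) hM) y'
  refine stepH1Pos_of_family_pos dB c35 (fun j => geo9Y (f j)) (fun j => (codingYx P G (f j) (C37 j) (C38 j)).bg)
    (fun j => KSC₅ P G (f j) (par j) (C37 j) (C38 j)) (fun j => KSCU P G (f j) (par j) (C37 j) (C38 j))
    (fun j => KACU P G (f j) (OA j) (parB j) (C37 j) (C38 j)) (fun j => KACU P G (f j) (OA j) (parB j) (C37 j) (C38 j))
    (fun j => pullS (codingYx P G (f j) (C37 j) (C38 j)) (Cinv j))
    (fun j => KSC₅ P G (f j) (par j) (C37 j) (C38 j)) (fun j => KSCU P G (f j) (par j) (C37 j) (C38 j))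
    (hin_KSC₅_on_pos P f c35 G par OA parB b ιB C37 C38 Cinv hι hG1 hM₂ hrepr dB)
    (fun Bβ δ a hδ ha => ⟨0, 1, a, Bβ, δ, one_pos, ha, le_rfl, hδ, fun j _ _ _ _ _ _ _ _ _ _ _ h => (h1Block_KSC₅_iff P G (f j) (par j) (C37 j) (C38 j) _).1 h⟩)
    (stepH1Pos_KSC₅_on P f c35 G par b ιB C37 C38 hι hG1 hpar hunit dB M₂ hM₂ hrepr hcR Cq hCq hC37 (max MInv ML) aInv aW hMInv' haInv haW hcLip
      hLip hnbr _ _)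

end Steps

end Literature.MathematicalPhysics.QuantumFieldTheory.Balaban1983to89.B9SectBH1FrameCodedYR

end

/-!
# `Balaban1983to89.B9Eq340HolderLipParSymYR` — THE CLASS-PARAMETRIC TWIN of `B9Eq340HolderLipParSymY` (CASCADE-R, director-ym №279 GO-R; №277 (3) `hunitA` cure; dag-n06-d SOCKET-(α) class question)

statement-level skeleton of published theorems with citation tags; proofs where landed; nothing here is a claim about the
Yang–Mills mass gap

WHAT THIS FILE IS.  The original module `B9Eq340HolderLipParSymY` types its objects over MODULE 3's member carrier `bg9Y 𝔸 G x` (MODULE 2's small-cube class (3.35)).  This file RE-DECLARES, with UNCHANGED NAMES inside the namespace `…B9Eq340HolderLipParSymYR`, exactly its 2 class-dependent declarations over the CLASS-PARAMETRIC carrier `B9SectBCodedClassR.bg9YC 𝔸 G P x` (`P : RegExtraY …` = the two cube conditions of (3.35)∕(3.36) as a parameter; `bg9Y 𝔸 G x = bg9YC 𝔸 G (extraY 𝔸 G) x` by `rfl`, so every declaration here specialises definitionally to its original; at the record's reading of PRINT's class, `P := extraYPb 𝔸 G`, the displayed laws `hreg335P` ((3.35) on plaquettes) and the class-keyed `hunitA`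 become theorems).  The text is the original's VERBATIM under the token surgery `bg9Y 𝔸 G ↦ bg9YC 𝔸 G P`, `NAME ↦ NAME P` for the class-dependent names (P the first explicit argument), and — №277 — the binder `hunitA` re-keyed from «all G-valued U» to «all (3.35)-regular U of the carrier» (`∀ j α₀ U, (bg9YC 𝔸 G P (f j)).Reg335 c35 α₀ U → IsUnit (deltaAY …)`).  Class-free declarations of the original are NOT copied: they are imported and used BY NAME (`open … hiding` the re-declared ones).  Generated by dag-n06-c g16's `gen.py` (HOME `pub-ymgap-dag-n06-c/lean/g16/`); the ORIGINAL MODULE DOCUMENTATION FOLLOWS VERBATIM and describes the mathematics.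

HONEST SCOPE.  Re-typing bookkeeping; nothing of [B9] asserted beyond the original; COUNT-NEUTRAL; N06 NOT discharged; nothing continuum ∕ OS ∕ mass gap ∕ Clay.  Cell `pub-ymgap` (D-0062), Track A node N06 [B9], seat `pub-ymgap-dag-n06-c` g16, 2026-08-29.
-/

/-! Module documentation: that of the original `Balaban1983to89.B9Eq340HolderLipParSymY` applies verbatim to this twin (not repeated here). -/

noncomputable section

namespace Literature.MathematicalPhysics.QuantumFieldTheory.Balaban1983to89.B9Eq340HolderLipParSymYR

open Literature.MathematicalPhysics.QuantumFieldTheory.Balaban1983to89.B9SectBCodedClassR (RegExtraY bg9YC)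
open Literature.MathematicalPhysics.QuantumFieldTheory.Balaban1983to89.B9Eq340HolderLipParSymY hiding hLip_parSymY stepH1Pos_KSCU_parSymY_on

open T4RelativeLadder (UnitaryLike)
open B9BackgroundsKLevelV1 (shiftsV1)
open B9Eq39Adjoint (R covD)
open B9Eq340StepLasso (rungSites taxiSteps)
open B4TorusKernel.MultiPeriod (torusSupNorm)
open B6GlobalChartV1 (boxEquiv boxEquiv_apply PV)
open B6Geom246MultiLevelBox (blkOf)
open B6Geom246MultiLevelTorus (torusSupNorm_neg)
open B6KLevelCensusIndexV1 (KIdx)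
open B6Ineq2142KLevelV1 (β)
open B6Prop22KLevelTorusCensusEta (nKT nKT_pos)
open B9Eq340CovariantLipschitzY (norm_R_parSY_sub_le norm_R_inv_parSY_sub_le length_taxiSteps_le_mul_pdist)
open B9Eq358TaxiLettersY (blkOf_toBox_rung_eq val_sub_corner)
open B9Eq360DeltaPrimeAY (blkY)
open B9PinMembersKLevelV1 (MemberY geo9Y bg9Y)
open B9SectBGpLettersY (GVal norm_le_one_and_inv_of_mem)
open B9SectBH1ProbesY (HolderLipY)
open Node00 (SiteY BlkY CfgY UboxY shiftY etaS cdS supBlkS' parSY parSymY parSymY_of_le parSymY_of_not_le toKT boxEquiv_symm_shiftY)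
open Node00.OpsYHolderFar (pdist pdist_nonneg one_le_NB)
open Node00.OpsYRead342 (norm_le_supBlkS')

variable {d ℓ : ℕ} {hd : 1 ≤ d + 1} {hL : Odd (ℓ + 1) ∧ 1 < ℓ + 1} {b₀ b₁ : ℝ} {Mstar : ℕ}
variable {𝔸 : Type} [NormedRing 𝔸] (P : RegExtraY d ℓ hd hL b₀ b₁ Mstar 𝔸) [NormedAlgebra ℂ 𝔸] [CompleteSpace 𝔸]
variable (i : KIdx d ℓ hd hL b₀ b₁)

/-! ## §1 Tools -/

/-! ## §2 The law for `parSymY` -/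

/-- ★★ **THE BINDER `hLip` OF `B9SectBH1FrameCodedY.stepH1Pos_KSCU_on` AT THE RECORD's TRANSPORTER**: for a subfamily `f` with `par j := parSymY`, at every
(3.35)-regular configuration of the member (hence `G`-valued) the law holds with `c_Lip = d + 1`.
[cite: Balaban1985BackgroundPropagators, (3.40) p.397, (3.35) p.396, Thm 3.4 p.400] -/
theorem hLip_parSymY [NormOneClass 𝔸] {J : Type} (f : J → MemberY d ℓ hd hL b₀ b₁ Mstar) (c35 : ℝ) (G : Subgroup 𝔸ˣ)
    (hG1 : ∀ u : 𝔸ˣ, u ∈ G → ‖(u : 𝔸)‖ ≤ 1) :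
    ∀ (j : J) (α₀ : ℝ) (U : CfgY 𝔸 (f j).toKIdx), (bg9YC 𝔸 G P (f j)).Reg335 c35 α₀ U →
      HolderLipY (f j).toKIdx ((d : ℝ) + 1) (parSymY (f j).toKIdx U) U :=
  fun j _ _ hreg => holderLipY_parSymY_of_gVal (f j).toKIdx G hG1 hreg.1.1

/-! ## §3 The (3.43) block-step of `KSCU` at the record's transporter, law-free -/

section Step

open B9SectBCodedCarrier (pullS)
open B9Eq360DeltaPrimeAY (AfldY)
open B9SectBGpFrameCodedYR (codingYx)
open B9SectBGpFrameCodedY (CplxLettersY)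
open B9SectBCodedReadingsUR (KSCU KACU)
open B9SectBStepWhole (StepH1Pos)
open B9SectBH1FrameCodedYR (stepH1Pos_KSCU_on)
open Node00 (IBondY SiteParY BondParY BondOpY deltaPrimeAY)

variable [NormOneClass 𝔸] [FiniteDimensional ℝ 𝔸] {J : Type} (f : J → MemberY d ℓ hd hL b₀ b₁ Mstar)
  [∀ x : MemberY d ℓ hd hL b₀ b₁ Mstar, Fintype (geo9Y x).Site]
  [instDS : ∀ x : MemberY d ℓ hd hL b₀ b₁ Mstar, DecidableEq (geo9Y x).Site] [instNE : ∀ x : MemberY d ℓ hd hL b₀ b₁ Mstar, Nonempty (geo9Y x).Site]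
  (c35 : ℝ) (G : Subgroup 𝔸ˣ) (OA : ∀ j : J, BondOpY 𝔸 (f j).toKIdx)
  (parB : ∀ j : J, BondParY 𝔸 (f j).toKIdx) {ι : Type} [Fintype ι] [DecidableEq ι] (b : Module.Basis ι ℝ 𝔸)
  (ιB : ∀ j : J, BlkY (f j).toKIdx → IBondY (f j).toKIdx)
  (C37 C38 : ∀ j : J, ℝ → CfgY 𝔸 (f j).toKIdx → AfldY 𝔸 (f j).toKIdx → Prop)
  (Cinv : ∀ j : J, B9.SiteKernel (geo9Y (f j)) (bg9YC 𝔸 G P (f j)))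

/-- ★★ **`StepH1Pos` OF `KSCU` AT THE RECORD's TRANSPORTER `parSymY`, LAW-FREE**: `B9SectBH1FrameCodedY.stepH1Pos_KSCU_on` with `par j := parSymY`, `c_Lip := d+1`
and `hLip := hLip_parSymY` — the (3.43) member of `B9SectBCodedReadingsU.SectBStepU` (G′ side) with exactly the binders of `B9SectBStepsKSCUBlocks.stepEPos_KSCU_on`.
[cite: Balaban1985BackgroundPropagators, Thm 3.4 p.400, Thm 3.1 (3.43) p.398, (3.40) p.397, p.403 l.1–9, (3.35)–(3.37) p.396; Balaban1984PropagatorsII, Lemma 2.1 p.234, (2.51)–(2.52) p.232] -/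
theorem stepH1Pos_KSCU_parSymY_on (hι : ∀ (j : J) (s : BlkY (f j).toKIdx), β (f j).toKIdx.hN (f j).toKIdx.D (f j).toKIdx.hk (ιB j s) = s)
    (hG1 : ∀ u : 𝔸ˣ, u ∈ G → ‖(u : 𝔸)‖ ≤ 1)
    (hpar : ∀ j (U : CfgY 𝔸 (f j).toKIdx), GVal G (f j).toKIdx U → ∀ z w, parSymY (f j).toKIdx U z w ∈ G)
    (hunit : ∀ j (U : CfgY 𝔸 (f j).toKIdx), GVal G (f j).toKIdx U → IsUnit (deltaPrimeAY (f j).toKIdx (parSymY (f j).toKIdx) U))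
    (dB : ℕ) (M₂ : ℝ) (hM₂ : 0 ≤ M₂) (hrepr : ∀ (v : 𝔸) (j : ι), |b.repr v j| ≤ M₂ * ‖v‖) (hcR : 0 < M₂ * ∑ j, ‖b j‖)
    (Cq : ℝ) (hCq : 0 ≤ Cq)
    (hC37 : ∀ j β' U a, C37 j β' U a → GVal G (f j).toKIdx U ∧ CplxLettersY G (f j) (parSymY (f j).toKIdx) (ιB j) Cq β' U a)
    (MInv aInv aW : ℝ) (hMInv : 0 < MInv) (haInv : 0 < aInv) (haW : 0 < aW) :
    StepH1Pos dB c35 (fun j => geo9Y (f j)) (fun j => (codingYx P G (f j) (C37 j) (C38 j)).bg)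
      (fun j => KSCU P G (f j) (parSymY (f j).toKIdx) (C37 j) (C38 j)) (fun j => KACU P G (f j) (OA j) (parB j) (C37 j) (C38 j))
      (fun j => pullS (codingYx P G (f j) (C37 j) (C38 j)) (Cinv j)) (fun j => KSCU P G (f j) (parSymY (f j).toKIdx) (C37 j) (C38 j)) :=
  stepH1Pos_KSCU_on P f c35 G (fun j => parSymY (f j).toKIdx) OA parB b ιB C37 C38 Cinv hι hG1 hpar hunit dB M₂ hM₂ hrepr hcR Cq hCq hC37
    MInv aInv aW hMInv haInv haW (by positivity : (0 : ℝ) ≤ (d : ℝ) + 1) (hLip_parSymY P f c35 G hG1)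

end Step

end Literature.MathematicalPhysics.QuantumFieldTheory.Balaban1983to89.B9Eq340HolderLipParSymYR

end

/-!
# `Balaban1983to89.B9SectBCodedClassGYR` — THE CLASS-PARAMETRIC TWIN of `B9SectBCodedClassGY` (CASCADE-R, director-ym №279 GO-R; №277 (3) `hunitA` cure; dag-n06-d SOCKET-(α) class question)

statement-level skeleton of published theorems with citation tags; proofs where landed; nothing here is a claim about the
Yang–Mills mass gap

WHAT THIS FILE IS.  The original module `B9SectBCodedClassGY` types its objects over MODULE 3's member carrier `bg9Y 𝔸 G x` (MODULE 2's small-cube class (3.35)).  This file RE-DECLARES, with UNCHANGED NAMES inside the namespace `…B9SectBCodedClassGYR`, exactly its 2 class-dependent declarations over the CLASS-PARAMETRIC carrier `B9SectBCodedClassR.bg9YC 𝔸 G P x` (`P : RegExtraY …` = the two cube conditions of (3.35)∕(3.36) as a parameter; `bg9Y 𝔸 G x = bg9YC 𝔸 G (extraY 𝔸 G) x` by `rfl`, so every declaration here specialises definitionally to its original; at the record's reading of PRINT's class, `P := extraYPb 𝔸 G`, the displayed laws `hreg335P` ((3.35) on plaquettes) and the class-keyed `hunitA` become theorems).  The text is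 the original's VERBATIM under the token surgery `bg9Y 𝔸 G ↦ bg9YC 𝔸 G P`, `NAME ↦ NAME P` for the class-dependent names (P the first explicit argument), and — №277 — the binder `hunitA` re-keyed from «all G-valued U» to «all (3.35)-regular U of the carrier» (`∀ j α₀ U, (bg9YC 𝔸 G P (f j)).Reg335 c35 α₀ U → IsUnit (deltaAY …)`).  Class-free declarations of the original are NOT copied: they are imported and used BY NAME (`open … hiding` the re-declared ones).  Generated by dag-n06-c g16's `gen.py` (HOME `pub-ymgap-dag-n06-c/lean/g16/`); the ORIGINAL MODULE DOCUMENTATION FOLLOWS VERBATIM and describes the mathematics.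

HONEST SCOPE.  Re-typing bookkeeping; nothing of [B9] asserted beyond the original; COUNT-NEUTRAL; N06 NOT discharged; nothing continuum ∕ OS ∕ mass gap ∕ Clay.  Cell `pub-ymgap` (D-0062), Track A node N06 [B9], seat `pub-ymgap-dag-n06-c` g16, 2026-08-29.
-/

/-! Module documentation: that of the original `Balaban1983to89.B9SectBCodedClassGY` applies verbatim to this twin (not repeated here). -/

noncomputable section

namespace Literature.MathematicalPhysics.QuantumFieldTheory.Balaban1983to89.B9SectBCodedClassGYR

open Literature.MathematicalPhysics.QuantumFieldTheory.Balaban1983to89.B9SectBCodedClassR (RegExtraY bg9YC)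
open Literature.MathematicalPhysics.QuantumFieldTheory.Balaban1983to89.B9SectBCodedClassGY hiding hclass_C37GY_at hclass_C37GY_on

open Complex
open T4RelativeLadder (UnitaryLike)
open B6GlobalChartV1 (PV boxEquiv)
open B6KLevelCensusIndexV1 (KIdx kGeo)
open B6Ineq2142KLevelV1 (β)
open B9BackgroundsKLevelV1 (shiftsV1 levV1)
open B9Eq39Adjoint (R covD covDstar fluct R_neg R_smul)
open B9Eq352DivForm (tauF tauB)
open B9Eq371Composition (covDstar_eq_neg_R_covD)
open B9Eq335RegularityClasses (Cplx337)
open B9Eq369Small (Through)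
open B9Eq372Locality (stBonds)
open B9Eq375Locality (locBondsA dirBondsA)
open LatticeNorms (scaleLen)
open B9Eq360DeltaPrimeAY (AfldY chartA chartA_apply)
open B9PinMembersKLevelV1 (MemberY geo9Y bg9Y)
open B9SectBGpLettersY (GVal coordC expAC blkC norm_le_one_and_inv_of_mem letters_base_of_gVal)
open B9SectBGpFrameCodedYR (codingYx)
open B9SectBGpFrameCodedY (CplxLettersY)
open B9SectBCodedClassY (C37Y covD_chart norm_R_le_of_unitaryLike len_blkC_eq_scaleLen cplxLettersY_of_cplx337)
open B9Eq359VarParBY (cVarGY cVarGY_nonneg varParBY_mono varParBY_parBY_of_cplx337)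
open B9SectBGClassLettersY (CplxLettersGY VarParBY stencilF_blkC' stencilB_blkC' stencilFB_blkC stencilSt_blkC stencilThrough_blkC stencil0_blkC shiftY_shiftY_symm_comm)
open B9RWSumsCompleteGeo9YNbr (len_le_of_dist_lt_M_geo9K)
open B9GeoLemma21KLevelV1 (geo9Y_len_pos geo9K_eta_pos)
open B9GeoNormsKLevelV1 (geo9K)
open Node00 (SiteY BlkY IBondY CfgY UboxY shiftY parSymY parBY)

variable {𝔸 : Type} [NormedRing 𝔸] [NormedAlgebra ℂ 𝔸] [CompleteSpace 𝔸]
variable {d ℓ : ℕ} {hd : 1 ≤ d + 1} {hL : Odd (ℓ + 1) ∧ 1 < ℓ + 1} {b₀ b₁ : ℝ} {Mstar : ℕ} (P : RegExtraY d ℓ hd hL b₀ b₁ Mstar 𝔸)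

/-! ## §1 Relocation by one stencil step -/

section Relocation

variable (i : KIdx d ℓ hd hL b₀ b₁) (ιB : BlkY i → IBondY i)

end Relocation

/-! ## §2 ★★ The seven further (3.37) letter bounds of the G clause from the record's class -/

section Letters

variable [NormOneClass 𝔸] (G : Subgroup 𝔸ˣ) (x : MemberY d ℓ hd hL b₀ b₁ Mstar) (ιB : BlkY x.toKIdx → IBondY x.toKIdx)

end Letters

/-! ## §3 The extended coded class `C37GY`, its dictionaries `hC37` ∕ `hC37G`, and the chain's class hypothesis -/

section Class

variable [NormOneClass 𝔸] (G : Subgroup 𝔸ˣ) (x : MemberY d ℓ hd hL b₀ b₁ Mstar) (ιB : BlkY x.toKIdx → IBondY x.toKIdx)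

/-- ★★ **`hclass` AT ONE MEMBER FOR THE EXTENDED CLASS**: above `2(d+1) < M`, every `U′` of the record's class (3.37) at a (3.35)-regular `U` and exponent
`0 < α₁ ≦ 1∕4` has the code `a := A′` (`U′ = e^{iηA′}`) in `C37GY` at exponent `L⁴α₁` (g8's `hclass_C37Y_at`, §2, and `varParBY_parBY_of_cplx337` raised
from `α₁` to `L⁴α₁`). [cite: Balaban1985BackgroundPropagators, (3.37) p.396, (3.35) p.396, Thm 3.4 p.400] -/
theorem hclass_C37GY_at (hι : ∀ s : BlkY x.toKIdx, β x.toKIdx.hN x.toKIdx.D x.toKIdx.hk (ιB s) = s)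
    (hG1 : ∀ u : 𝔸ˣ, u ∈ G → ‖(u : 𝔸)‖ ≤ 1) (hdM : 2 * ((d : ℝ) + 1) < (geo9Y x).M) {c35 α₀ α₁ : ℝ} {U U' : (bg9YC 𝔸 G P x).Cfg}
    (hreg : (bg9YC 𝔸 G P x).Reg335 c35 α₀ U) (hα₁ : 0 < α₁) (hα₁4 : α₁ ≤ 1 / 4) (h37 : (bg9YC 𝔸 G P x).Cplx337 α₁ U U') :
    ∃ a : AfldY 𝔸 x.toKIdx, fluct (kGeo x.toKIdx).eta a = U' ∧
      C37GY G x ιB (4 * ((d : ℝ) + 1) * Real.exp (3 * (((d : ℝ) + 1) / 2))) ((((ℓ : ℝ) + 1) ^ 4) * α₁) U a := by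
  obtain ⟨A', hU', hcl⟩ := h37
  have hL4 : (1 : ℝ) ≤ ((ℓ : ℝ) + 1) ^ 4 := one_le_pow₀ (by have : (0 : ℝ) ≤ ℓ := Nat.cast_nonneg _; linarith)
  have hmono : α₁ ≤ (((ℓ : ℝ) + 1) ^ 4) * α₁ := le_mul_of_one_le_left hα₁.le hL4
  exact ⟨A', hU'.symm, ⟨hreg.1.1, cplxLettersY_of_cplx337 G x ιB hι hG1 hdM hreg.1.1 hα₁ hα₁4 hcl⟩,
    cplxLettersGY_of_cplx337 G x ιB hι hG1 hdM hreg.1.1 hα₁.le hcl,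
    varParBY_mono x.toKIdx (parBY x.toKIdx) (cVarGY_nonneg d ℓ) hmono
      (varParBY_parBY_of_cplx337 G x hG1 hreg.1.1 hα₁.le hα₁4 hcl)⟩

end Class

/-! ## §4 `hclass` for the extended class on a subfamily -/

section Family

variable [NormOneClass 𝔸] {J : Type} (f : J → MemberY d ℓ hd hL b₀ b₁ Mstar) (G : Subgroup 𝔸ˣ)
  (ιB : ∀ j : J, BlkY (f j).toKIdx → IBondY (f j).toKIdx) (C38 : ∀ j : J, ℝ → CfgY 𝔸 (f j).toKIdx → AfldY 𝔸 (f j).toKIdx → Prop)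

/-- ★ **`hclass` OF `sectBStepPrinted_of_coded` ON A SUBFAMILY, for the codings `codingYx G (f j) (C37GY …) (C38 j)`**: `r := L⁴`, `αcap := 1∕4`,
`Mc := 2(d+1)+1`, any `ac` — `hclass_C37GY_at` at the members `f j` (the `C37GY` twin of `B9SectBCodedChainC37Y.hclass_C37Y_on`).
[cite: Balaban1985BackgroundPropagators, (3.37) p.396, (3.58) p.402, Thm 3.4 p.400] -/
theorem hclass_C37GY_on (hι : ∀ (j : J) (s : BlkY (f j).toKIdx), β (f j).toKIdx.hN (f j).toKIdx.D (f j).toKIdx.hk (ιB j s) = s)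
    (hG1 : ∀ u : 𝔸ˣ, u ∈ G → ‖(u : 𝔸)‖ ≤ 1) (c35 ac : ℝ) :
    ∀ (j : J) (α₀ α₁ : ℝ) (U U' : (bg9YC 𝔸 G P (f j)).Cfg), 2 * ((d : ℝ) + 1) + 1 ≤ (geo9Y (f j)).M → 0 < α₀ → (geo9Y (f j)).M * α₀ ≤ ac →
      (bg9YC 𝔸 G P (f j)).Reg335 c35 α₀ U → 0 < α₁ → α₁ ≤ 1 / 4 → (bg9YC 𝔸 G P (f j)).Cplx337 α₁ U U' →
      ∃ a : (codingYx P G (f j) (C37GY G (f j) (ιB j) (4 * ((d : ℝ) + 1) * Real.exp (3 * (((d : ℝ) + 1) / 2)))) (C38 j)).A,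
        (codingYx P G (f j) (C37GY G (f j) (ιB j) (4 * ((d : ℝ) + 1) * Real.exp (3 * (((d : ℝ) + 1) / 2)))) (C38 j)).decA a = U' ∧
        (codingYx P G (f j) (C37GY G (f j) (ιB j) (4 * ((d : ℝ) + 1) * Real.exp (3 * (((d : ℝ) + 1) / 2)))) (C38 j)).C37 ((((ℓ : ℝ) + 1) ^ 4) * α₁) U a := by
  intro j α₀ α₁ U U' hM _ _ hreg hα₁ hα₁4 h37
  exact hclass_C37GY_at P G (f j) (ιB j) (hι j) hG1 (by linarith) hreg hα₁ hα₁4 h37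

end Family

end Literature.MathematicalPhysics.QuantumFieldTheory.Balaban1983to89.B9SectBCodedClassGYR

end

/-!
# `Balaban1983to89.B9SectBCodedChainC37GYR` — THE CLASS-PARAMETRIC TWIN of `B9SectBCodedChainC37GY` (CASCADE-R, director-ym №279 GO-R; №277 (3) `hunitA` cure; dag-n06-d SOCKET-(α) class question)

statement-level skeleton of published theorems with citation tags; proofs where landed; nothing here is a claim about the
Yang–Mills mass gap

WHAT THIS FILE IS.  The original module `B9SectBCodedChainC37GY` types its objects over MODULE 3's member carrier `bg9Y 𝔸 G x` (MODULE 2's small-cube class (3.35)).  This file RE-DECLARES, with UNCHANGED NAMES inside the namespace `…B9SectBCodedChainC37GYR`, exactly its 2 class-dependent declarations over the CLASS-PARAMETRIC carrier `B9SectBCodedClassR.bg9YC 𝔸 G P x` (`P : RegExtraY …` = the two cube conditions of (3.35)∕(3.36) as a parameter; `bg9Y 𝔸 G x = bg9YC 𝔸 G (extraY 𝔸 G) x` by `rfl`, so every declaration here specialises definitionally to its original; at the record's reading of PRINT's class, `P := extraYPb 𝔸 G`, the displayed laws `hreg335P` ((3.35) on plaquettes) and the class-keyed `hunitA` become theorems).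  The text is the original's VERBATIM under the token surgery `bg9Y 𝔸 G ↦ bg9YC 𝔸 G P`, `NAME ↦ NAME P` for the class-dependent names (P the first explicit argument), and — №277 — the binder `hunitA` re-keyed from «all G-valued U» to «all (3.35)-regular U of the carrier» (`∀ j α₀ U, (bg9YC 𝔸 G P (f j)).Reg335 c35 α₀ U → IsUnit (deltaAY …)`).  Class-free declarations of the original are NOT copied: they are imported and used BY NAME (`open … hiding` the re-declared ones).  Generated by dag-n06-c g16's `gen.py` (HOME `pub-ymgap-dag-n06-c/lean/g16/`); the ORIGINAL MODULE DOCUMENTATION FOLLOWS VERBATIM and describes the mathematics.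

HONEST SCOPE.  Re-typing bookkeeping; nothing of [B9] asserted beyond the original; COUNT-NEUTRAL; N06 NOT discharged; nothing continuum ∕ OS ∕ mass gap ∕ Clay.  Cell `pub-ymgap` (D-0062), Track A node N06 [B9], seat `pub-ymgap-dag-n06-c` g16, 2026-08-29.
-/

/-! Module documentation: that of the original `Balaban1983to89.B9SectBCodedChainC37GY` applies verbatim to this twin (not repeated here). -/

namespace Literature.MathematicalPhysics.QuantumFieldTheory.Balaban1983to89.B9SectBCodedChainC37GYR

open Literature.MathematicalPhysics.QuantumFieldTheory.Balaban1983to89.B9SectBCodedClassR (RegExtraY bg9YC)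
open Literature.MathematicalPhysics.QuantumFieldTheory.Balaban1983to89.B9SectBCodedChainC37GY hiding sectBStepPrinted_on_of_KSC_C37GY sectBStepPrinted_cornerFree_of_KSC_C37GY

open Literature.MathematicalPhysics.QuantumFieldTheory.Balaban1983to89
open Literature.MathematicalPhysics.QuantumFieldTheory.Balaban1983to89.B6KLevelCensusIndexV1 (KIdx kGeo)
open Literature.MathematicalPhysics.QuantumFieldTheory.Balaban1983to89.B6Ineq2142KLevelV1 (β)
open Literature.MathematicalPhysics.QuantumFieldTheory.Balaban1983to89.B9SectBCodedCarrier (CCfg Coding pullK pullS pullAn)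
open Literature.MathematicalPhysics.QuantumFieldTheory.Balaban1983to89.B9Eq360DeltaPrimeAY (AfldY mulY)
open Literature.MathematicalPhysics.QuantumFieldTheory.Balaban1983to89.B9PinMembersKLevelV1 (MemberY geo9Y bg9Y)
open Literature.MathematicalPhysics.QuantumFieldTheory.Balaban1983to89.B9SectBGpLettersY (GVal)
open Literature.MathematicalPhysics.QuantumFieldTheory.Balaban1983to89.B9SectBGpFrameCodedYR (codingYx)
open Literature.MathematicalPhysics.QuantumFieldTheory.Balaban1983to89.B9SectBGpFrameCodedY (CplxLettersY)
open Literature.MathematicalPhysics.QuantumFieldTheory.Balaban1983to89.B9SectBGpReadingsYR (KSC)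
open Literature.MathematicalPhysics.QuantumFieldTheory.Balaban1983to89.B9SectBCodedClassGYR (hclass_C37GY_at hclass_C37GY_on)
open Literature.MathematicalPhysics.QuantumFieldTheory.Balaban1983to89.B9SectBCodedClassGY (C37GY hC37_of_C37GY)
open Literature.MathematicalPhysics.QuantumFieldTheory.Balaban1983to89.B9SectBCodedChainOnSubfamilyR (sectBStepPrinted_on_of_KSC)
open Literature.MathematicalPhysics.QuantumFieldTheory.Balaban1983to89.Node00 (SiteY BlkY IBondY CfgY SiteParY parSymY kernelFamilyS GpY)

variable {d ℓ : ℕ} {hd : 1 ≤ d + 1} {hL : Odd (ℓ + 1) ∧ 1 < ℓ + 1} {b₀ b₁ : ℝ} {Mstar : ℕ}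
variable {𝔸 : Type} [NormedRing 𝔸] (P : RegExtraY d ℓ hd hL b₀ b₁ Mstar 𝔸) [NormedAlgebra ℂ 𝔸] [CompleteSpace 𝔸] [NormOneClass 𝔸] [FiniteDimensional ℝ 𝔸]
variable {J : Type} (f : J → MemberY d ℓ hd hL b₀ b₁ Mstar) [∀ x : MemberY d ℓ hd hL b₀ b₁ Mstar, Fintype (geo9Y x).Site]
  (G : Subgroup 𝔸ˣ) {ι : Type} [Fintype ι] (b : Module.Basis ι ℝ 𝔸)
  (ιB : ∀ j : J, BlkY (f j).toKIdx → IBondY (f j).toKIdx)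
  (C38 : ∀ j : J, ℝ → CfgY 𝔸 (f j).toKIdx → AfldY 𝔸 (f j).toKIdx → Prop)

/-! ## §2 ★★★ The chain on a subfamily, class hypotheses discharged -/

/-- ★★★ **THE CODED-CARRIER CHAIN ON A SUBFAMILY WITH SECTIONS, CLASS HYPOTHESES DISCHARGED** (extended coded class `C37GY`, transporter `parSymY`, `Cq = 4(d+1)e^{3(d+1)/2}`,
`r = L⁴`, `αcap = 1∕4`, `Mc = 2(d+1)+1`): IF the Sect.-B step holds for the augmented coded readings `(KSC, pullK GA, pullS Cinv, IsAnK)` over the coded carriers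
on `J`, and the analyticity predicates transport (`hAn`), THEN the Sect.-B step holds for the record's families — `G′` read by `kernelFamilyS (GpY parSymY) parSymY`,
`GA`, `Cinv`, `IsAn` over `bg9Y` — on `J`. [cite: Balaban1985BackgroundPropagators, Thm 3.4 p.400, Sect. B pp.400–407, p.403 l.1–9, (3.35)–(3.37) p.396, (3.58) p.402, p.399 (the family); Balaban1984PropagatorsII, Lemma 2.1 p.234] -/
theorem sectBStepPrinted_on_of_KSC_C37GY (hι : ∀ (j : J) (s : BlkY (f j).toKIdx), β (f j).toKIdx.hN (f j).toKIdx.D (f j).toKIdx.hk (ιB j s) = s)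
    (hG1 : ∀ u : 𝔸ˣ, u ∈ G → ‖(u : 𝔸)‖ ≤ 1) {M₂ : ℝ} (hM₂ : 0 ≤ M₂) (hrepr : ∀ (v : 𝔸) (j : ι), |b.repr v j| ≤ M₂ * ‖v‖) (c35 : ℝ) (dC : ℕ)
    (GA : ∀ j : J, B9.KernelFamily (geo9Y (f j)) (bg9YC 𝔸 G P (f j))) (Cinv : ∀ j : J, B9.SiteKernel (geo9Y (f j)) (bg9YC 𝔸 G P (f j)))
    (hGA : ∀ (j : J) (U : (bg9YC 𝔸 G P (f j)).Cfg),
      (∀ lam β' ζ, 0 ≤ (GA j).h1 U lam β' ζ) ∧ (∀ lam y, 0 ≤ (GA j).e4 U lam y) ∧ (∀ lam β' ζ, 0 ≤ (GA j).h2 U lam β' ζ))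
    (IsAnK : ∀ j : J,
      B9.KernelFamily (geo9Y (f j)) (codingYx P G (f j) (C37GY G (f j) (ιB j) (4 * ((d : ℝ) + 1) * Real.exp (3 * (((d : ℝ) + 1) / 2)))) (C38 j)).bg →
        (codingYx P G (f j) (C37GY G (f j) (ιB j) (4 * ((d : ℝ) + 1) * Real.exp (3 * (((d : ℝ) + 1) / 2)))) (C38 j)).bg.Cfg → ℝ → Prop)
    (IsAn : ∀ j : J, B9.KernelFamily (geo9Y (f j)) (bg9YC 𝔸 G P (f j)) → (bg9YC 𝔸 G P (f j)).Cfg → ℝ → Prop) {ac : ℝ} (hac : 0 < ac)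
    (hAn : ∀ (j : J) (c : (codingYx P G (f j) (C37GY G (f j) (ιB j) (4 * ((d : ℝ) + 1) * Real.exp (3 * (((d : ℝ) + 1) / 2)))) (C38 j)).bg.Cfg) (α : ℝ),
      (IsAnK j (KSC P G (f j) (parSymY (f j).toKIdx) (C37GY G (f j) (ιB j) (4 * ((d : ℝ) + 1) * Real.exp (3 * (((d : ℝ) + 1) / 2)))) (C38 j)) c α →
        pullAn (codingYx P G (f j) (C37GY G (f j) (ιB j) (4 * ((d : ℝ) + 1) * Real.exp (3 * (((d : ℝ) + 1) / 2)))) (C38 j)) (((ℓ : ℝ) + 1) ^ 4) (IsAn j)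
          (pullK (codingYx P G (f j) (C37GY G (f j) (ιB j) (4 * ((d : ℝ) + 1) * Real.exp (3 * (((d : ℝ) + 1) / 2)))) (C38 j))
            (kernelFamilyS (f j).toKIdx (bg9YC 𝔸 G P (f j)) (fun U => U) (GpY (f j).toKIdx (parSymY (f j).toKIdx)) (parSymY (f j).toKIdx))) c α) ∧
      (IsAnK j (pullK (codingYx P G (f j) (C37GY G (f j) (ιB j) (4 * ((d : ℝ) + 1) * Real.exp (3 * (((d : ℝ) + 1) / 2)))) (C38 j)) (GA j)) c α →
        pullAn (codingYx P G (f j) (C37GY G (f j) (ιB j) (4 * ((d : ℝ) + 1) * Real.exp (3 * (((d : ℝ) + 1) / 2)))) (C38 j)) (((ℓ : ℝ) + 1) ^ 4) (IsAn j)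
          (pullK (codingYx P G (f j) (C37GY G (f j) (ιB j) (4 * ((d : ℝ) + 1) * Real.exp (3 * (((d : ℝ) + 1) / 2)))) (C38 j)) (GA j)) c α))
    (h : B9.SectBStepPrinted dC c35 (fun j => geo9Y (f j))
      (fun j => (codingYx P G (f j) (C37GY G (f j) (ιB j) (4 * ((d : ℝ) + 1) * Real.exp (3 * (((d : ℝ) + 1) / 2)))) (C38 j)).bg)
      (fun j => KSC P G (f j) (parSymY (f j).toKIdx) (C37GY G (f j) (ιB j) (4 * ((d : ℝ) + 1) * Real.exp (3 * (((d : ℝ) + 1) / 2)))) (C38 j))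
      (fun j => pullK (codingYx P G (f j) (C37GY G (f j) (ιB j) (4 * ((d : ℝ) + 1) * Real.exp (3 * (((d : ℝ) + 1) / 2)))) (C38 j)) (GA j))
      (fun j => pullS (codingYx P G (f j) (C37GY G (f j) (ιB j) (4 * ((d : ℝ) + 1) * Real.exp (3 * (((d : ℝ) + 1) / 2)))) (C38 j)) (Cinv j)) IsAnK) :
    B9.SectBStepPrinted dC c35 (fun j => geo9Y (f j)) (fun j => bg9YC 𝔸 G P (f j))
      (fun j => kernelFamilyS (f j).toKIdx (bg9YC 𝔸 G P (f j)) (fun U => U) (GpY (f j).toKIdx (parSymY (f j).toKIdx)) (parSymY (f j).toKIdx)) GA Cinv IsAn := by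
  have hL4 : (0 : ℝ) < ((ℓ : ℝ) + 1) ^ 4 := by positivity
  exact sectBStepPrinted_on_of_KSC P f G (fun j => parSymY (f j).toKIdx) b ιB
    (fun j => C37GY G (f j) (ιB j) (4 * ((d : ℝ) + 1) * Real.exp (3 * (((d : ℝ) + 1) / 2)))) C38 hG1 hM₂ hrepr hι
    (fun j => hC37_of_C37GY G (f j) (ιB j) _) c35 dC GA Cinv hGA IsAnK IsAn hL4 (by norm_num : (0 : ℝ) < 1 / 4) hac hAn
    (hclass_C37GY_on P f G ιB C38 hι hG1 c35 ac) h

/-! ## §3 ★★★ The chain on a corner-free subfamily: no section binder, no class hypothesis -/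

/-- ★★★ **THE CODED-CARRIER CHAIN ON A CORNER-FREE SUBFAMILY** (`hf : β` onto at every `f j`; sections `Function.surjInv (hf j)`; extended coded class `C37GY`): the Sect.-B
step for the augmented coded readings over the members `f j` gives the Sect.-B step for the record's families over them — the displayed hypotheses are the
frames' output `h`, the analyticity transport `hAn`, and structural record data only. [cite: Balaban1985BackgroundPropagators, Thm 3.4 p.400, Sect. B pp.400–407, p.403 l.1–9, (3.35)–(3.37) p.396, (3.58) p.402, p.399; Balaban1984PropagatorsII, (2.45) p.231, Lemma 2.1 p.234] -/
theorem sectBStepPrinted_cornerFree_of_KSC_C37GY (hf : ∀ j : J, Function.Surjective (β (f j).toKIdx.hN (f j).toKIdx.D (f j).toKIdx.hk))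
    (hG1 : ∀ u : 𝔸ˣ, u ∈ G → ‖(u : 𝔸)‖ ≤ 1) {M₂ : ℝ} (hM₂ : 0 ≤ M₂) (hrepr : ∀ (v : 𝔸) (j : ι), |b.repr v j| ≤ M₂ * ‖v‖) (c35 : ℝ) (dC : ℕ)
    (GA : ∀ j : J, B9.KernelFamily (geo9Y (f j)) (bg9YC 𝔸 G P (f j))) (Cinv : ∀ j : J, B9.SiteKernel (geo9Y (f j)) (bg9YC 𝔸 G P (f j)))
    (hGA : ∀ (j : J) (U : (bg9YC 𝔸 G P (f j)).Cfg),
      (∀ lam β' ζ, 0 ≤ (GA j).h1 U lam β' ζ) ∧ (∀ lam y, 0 ≤ (GA j).e4 U lam y) ∧ (∀ lam β' ζ, 0 ≤ (GA j).h2 U lam β' ζ))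
    (IsAnK : ∀ j : J,
      B9.KernelFamily (geo9Y (f j))
          (codingYx P G (f j) (C37GY G (f j) (fun s => Function.surjInv (hf j) s) (4 * ((d : ℝ) + 1) * Real.exp (3 * (((d : ℝ) + 1) / 2)))) (C38 j)).bg →
        (codingYx P G (f j) (C37GY G (f j) (fun s => Function.surjInv (hf j) s) (4 * ((d : ℝ) + 1) * Real.exp (3 * (((d : ℝ) + 1) / 2)))) (C38 j)).bg.Cfg →
          ℝ → Prop)
    (IsAn : ∀ j : J, B9.KernelFamily (geo9Y (f j)) (bg9YC 𝔸 G P (f j)) → (bg9YC 𝔸 G P (f j)).Cfg → ℝ → Prop) {ac : ℝ} (hac : 0 < ac)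
    (hAn : ∀ (j : J)
      (c : (codingYx P G (f j) (C37GY G (f j) (fun s => Function.surjInv (hf j) s) (4 * ((d : ℝ) + 1) * Real.exp (3 * (((d : ℝ) + 1) / 2)))) (C38 j)).bg.Cfg)
      (α : ℝ),
      (IsAnK j (KSC P G (f j) (parSymY (f j).toKIdx)
          (C37GY G (f j) (fun s => Function.surjInv (hf j) s) (4 * ((d : ℝ) + 1) * Real.exp (3 * (((d : ℝ) + 1) / 2)))) (C38 j)) c α →
        pullAn (codingYx P G (f j) (C37GY G (f j) (fun s => Function.surjInv (hf j) s) (4 * ((d : ℝ) + 1) * Real.exp (3 * (((d : ℝ) + 1) / 2)))) (C38 j))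
          (((ℓ : ℝ) + 1) ^ 4) (IsAn j)
          (pullK (codingYx P G (f j) (C37GY G (f j) (fun s => Function.surjInv (hf j) s) (4 * ((d : ℝ) + 1) * Real.exp (3 * (((d : ℝ) + 1) / 2)))) (C38 j))
            (kernelFamilyS (f j).toKIdx (bg9YC 𝔸 G P (f j)) (fun U => U) (GpY (f j).toKIdx (parSymY (f j).toKIdx)) (parSymY (f j).toKIdx))) c α) ∧
      (IsAnK j (pullK (codingYx P G (f j) (C37GY G (f j) (fun s => Function.surjInv (hf j) s) (4 * ((d : ℝ) + 1) * Real.exp (3 * (((d : ℝ) + 1) / 2))))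
          (C38 j)) (GA j)) c α →
        pullAn (codingYx P G (f j) (C37GY G (f j) (fun s => Function.surjInv (hf j) s) (4 * ((d : ℝ) + 1) * Real.exp (3 * (((d : ℝ) + 1) / 2)))) (C38 j))
          (((ℓ : ℝ) + 1) ^ 4) (IsAn j)
          (pullK (codingYx P G (f j) (C37GY G (f j) (fun s => Function.surjInv (hf j) s) (4 * ((d : ℝ) + 1) * Real.exp (3 * (((d : ℝ) + 1) / 2)))) (C38 j))
            (GA j)) c α))
    (h : B9.SectBStepPrinted dC c35 (fun j => geo9Y (f j))
      (fun j => (codingYx P G (f j) (C37GY G (f j) (fun s => Function.surjInv (hf j) s) (4 * ((d : ℝ) + 1) * Real.exp (3 * (((d : ℝ) + 1) / 2)))) (C38 j)).bg)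
      (fun j => KSC P G (f j) (parSymY (f j).toKIdx)
        (C37GY G (f j) (fun s => Function.surjInv (hf j) s) (4 * ((d : ℝ) + 1) * Real.exp (3 * (((d : ℝ) + 1) / 2)))) (C38 j))
      (fun j => pullK (codingYx P G (f j) (C37GY G (f j) (fun s => Function.surjInv (hf j) s) (4 * ((d : ℝ) + 1) * Real.exp (3 * (((d : ℝ) + 1) / 2))))
        (C38 j)) (GA j))
      (fun j => pullS (codingYx P G (f j) (C37GY G (f j) (fun s => Function.surjInv (hf j) s) (4 * ((d : ℝ) + 1) * Real.exp (3 * (((d : ℝ) + 1) / 2))))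
        (C38 j)) (Cinv j)) IsAnK) :
    B9.SectBStepPrinted dC c35 (fun j => geo9Y (f j)) (fun j => bg9YC 𝔸 G P (f j))
      (fun j => kernelFamilyS (f j).toKIdx (bg9YC 𝔸 G P (f j)) (fun U => U) (GpY (f j).toKIdx (parSymY (f j).toKIdx)) (parSymY (f j).toKIdx)) GA Cinv IsAn :=
  sectBStepPrinted_on_of_KSC_C37GY P f G b (fun j s => Function.surjInv (hf j) s) C38 (fun j s => Function.surjInv_eq (hf j) s) hG1 hM₂ hrepr c35 dC GA Cinv hGA
    IsAnK IsAn hac hAn h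

end Literature.MathematicalPhysics.QuantumFieldTheory.Balaban1983to89.B9SectBCodedChainC37GYR

/-!
# `Balaban1983to89.B9SectBE4FrameCodedYR` — THE CLASS-PARAMETRIC TWIN of `B9SectBE4FrameCodedY` (CASCADE-R, director-ym №279 GO-R; №277 (3) `hunitA` cure; dag-n06-d SOCKET-(α) class question)

statement-level skeleton of published theorems with citation tags; proofs where landed; nothing here is a claim about the
Yang–Mills mass gap

WHAT THIS FILE IS.  The original module `B9SectBE4FrameCodedY` types its objects over MODULE 3's member carrier `bg9Y 𝔸 G x` (MODULE 2's small-cube class (3.35)).  This file RE-DECLARES, with UNCHANGED NAMES inside the namespace `…B9SectBE4FrameCodedYR`, exactly its 16 class-dependent declarations over the CLASS-PARAMETRIC carrier `B9SectBCodedClassR.bg9YC 𝔸 G P x` (`P : RegExtraY …` = the two cube conditions of (3.35)∕(3.36) as a parameter; `bg9Y 𝔸 G x = bg9YC 𝔸 G (extraY 𝔸 G) x` by `rfl`, so every declaration here specialises definitionally to its original; at the record's reading of PRINT's class, `P := extraYPb 𝔸 G`, the displayed laws `hreg335P` ((3.35) on plaquettes) and the class-keyed `hunitA` become theorems).  The text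 is the original's VERBATIM under the token surgery `bg9Y 𝔸 G ↦ bg9YC 𝔸 G P`, `NAME ↦ NAME P` for the class-dependent names (P the first explicit argument), and — №277 — the binder `hunitA` re-keyed from «all G-valued U» to «all (3.35)-regular U of the carrier» (`∀ j α₀ U, (bg9YC 𝔸 G P (f j)).Reg335 c35 α₀ U → IsUnit (deltaAY …)`).  Class-free declarations of the original are NOT copied: they are imported and used BY NAME (`open … hiding` the re-declared ones).  Generated by dag-n06-c g16's `gen.py` (HOME `pub-ymgap-dag-n06-c/lean/g16/`); the ORIGINAL MODULE DOCUMENTATION FOLLOWS VERBATIM and describes the mathematics.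

HONEST SCOPE.  Re-typing bookkeeping; nothing of [B9] asserted beyond the original; COUNT-NEUTRAL; N06 NOT discharged; nothing continuum ∕ OS ∕ mass gap ∕ Clay.  Cell `pub-ymgap` (D-0062), Track A node N06 [B9], seat `pub-ymgap-dag-n06-c` g16, 2026-08-29.
-/

/-! Module documentation: that of the original `Balaban1983to89.B9SectBE4FrameCodedY` applies verbatim to this twin (not repeated here). -/

noncomputable section

namespace Literature.MathematicalPhysics.QuantumFieldTheory.Balaban1983to89.B9SectBE4FrameCodedYR

open Literature.MathematicalPhysics.QuantumFieldTheory.Balaban1983to89.B9SectBCodedClassR (RegExtraY bg9YC)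
open Literature.MathematicalPhysics.QuantumFieldTheory.Balaban1983to89.B9SectBE4FrameCodedY hiding KSC₆ KSC₆_e KSC₆_e4 KSC₆_e4_inl KSC₆_e4_inr eBlock_KSC₆_iff e4Block_KSC₆_iff KSC₆_members_base read342Y_KSC₆ write342Y_KSC₆ e4_read e4_transfer_KSC₆ e4Frame₃CodedOn stepE4Pos_KSC₆_on hin_KSC₆_on_pos stepE4Pos_KSCU_on

open B6RandomWalk (HasMajorant hasMajorant_mono BlockSupp)
open B6KLevelCensusIndexV1 (KIdx kGeo)
open B6Ineq2142KLevelV1 (β)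
open B9Thm34Ext (toB6)
open B9FromB6 (EBlock E4Block)
open B9Eq352DivFormLetters (conj coordEquiv gradLetterF gradLetterB gradLetterF_apply)
open B9Eq352GradLetters (diffLetter diffLetter_inl diffLetter_inr)
open B9Thm34SectBUniformR1 (thm34_Gp_uniform)
open B9Thm34HolderGpUniformR1 (thm34_Gp_holderInput_uniform)
open B9SectBGpStepAtLettersV2 (GpFrame₂)
open B9SectBStepWhole (StepPos StepE4Pos)
open B9SectBCodedCarrier (CCfg Coding pullK pullS)
open B9Eq360DeltaPrimeAY (AfldY blkY)
open B9PinMembersKLevelV1 (MemberY geo9Y bg9Y)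
open B9SectBGpLettersY (GVal decY coordC blkC GopC letters_base_of_gVal norm_le_one_and_inv_of_mem stencilB_blkC)
open B9SectBGpFrameCodedYR (codingYx Read342Y Write342Y)
open B9SectBGpFrameCodedY (CplxLettersY)
open B9SectBGpReadingsYR (KSC read342Y_KSC write342Y_KSC)
open B9SectBGpReadingsY (baseY etaS_eq_eta exists_ball_bound)
open B9SectBCodedReadingsUR (KSCU KACU)
open B9SectBStepsKSCUR (KACU_members_base ineq342_346_347_congr thms_KSCU_base_iff hin_KSCU_on_pos)
open B9SectBGpTransferInYR (ineq343_345_congr)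
open B9SectBCodedChainOnSubfamilyR (gpFrame₂CodedOn)
open B9SectBStepPosFamilyTransfer (stepE4Pos_of_family_pos)
open B9GeoLemma21KLevelV1 (geo9Y_dist_triangle geo9Y_len_pos geo9Y_dist_comm)
open B9RWSums347DefiniteFacesWindow (geo9Y_dist_nonneg)
open B9GeoNormsKLevelModelSignsV1 (modelSignsOn_geo9K)
open Node00 (SiteY BlkY IBondY CfgY BallY SiteParY BondParY BondOpY liftY deltaPrimeAY kernelFamilyS GpY UboxY shiftY etaS cdS cdsS cdS_smul
  supBlkS' toKT)
open Node00.OpsYRead342 (geo9K_len_congr geo9K_dist_congr norm_le_supBlkS')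
open Node00.OpsYRead342Cross (norm_cdsS_le_norm_cdS_symm_shift)
open B9Ineq349SiteComposite (cdSL cdsSL cdSL_apply cdsSL_apply etaS_pos supBlkS'_le)
open B9SectBH1ProbesY (Gsc symm_conj_apply symm_G_negGradB norm_coordEquiv_symm_apply_le blockSupp_coordEquiv_liftY)
open B9SectBH1FrameCodedYR (KSC₅)

/-! ## §1 The (3.44) frame: the (v′)-half of `E4H2Frame₂` -/

section Frame

universe u

variable {I : Type} (d : ℕ) (c35 : ℝ) (geo : I → B9.Geometry) (bg : I → B9.Backgrounds)
  (Gp : ∀ i, B9.KernelFamily (geo i) (bg i))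
  {𝔸 : Type u} [NormedRing 𝔸] [NormedAlgebra ℂ 𝔸] [CompleteSpace 𝔸] {ι : Type} [Fintype ι] [DecidableEq ι]
  (b : Module.Basis ι ℝ 𝔸) (κ : Type) [Fintype κ]
  (S : I → Type) [∀ i, Fintype (S i)] [∀ i, DecidableEq (S i)]
  [∀ i, Fintype (geo i).Site] [∀ i, DecidableEq (geo i).Site] [∀ i, Nonempty (geo i).Site]

variable {d c35 geo bg Gp b κ S}

end Frame

/-! ## §2 The family `KSC₆` (augmented (3.42) reading, U-letter (3.44) member) and its (3.42) dictionaries -/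

variable {d ℓ : ℕ} {hd : 1 ≤ d + 1} {hL : Odd (ℓ + 1) ∧ 1 < ℓ + 1} {b₀ b₁ : ℝ} {Mstar : ℕ}
variable {𝔸 : Type} [NormedRing 𝔸] (P : RegExtraY d ℓ hd hL b₀ b₁ Mstar 𝔸) [NormedAlgebra ℂ 𝔸] [CompleteSpace 𝔸] [FiniteDimensional ℝ 𝔸]

section Family

variable (G : Subgroup 𝔸ˣ) (x : MemberY d ℓ hd hL b₀ b₁ Mstar) (par : SiteParY 𝔸 x.toKIdx) {ι : Type} [Fintype ι] (b : Module.Basis ι ℝ 𝔸)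
  (ιB : BlkY x.toKIdx → IBondY x.toKIdx) (C37 C38 : ℝ → CfgY 𝔸 x.toKIdx → AfldY 𝔸 x.toKIdx → Prop)

/-- ★ **`KSC₆`** — g7's augmented coded reading `KSC` with the (3.44) member REPLACED by the U-letter one of `KSCU` (the differences of `base c` around `G′(dec c)`).
[cite: Balaban1985BackgroundPropagators, (3.42) p.397, (3.44) p.398, Thm 3.4 p.400, p.403 l.2–5] -/
def KSC₆ : B9.KernelFamily (geo9Y x) (codingYx P G x C37 C38).bg :=
  { KSC P G x par C37 C38 with e4 := (KSCU P G x par C37 C38).e4 }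

omit [FiniteDimensional ℝ 𝔸] in
/-- the (3.42) member of `KSC₆` is `KSC`'s (`rfl`). [cite: Balaban1985BackgroundPropagators, (3.42) p.397, bookkeeping] -/
theorem KSC₆_e : (KSC₆ P G x par C37 C38).e = (KSC P G x par C37 C38).e := rfl

omit [FiniteDimensional ℝ 𝔸] in
/-- the (3.44) member of `KSC₆` is `KSCU`'s (`rfl`). [cite: Balaban1985BackgroundPropagators, (3.44) p.398, bookkeeping] -/
theorem KSC₆_e4 : (KSC₆ P G x par C37 C38).e4 = (KSCU P G x par C37 C38).e4 := rfl

omit [FiniteDimensional ℝ 𝔸] in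
/-- the (3.44) member of `KSC₆` on site arguments: `sup_E sup_μ sup_{w ∈ Δ, ν} ‖(∇_{U,μ}G′(dec c)∇*_{U,ν}(f ⊗ E))(w)‖`, `U = base c` (`rfl`).
[cite: Balaban1985BackgroundPropagators, (3.44) p.398, p.403 l.2–5, bookkeeping] -/
theorem KSC₆_e4_inl (c : (codingYx P G x C37 C38).bg.Cfg) (f : SiteY x.toKIdx → ℝ) (bb : IBondY x.toKIdx) :
    (KSC₆ P G x par C37 C38).e4 c (.inl f) bb =
      ⨆ E : BallY 𝔸, ⨆ μ : Fin (d + 1), supBlkS' x.toKIdx (β x.toKIdx.hN x.toKIdx.D x.toKIdx.hk bb)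
        (fun ν => cdS x.toKIdx (baseY x.toKIdx c) μ (GpY x.toKIdx par (decY x.toKIdx c) (cdsS x.toKIdx (baseY x.toKIdx c) ν (liftY f (E : 𝔸))))) := rfl

omit [FiniteDimensional ℝ 𝔸] in
/-- the (3.44) member of `KSC₆` vanishes on bond-sector arguments (`rfl`). [cite: Balaban1985BackgroundPropagators, (3.44) p.398, bookkeeping] -/
theorem KSC₆_e4_inr (c : (codingYx P G x C37 C38).bg.Cfg) (J : Node00.FBondY x.toKIdx → ℝ) (bb : IBondY x.toKIdx) :
    (KSC₆ P G x par C37 C38).e4 c (.inr J) bb = 0 := rfl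

omit [FiniteDimensional ℝ 𝔸] in
/-- the (3.42) block of `KSC₆` IS that of `KSC`. [cite: Balaban1985BackgroundPropagators, (3.42) p.397, bookkeeping] -/
theorem eBlock_KSC₆_iff {B₀ δ : ℝ} (c : (codingYx P G x C37 C38).bg.Cfg) :
    EBlock (KSC₆ P G x par C37 C38) B₀ δ c ↔ EBlock (KSC P G x par C37 C38) B₀ δ c := by
  rw [EBlock, EBlock, KSC₆_e]

omit [FiniteDimensional ℝ 𝔸] in
/-- the (3.44) block of `KSC₆` IS that of `KSCU`. [cite: Balaban1985BackgroundPropagators, (3.44) p.398, bookkeeping] -/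
theorem e4Block_KSC₆_iff {Bε : ℝ → ℝ} {δ : ℝ} (c : (codingYx P G x C37 C38).bg.Cfg) :
    E4Block (KSC₆ P G x par C37 C38) Bε δ c ↔ E4Block (KSCU P G x par C37 C38) Bε δ c := by
  rw [E4Block, E4Block, KSC₆_e4]

omit [FiniteDimensional ℝ 𝔸] in
/-- at a BASE configuration every member of `KSC₆` is `KSC`'s (`dec (base U) = base (base U) = U`). [cite: Balaban1985BackgroundPropagators, (3.42)–(3.47) pp.397–398, bookkeeping] -/
theorem KSC₆_members_base (U : CfgY 𝔸 x.toKIdx) :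
    (∀ n, (KSC₆ P G x par C37 C38).e n (.base U) = (KSC P G x par C37 C38).e n (.base U)) ∧
    (KSC₆ P G x par C37 C38).h1 (.base U) = (KSC P G x par C37 C38).h1 (.base U) ∧
    (KSC₆ P G x par C37 C38).e4 (.base U) = (KSC P G x par C37 C38).e4 (.base U) ∧
    (KSC₆ P G x par C37 C38).h2 (.base U) = (KSC P G x par C37 C38).h2 (.base U) ∧
    (∀ n, (KSC₆ P G x par C37 C38).l2 n (.base U) = (KSC P G x par C37 C38).l2 n (.base U)) ∧
    (∀ n, (KSC₆ P G x par C37 C38).glob n (.base U) = (KSC P G x par C37 C38).glob n (.base U)) := by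
  refine ⟨fun _ => rfl, rfl, ?_, rfl, fun _ => rfl, fun _ => rfl⟩
  funext lam bb
  rcases lam with f | J <;> rfl

variable [Fintype (geo9Y x).Site]

/-- the (3.42) reading dictionary of `KSC₆` is `KSC`'s. [cite: Balaban1985BackgroundPropagators, (3.42) p.397; Balaban1984PropagatorsII, (2.51) p.232] -/
theorem read342Y_KSC₆ (hι : ∀ s : BlkY x.toKIdx, β x.toKIdx.hN x.toKIdx.D x.toKIdx.hk (ιB s) = s)
    (M₂ : ℝ) (hM₂ : 0 ≤ M₂) (hrepr : ∀ (v : 𝔸) (j : ι), |b.repr v j| ≤ M₂ * ‖v‖) (c35 MInv aInv : ℝ) :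
    Read342Y P G x par b ιB C37 C38 (KSC₆ P G x par C37 C38) c35 (M₂ * ∑ j, ‖b j‖) MInv aInv 0 True :=
  fun α₀ U B₀ δ hM hα₀ hMa hreg hB₀ hδ hE =>
    read342Y_KSC P G x par b ιB C37 C38 hι M₂ hM₂ hrepr c35 MInv aInv α₀ U B₀ δ hM hα₀ hMa hreg hB₀ hδ ((eBlock_KSC₆_iff P G x par C37 C38 _).1 hE)

omit [FiniteDimensional ℝ 𝔸] in
/-- the (3.42) writing dictionary of `KSC₆` is `KSC`'s. [cite: Balaban1985BackgroundPropagators, (3.42) p.397, p.403; Balaban1984PropagatorsII, (2.51) p.232] -/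
theorem write342Y_KSC₆ (hι : ∀ s : BlkY x.toKIdx, β x.toKIdx.hN x.toKIdx.D x.toKIdx.hk (ιB s) = s)
    (M₂ : ℝ) (hM₂ : 0 ≤ M₂) (hrepr : ∀ (v : 𝔸) (j : ι), |b.repr v j| ≤ M₂ * ‖v‖) (aW : ℝ) (hC37 : ∀ β' U a, C37 β' U a → GVal G x.toKIdx U) :
    Write342Y P G x par b ιB C37 C38 (KSC₆ P G x par C37 C38) (fun B _ => (M₂ * ∑ j, ‖b j‖) * B + 1) (fun δ => δ) aW 0 True :=
  fun U a α₁ B δ hα₁ hα₁W h37 hB hδ hG hDG hGD hLG =>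
    (eBlock_KSC₆_iff P G x par C37 C38 _).2 (write342Y_KSC P G x par b ιB C37 C38 hι M₂ hM₂ hrepr aW hC37 U a α₁ B δ hα₁ hα₁W h37 hB hδ hG hDG hGD hLG)

end Family

/-! ## §3 Tools: the triple letter product read back as def-Y's (3.44) word, coordinates, the (3.44) block READ -/

section Tools

variable [NormOneClass 𝔸] (c35 : ℝ) (G : Subgroup 𝔸ˣ) (x : MemberY d ℓ hd hL b₀ b₁ Mstar) (par : SiteParY 𝔸 x.toKIdx) {ι : Type} [Fintype ι]
  (b : Module.Basis ι ℝ 𝔸) (ιB : BlkY x.toKIdx → IBondY x.toKIdx) [Fintype (geo9Y x).Site]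
  (C37 C38 : ℝ → CfgY 𝔸 x.toKIdx → AfldY 𝔸 x.toKIdx → Prop)

omit [NormOneClass 𝔸] [Fintype (geo9Y x).Site] in
/-- ★ **THE (3.44) BLOCK OF `KSCU` AT A BASE, READ POINTWISE**: `‖(∇_{U,μ}G′(U)∇*_{U,ν}(f ⊗ E))(w)‖ ≦ B_ε(ε)·e^{−δd(y,y′)}·(‖f‖_ε + |f|)` for `w ∈ Δ(βy)`,
`supp f ⊂ Δ(βy′)`, `‖E‖ ≦ 1`, `0 < ε ≦ 1` (the integrand is below its `⨆` — bounded over the unit ball by finite-dimensionality, `exists_ball_bound`).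
[cite: Balaban1985BackgroundPropagators, (3.44) p.398] -/
theorem e4_read {Bε : ℝ → ℝ} {δ : ℝ} {U : CfgY 𝔸 x.toKIdx} (hE4 : E4Block (KSCU P G x par C37 C38) Bε δ (.base U))
    {ε : ℝ} (hε0 : 0 < ε) (hε1 : ε ≤ 1) (f : SiteY x.toKIdx → ℝ) (y y' : IBondY x.toKIdx) (hs : (geo9Y x).suppIn (Sum.inl f) y')
    (E : BallY 𝔸) (μ ν : Fin (d + 1)) {w : SiteY x.toKIdx} (hw : blkY x.toKIdx w = β x.toKIdx.hN x.toKIdx.D x.toKIdx.hk y) :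
    ‖cdS x.toKIdx U μ (GpY x.toKIdx par U (cdsS x.toKIdx U ν (liftY f (E : 𝔸)))) w‖ ≤
      Bε ε * Real.exp (-(δ * (geo9Y x).dist y y')) * ((geo9Y x).holder ε (Sum.inl f) + (geo9Y x).supNorm (Sum.inl f)) := by
  have h := hE4 ε (Sum.inl f) y y' hε0 hε1 hs
  rw [← KSC₆_e4 P, KSC₆_e4_inl] at h
  refine le_trans ?_ h
  -- the bound over the unit ball, uniform in the directions
  have hC : ∀ μ' ν' : Fin (d + 1), ∃ C : ℝ, 0 ≤ C ∧ ∀ (E' : BallY 𝔸) (z : SiteY x.toKIdx),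
      ‖((cdSL x.toKIdx U μ' ∘ₗ GpY x.toKIdx par U ∘ₗ cdsSL x.toKIdx U ν').restrictScalars ℝ) (liftY f (E' : 𝔸)) z‖ ≤ C := fun μ' ν' =>
    exists_ball_bound x _ f
  choose C hC0 hCb using hC
  have hbdd : BddAbove (Set.range fun E' : BallY 𝔸 => ⨆ μ' : Fin (d + 1), supBlkS' x.toKIdx (β x.toKIdx.hN x.toKIdx.D x.toKIdx.hk y)
      (fun ν' => cdS x.toKIdx U μ' (GpY x.toKIdx par U (cdsS x.toKIdx U ν' (liftY f (E' : 𝔸)))))) := by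
    refine ⟨∑ μ', ∑ ν', C μ' ν', ?_⟩
    rintro _ ⟨E', rfl⟩
    have hS : 0 ≤ ∑ μ', ∑ ν', C μ' ν' := Finset.sum_nonneg fun μ' _ => Finset.sum_nonneg fun ν' _ => hC0 μ' ν'
    refine Real.iSup_le (fun μ' => ?_) hS
    refine supBlkS'_le x.toKIdx _ _ hS fun z ν' _ => ?_
    refine le_trans ?_ (Finset.single_le_sum (f := fun μ'' => ∑ ν', C μ'' ν') (fun _ _ => Finset.sum_nonneg fun ν' _ => hC0 _ ν') (Finset.mem_univ μ'))
    refine le_trans ?_ (Finset.single_le_sum (f := fun ν'' => C μ' ν'') (fun _ _ => hC0 _ _) (Finset.mem_univ ν'))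
    exact hCb μ' ν' E' z
  refine le_trans ?_ (le_ciSup hbdd E)
  refine le_trans ?_ (le_ciSup (f := fun μ' : Fin (d + 1) => supBlkS' x.toKIdx (β x.toKIdx.hN x.toKIdx.D x.toKIdx.hk y)
    (fun ν' => cdS x.toKIdx U μ' (GpY x.toKIdx par U (cdsS x.toKIdx U ν' (liftY f (E : 𝔸)))))) (Finite.bddAbove_range _) μ)
  exact norm_le_supBlkS' x.toKIdx _ (fun ν' => cdS x.toKIdx U μ (GpY x.toKIdx par U (cdsS x.toKIdx U ν' (liftY f (E : 𝔸))))) ν hw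

end Tools

/-! ## §4 ★★ The transfer field PROVED for `KSC₆`, the instance, the (3.44) block-steps -/

section Transfer

variable [NormOneClass 𝔸] (c35 : ℝ) (G : Subgroup 𝔸ˣ) (x : MemberY d ℓ hd hL b₀ b₁ Mstar) (par : SiteParY 𝔸 x.toKIdx) {ι : Type} [Fintype ι]
  (b : Module.Basis ι ℝ 𝔸) (ιB : BlkY x.toKIdx → IBondY x.toKIdx) [Fintype (geo9Y x).Site]
  (C37 C38 : ℝ → CfgY 𝔸 x.toKIdx → AfldY 𝔸 x.toKIdx → Prop)

omit [NormOneClass 𝔸] in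
set_option maxHeartbeats 800000 in
/-- ★★ **THE TRANSFER FIELD OF THE (3.44) FRAME, PROVED FOR `KSC₆` AT def-Y's LETTERS**: from r06's per-input transfer (v′) for the letters of the member (hypothesis
`HV`, the shape of `E4Frame₃.e4_transfer`), the (3.42) majorants at the base (`hread`), the (3.44) block of `KSC₆` at the base, unit norms of the bond variables
(`G`-valued base): the (3.44) block of `KSC₆` at the coded product with `(wE4₆ … B δc Bε, 4δc∕5)`.  For the output word `∇_{U,μ}G′(U′U)∇*_{U,ν}(f ⊗ E)` at `w`:
`D_l := conj b(η⁻¹∇_μ)`, `D_s := conj b(−η⁻¹∇*_ν)`, input `coord(f ⊗ E)` (supported in the labelled block of `supp f`, `|·| ≦ M₂|f|`), data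
`N := M₂·B⁺_ε·e^{2(d+1)δc}·(‖f‖_ε + |f|)` read from the (3.44) block at the base (backward letters on the left through `‖∇*_μΨ(w)‖ ≦ ‖∇_μΨ(w−e_μ)‖`).
[cite: Balaban1985BackgroundPropagators, Thm 3.4 p.400, (3.44) p.398, p.403 l.2–5, (3.3) p.390, (3.8) p.392; Balaban1984PropagatorsII, (2.51)–(2.52) p.232, (2.54) p.233] -/
theorem e4_transfer_KSC₆ (hι : ∀ s : BlkY x.toKIdx, β x.toKIdx.hN x.toKIdx.D x.toKIdx.hk (ιB s) = s)
    (hG1 : ∀ u : 𝔸ˣ, u ∈ G → ‖(u : 𝔸)‖ ≤ 1)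
    {M₂ : ℝ} (hM₂ : 0 ≤ M₂) (hrepr : ∀ (v : 𝔸) (j : ι), |b.repr v j| ≤ M₂ * ‖v‖)
    {MInv cR aInv aW : ℝ} (hcR : 0 < cR) (hread : Read342Y P G x par b ιB C37 C38 (KSC₆ P G x par C37 C38) c35 cR MInv aInv 0 True)
    (α₀ : ℝ) (c c' : (codingYx P G x C37 C38).bg.Cfg) (α₁ B₀ B δ δc : ℝ) (Bε : ℝ → ℝ)
    (hM : MInv ≤ (geo9Y x).M) (hα₀ : 0 < α₀) (hMa : (geo9Y x).M * α₀ ≤ aInv) (hreg : (codingYx P G x C37 C38).bg.Reg335 c35 α₀ c)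
    (_hα₁ : 0 < α₁) (_haW : α₁ ≤ aW) (h37 : (codingYx P G x C37 C38).bg.Cplx337 α₁ c c') (hB₀ : 0 < B₀) (hB : 0 ≤ B)
    (hδ : 0 < δ) (hδc : 0 < δc) (hδcδ : δc ≤ δ)
    (hE : EBlock (KSC₆ P G x par C37 C38) B₀ δ c) (hE4 : E4Block (KSC₆ P G x par C37 C38) Bε δ c)
    (HV : ∀ (Dl Ds : Module.End ℝ (SiteY x.toKIdx × ι → ℝ)),
      HasMajorant (g := toB6 (geo9Y x) (0 : ℝ) True) (fun p : SiteY x.toKIdx × ι => blkC x.toKIdx ιB p.1) (Dl * GopC x.toKIdx par b c)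
        (fun a a' => cR * B₀ * (geo9Y x).len a * Real.exp (-(δc * (geo9Y x).dist a a'))) →
      HasMajorant (g := toB6 (geo9Y x) (0 : ℝ) True) (fun p : SiteY x.toKIdx × ι => blkC x.toKIdx ιB p.1) (GopC x.toKIdx par b c * Ds)
        (fun a a' => cR * B₀ * (geo9Y x).len a * Real.exp (-(δc * (geo9Y x).dist a a'))) →
      ∀ (y' : IBondY x.toKIdx) (μ : SiteY x.toKIdx × ι → ℝ) (M : ℝ),
        BlockSupp (g := toB6 (geo9Y x) (0 : ℝ) True) (fun p : SiteY x.toKIdx × ι => blkC x.toKIdx ιB p.1) μ y' M →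
      ∀ (N : ℝ), 0 ≤ N →
        (∀ (k : Fin (d + 1) ⊕ Fin (d + 1)) (z : SiteY x.toKIdx × ι),
          |(((conj b (diffLetter (shiftY x.toKIdx) (coordC G x.toKIdx c) ((((geo9Y x).eta : ℂ))⁻¹) k)) * GopC x.toKIdx par b c * Ds) μ) z| ≤
            N * Real.exp (-(δc * (geo9Y x).dist (blkC x.toKIdx ιB z.1) y'))) →
        (∀ z : SiteY x.toKIdx × ι, |((Dl * GopC x.toKIdx par b c * Ds) μ) z| ≤ N * Real.exp (-(δc * (geo9Y x).dist (blkC x.toKIdx ιB z.1) y'))) →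
        ∀ p : SiteY x.toKIdx × ι, |((Dl * GopC x.toKIdx par b ((codingYx P G x C37 C38).bg.mul c' c) * Ds) μ) p| ≤
          B * (N + M) * Real.exp (-(4 / 5 * δc * (geo9Y x).dist (blkC x.toKIdx ιB p.1) y'))) :
    E4Block (KSC₆ P G x par C37 C38) (wE4₆ (2 * ((d : ℝ) + 1)) (∑ j, ‖b j‖) M₂ B δc Bε) (4 / 5 * δc) ((codingYx P G x C37 C38).bg.mul c' c) := by
  classical
  letI : Fintype (B9GeoNormsKLevelV1.geo9K x.toKIdx).Site := ‹Fintype (geo9Y x).Site›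
  obtain ⟨U, a, rfl, rfl, hCa⟩ := (codingYx P G x C37 C38).exists_of_bg_Cplx337 h37
  have hU335 : (bg9YC 𝔸 G P x).Reg335 c35 α₀ U := by
    obtain ⟨U', h1, h2⟩ := (codingYx P G x C37 C38).exists_of_bg_Reg335 hreg
    cases h1
    exact h2
  have hU : GVal G x.toKIdx U := hU335.1.1
  set Sb : ℝ := ∑ j, ‖b j‖ with hSb
  have hSb0 : 0 ≤ Sb := Finset.sum_nonneg fun j _ => norm_nonneg _
  set TU : (SiteY x.toKIdx → 𝔸) →ₗ[ℂ] (SiteY x.toKIdx → 𝔸) := GpY x.toKIdx par U with hTU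
  set TW : (SiteY x.toKIdx → 𝔸) →ₗ[ℂ] (SiteY x.toKIdx → 𝔸) := GpY x.toKIdx par (decY x.toKIdx (.prod U a)) with hTW
  have hco : coordC G x.toKIdx (.base U) = UboxY x.toKIdx U := (letters_base_of_gVal G x.toKIdx par hU).1
  have hGopU : GopC x.toKIdx par b (.base U) = conj b (Gsc x.toKIdx TU) := by
    show conj b (((kGeo x.toKIdx).eta ^ 2) • (GpY x.toKIdx par U).restrictScalars ℝ) = conj b ((etaS x.toKIdx ^ 2) • TU.restrictScalars ℝ)
    rw [etaS_eq_eta]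
  have hGopW : GopC x.toKIdx par b ((codingYx P G x C37 C38).bg.mul (.mult a) (.base U)) = conj b (Gsc x.toKIdx TW) := by
    show conj b (((kGeo x.toKIdx).eta ^ 2) • (GpY x.toKIdx par (decY x.toKIdx (.prod U a))).restrictScalars ℝ) =
      conj b ((etaS x.toKIdx ^ 2) • TW.restrictScalars ℝ)
    rw [etaS_eq_eta]
  have hDk : ∀ k : Fin (d + 1) ⊕ Fin (d + 1),
      diffLetter (shiftY x.toKIdx) (coordC G x.toKIdx (.base U)) ((((geo9Y x).eta : ℂ))⁻¹) k =
        diffLetter (shiftY x.toKIdx) (UboxY x.toKIdx U) ((((etaS x.toKIdx : ℝ) : ℂ))⁻¹) k := by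
    intro k
    show diffLetter (shiftY x.toKIdx) (coordC G x.toKIdx (.base U)) ((((kGeo x.toKIdx).eta : ℝ) : ℂ))⁻¹ k = _
    rw [hco, etaS_eq_eta]
  have hUu : ∀ (μ : Fin (d + 1)) (w : SiteY x.toKIdx), ‖((UboxY x.toKIdx U μ w : 𝔸ˣ) : 𝔸)‖ ≤ 1 ∧ ‖(((UboxY x.toKIdx U μ w)⁻¹ : 𝔸ˣ) : 𝔸)‖ ≤ 1 :=
    fun μ w => norm_le_one_and_inv_of_mem G hG1 (hU μ _)
  have hdd : 0 ≤ 2 * ((d : ℝ) + 1) := by positivity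
  -- the (3.42) majorants at the base, lowered to the call rate
  obtain ⟨-, hm1, hm2, -⟩ := hread α₀ U B₀ δ hM hα₀ hMa hU335 hB₀ hδ hE
  have hlow : ∀ a a' : IBondY x.toKIdx, cR * B₀ * (geo9Y x).len a * Real.exp (-(δ * (geo9Y x).dist a a')) ≤
      cR * B₀ * (geo9Y x).len a * Real.exp (-(δc * (geo9Y x).dist a a')) := fun a a' =>
    mul_le_mul_of_nonneg_left (Real.exp_le_exp.2 (by nlinarith [geo9Y_dist_nonneg x a a'])) (mul_nonneg (mul_pos hcR hB₀).le (geo9Y_len_pos x a).le)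
  -- the output block
  intro ε lam y y' hε0 hε1 hlam
  have hW : 0 ≤ wE4₆ (2 * ((d : ℝ) + 1)) Sb M₂ B δc Bε ε := wE4₆_nonneg Bε hSb0 hB hM₂ ε
  have hHS : 0 ≤ (geo9Y x).holder ε lam + (geo9Y x).supNorm lam :=
    add_nonneg ((modelSignsOn_geo9K x.toKIdx).holder_nonneg ε lam) ((modelSignsOn_geo9K x.toKIdx).supNorm_nonneg lam)
  have hRHS : 0 ≤ wE4₆ (2 * ((d : ℝ) + 1)) Sb M₂ B δc Bε ε * Real.exp (-(4 / 5 * δc * (geo9Y x).dist y y')) *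
      ((geo9Y x).holder ε lam + (geo9Y x).supNorm lam) := mul_nonneg (mul_nonneg hW (Real.exp_pos _).le) hHS
  rcases lam with f | J
  swap
  · rw [KSC₆_e4_inr]; exact hRHS
  have hlam' : (geo9Y x).suppIn (Sum.inl f) y' := hlam
  have hsupN : 0 ≤ (geo9Y x).supNorm (Sum.inl f) := (modelSignsOn_geo9K x.toKIdx).supNorm_nonneg _
  have hhol : 0 ≤ (geo9Y x).holder ε (Sum.inl f) := (modelSignsOn_geo9K x.toKIdx).holder_nonneg ε _
  -- the labelled block of the support and the block support of `coord(f ⊗ E)`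
  set yL : IBondY x.toKIdx := ιB (β x.toKIdx.hN x.toKIdx.D x.toKIdx.hk y') with hyL
  have hyLβ : β x.toKIdx.hN x.toKIdx.D x.toKIdx.hk yL = β x.toKIdx.hN x.toKIdx.D x.toKIdx.hk y' := hι _
  have hlamL : (geo9Y x).suppIn (Sum.inl f) yL := by
    intro w hw; show B6Geom246MultiLevelBox.blkOf x.toKIdx.D.toDomains w = β x.toKIdx.hN x.toKIdx.D x.toKIdx.hk yL
    rw [hyLβ]; exact hlam' w hw
  have hdistL : ∀ t : IBondY x.toKIdx, (geo9Y x).dist t yL = (geo9Y x).dist t y' := fun t => geo9K_dist_congr x.toKIdx rfl hyLβ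
  -- the (3.44) data at the base, in U-letters, on every block
  set Bp : ℝ := max (Bε ε) 0 with hBp
  have hBp0 : 0 ≤ Bp := le_max_right _ _
  have he4U : ∀ (E : BallY 𝔸) (μ ν : Fin (d + 1)) (w : SiteY x.toKIdx),
      ‖cdS x.toKIdx U μ (TU (cdsS x.toKIdx U ν (liftY f (E : 𝔸)))) w‖ ≤
        Bp * Real.exp (-(δc * (geo9Y x).dist (blkC x.toKIdx ιB w) yL)) * ((geo9Y x).holder ε (Sum.inl f) + (geo9Y x).supNorm (Sum.inl f)) := by
    intro E μ ν w
    have hwb : blkY x.toKIdx w = β x.toKIdx.hN x.toKIdx.D x.toKIdx.hk (blkC x.toKIdx ιB w) := (hι _).symm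
    have h := e4_read P G x par C37 C38 ((e4Block_KSC₆_iff P G x par C37 C38 _).1 hE4) hε0 hε1 f (blkC x.toKIdx ιB w) yL hlamL E μ ν hwb
    refine h.trans ?_
    have hHS' : 0 ≤ (geo9Y x).holder ε (Sum.inl f) + (geo9Y x).supNorm (Sum.inl f) := add_nonneg hhol hsupN
    refine mul_le_mul_of_nonneg_right ?_ hHS'
    have hexp : Real.exp (-(δ * (geo9Y x).dist (blkC x.toKIdx ιB w) yL)) ≤ Real.exp (-(δc * (geo9Y x).dist (blkC x.toKIdx ιB w) yL)) :=
      Real.exp_le_exp.2 (by nlinarith [geo9Y_dist_nonneg x (blkC x.toKIdx ιB w) yL])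
    calc Bε ε * Real.exp (-(δ * (geo9Y x).dist (blkC x.toKIdx ιB w) yL))
        ≤ Bp * Real.exp (-(δ * (geo9Y x).dist (blkC x.toKIdx ιB w) yL)) := mul_le_mul_of_nonneg_right (le_max_left _ _) (Real.exp_pos _).le
      _ ≤ Bp * Real.exp (-(δc * (geo9Y x).dist (blkC x.toKIdx ιB w) yL)) := mul_le_mul_of_nonneg_left hexp hBp0
  -- the backward letter on the left: the exact neighbour identity, at the cost `e^{2(d+1)δc}`
  have he4U' : ∀ (E : BallY 𝔸) (μ ν : Fin (d + 1)) (w : SiteY x.toKIdx),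
      ‖cdsS x.toKIdx U μ (TU (cdsS x.toKIdx U ν (liftY f (E : 𝔸)))) w‖ ≤
        Bp * Real.exp (δc * (2 * ((d : ℝ) + 1))) * Real.exp (-(δc * (geo9Y x).dist (blkC x.toKIdx ιB w) yL)) *
          ((geo9Y x).holder ε (Sum.inl f) + (geo9Y x).supNorm (Sum.inl f)) := by
    intro E μ ν w
    refine (norm_cdsS_le_norm_cdS_symm_shift x.toKIdx U hUu μ _ w).trans ((he4U E μ ν _).trans ?_)
    have hHS' : 0 ≤ (geo9Y x).holder ε (Sum.inl f) + (geo9Y x).supNorm (Sum.inl f) := add_nonneg hhol hsupN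
    refine mul_le_mul_of_nonneg_right ?_ hHS'
    rw [mul_assoc]
    refine mul_le_mul_of_nonneg_left ?_ hBp0
    rw [← Real.exp_add]
    refine Real.exp_le_exp.2 ?_
    have hst := stencilB_blkC x.toKIdx ιB hι μ w
    have htri := geo9Y_dist_triangle x (blkC x.toKIdx ιB w) (blkC x.toKIdx ιB ((shiftY x.toKIdx μ).symm w)) yL
    have h3 : (geo9Y x).dist (blkC x.toKIdx ιB w) yL ≤ 2 * ((d : ℝ) + 1) + (geo9Y x).dist (blkC x.toKIdx ιB ((shiftY x.toKIdx μ).symm w)) yL := by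
      have hst' : (geo9Y x).dist (blkC x.toKIdx ιB w) (blkC x.toKIdx ιB ((shiftY x.toKIdx μ).symm w)) ≤ 2 * ((d : ℝ) + 1) := hst
      linarith
    have h4 := mul_le_mul_of_nonneg_left h3 hδc.le
    rw [mul_add] at h4
    linarith
  -- the (3.44) member of the reading at the product: each value of the ⨆
  rw [KSC₆_e4_inl]
  show (⨆ E : BallY 𝔸, ⨆ μ : Fin (d + 1), supBlkS' x.toKIdx (β x.toKIdx.hN x.toKIdx.D x.toKIdx.hk y)
      (fun ν => cdS x.toKIdx U μ (TW (cdsS x.toKIdx U ν (liftY f (E : 𝔸)))))) ≤ _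
  refine Real.iSup_le (fun E => Real.iSup_le (fun μ => supBlkS'_le x.toKIdx _ _ hRHS fun w ν hw => ?_) hRHS) hRHS
  have hE1 : ‖(E : 𝔸)‖ ≤ 1 := mem_closedBall_zero_iff.1 E.2
  have hwL : blkC x.toKIdx ιB w = ιB (β x.toKIdx.hN x.toKIdx.D x.toKIdx.hk y) := by
    show ιB (blkY x.toKIdx w) = _; rw [show blkY x.toKIdx w = _ from hw]
  have hdistw : (geo9Y x).dist (blkC x.toKIdx ιB w) yL = (geo9Y x).dist y y' := by
    rw [hwL]; exact geo9K_dist_congr x.toKIdx (hι _) hyLβ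
  -- the two letters of the output word, the input, the data
  set Dl : Module.End ℝ (SiteY x.toKIdx × ι → ℝ) := conj b (gradLetterF (shiftY x.toKIdx) (UboxY x.toKIdx U) ((((etaS x.toKIdx : ℝ) : ℂ))⁻¹) μ) with hDl
  set Ds : Module.End ℝ (SiteY x.toKIdx × ι → ℝ) :=
    conj b (diffLetter (shiftY x.toKIdx) (coordC G x.toKIdx (.base U)) ((((geo9Y x).eta : ℂ))⁻¹) (Sum.inr ν)) with hDs
  have hDsU : Ds = conj b (-gradLetterB (shiftY x.toKIdx) (UboxY x.toKIdx U) ((((etaS x.toKIdx : ℝ) : ℂ))⁻¹) ν) := by rw [hDs, hDk, diffLetter_inr]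
  have hDlU : Dl = conj b (diffLetter (shiftY x.toKIdx) (coordC G x.toKIdx (.base U)) ((((geo9Y x).eta : ℂ))⁻¹) (Sum.inl μ)) := by
    rw [hDl, hDk, diffLetter_inl]
  have hmajL : HasMajorant (g := toB6 (geo9Y x) (0 : ℝ) True) (fun p : SiteY x.toKIdx × ι => blkC x.toKIdx ιB p.1) (Dl * GopC x.toKIdx par b (.base U))
      (fun a a' => cR * B₀ * (geo9Y x).len a * Real.exp (-(δc * (geo9Y x).dist a a'))) := by
    rw [hDlU]; exact hasMajorant_mono _ (hm1 (Sum.inl μ)) hlow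
  have hmajR : HasMajorant (g := toB6 (geo9Y x) (0 : ℝ) True) (fun p : SiteY x.toKIdx × ι => blkC x.toKIdx ιB p.1) (GopC x.toKIdx par b (.base U) * Ds)
      (fun a a' => cR * B₀ * (geo9Y x).len a * Real.exp (-(δc * (geo9Y x).dist a a'))) :=
    hasMajorant_mono _ (hm2 (Sum.inr ν)) hlow
  have hBS : BlockSupp (g := toB6 (geo9Y x) (0 : ℝ) True) (fun p : SiteY x.toKIdx × ι => blkC x.toKIdx ιB p.1)
      (coordEquiv b (liftY f (E : 𝔸))) yL (M₂ * (geo9Y x).supNorm (Sum.inl f)) :=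
    blockSupp_coordEquiv_liftY x.toKIdx b ιB hM₂ hrepr f y' hlam' hE1
  set N : ℝ := M₂ * (Bp * Real.exp (δc * (2 * ((d : ℝ) + 1))) * ((geo9Y x).holder ε (Sum.inl f) + (geo9Y x).supNorm (Sum.inl f))) with hN
  have hN0 : 0 ≤ N := by positivity
  have hliftE : (coordEquiv b).symm (coordEquiv b (liftY f (E : 𝔸))) = liftY f (E : 𝔸) := LinearEquiv.symm_apply_apply _ _
  -- (N1) the sup data for every letter on the left
  have hN1 : ∀ (k : Fin (d + 1) ⊕ Fin (d + 1)) (z : SiteY x.toKIdx × ι),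
      |(((conj b (diffLetter (shiftY x.toKIdx) (coordC G x.toKIdx (.base U)) ((((geo9Y x).eta : ℂ))⁻¹) k)) * GopC x.toKIdx par b (.base U) * Ds)
        (coordEquiv b (liftY f (E : 𝔸)))) z| ≤ N * Real.exp (-(δc * (geo9Y x).dist (blkC x.toKIdx ιB z.1) yL)) := by
    intro k z
    refine (abs_apply_le_norm_symm x b hrepr _ z).trans ?_
    rw [hDk, hGopU, hDsU]
    rcases k with μ' | μ'
    · rw [diffLetter_inl, norm_symm_gradF_G_negGradB x b TU U μ' ν _ z.1, hliftE]
      refine (mul_le_mul_of_nonneg_left (he4U E μ' ν z.1) hM₂).trans ?_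
      rw [hN]
      have hone : (1 : ℝ) ≤ Real.exp (δc * (2 * ((d : ℝ) + 1))) := Real.one_le_exp (by positivity)
      have hHS' : 0 ≤ (geo9Y x).holder ε (Sum.inl f) + (geo9Y x).supNorm (Sum.inl f) := add_nonneg hhol hsupN
      have he0 : 0 ≤ Real.exp (-(δc * (geo9Y x).dist (blkC x.toKIdx ιB z.1) yL)) := (Real.exp_pos _).le
      calc M₂ * (Bp * Real.exp (-(δc * (geo9Y x).dist (blkC x.toKIdx ιB z.1) yL)) * ((geo9Y x).holder ε (Sum.inl f) + (geo9Y x).supNorm (Sum.inl f)))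
          = (M₂ * (Bp * 1 * ((geo9Y x).holder ε (Sum.inl f) + (geo9Y x).supNorm (Sum.inl f)))) *
              Real.exp (-(δc * (geo9Y x).dist (blkC x.toKIdx ιB z.1) yL)) := by ring
        _ ≤ (M₂ * (Bp * Real.exp (δc * (2 * ((d : ℝ) + 1))) * ((geo9Y x).holder ε (Sum.inl f) + (geo9Y x).supNorm (Sum.inl f)))) *
              Real.exp (-(δc * (geo9Y x).dist (blkC x.toKIdx ιB z.1) yL)) := by
            refine mul_le_mul_of_nonneg_right (mul_le_mul_of_nonneg_left ?_ hM₂) he0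
            exact mul_le_mul_of_nonneg_right (mul_le_mul_of_nonneg_left hone hBp0) hHS'
    · rw [diffLetter_inr, norm_symm_negGradB_G_negGradB x b TU U μ' ν _ z.1, hliftE]
      refine (mul_le_mul_of_nonneg_left (he4U' E μ' ν z.1) hM₂).trans (le_of_eq ?_)
      rw [hN]; ring
  -- (N2) the sup data of the unperturbed output word
  have hN2 : ∀ z : SiteY x.toKIdx × ι, |((Dl * GopC x.toKIdx par b (.base U) * Ds) (coordEquiv b (liftY f (E : 𝔸)))) z| ≤
      N * Real.exp (-(δc * (geo9Y x).dist (blkC x.toKIdx ιB z.1) yL)) := by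
    intro z
    have h := hN1 (Sum.inl μ) z
    rwa [← hDlU] at h
  -- the transfer and the coordinates of the output word
  have hout := HV Dl Ds hmajL hmajR yL (coordEquiv b (liftY f (E : 𝔸))) _ hBS N hN0 hN1 hN2
  have hval : ‖cdS x.toKIdx U μ (TW (cdsS x.toKIdx U ν (liftY f (E : 𝔸)))) w‖ =
      ‖(coordEquiv b).symm ((Dl * GopC x.toKIdx par b ((codingYx P G x C37 C38).bg.mul (.mult a) (.base U)) * Ds)
        (coordEquiv b (liftY f (E : 𝔸)))) w‖ := by
    rw [hGopW, hDsU, hDl, norm_symm_gradF_G_negGradB x b TW U μ ν _ w, hliftE]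
  rw [hval]
  refine (norm_coordEquiv_symm_apply_le x.toKIdx b _ w
    (C := B * (N + M₂ * (geo9Y x).supNorm (Sum.inl f)) * Real.exp (-(4 / 5 * δc * (geo9Y x).dist (blkC x.toKIdx ιB w) yL)))
    fun j => hout (w, j)).trans ?_
  rw [hdistw]
  -- arithmetic: `Σ‖b‖·B·(N + M₂|f|)·e ≦ wE4₆ ε · e · (‖f‖_ε + |f|)`
  have he0 : 0 ≤ Real.exp (-(4 / 5 * δc * (geo9Y x).dist y y')) := (Real.exp_pos _).le
  have hNM : N + M₂ * (geo9Y x).supNorm (Sum.inl f) ≤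
      M₂ * (Bp * Real.exp (δc * (2 * ((d : ℝ) + 1))) + 1) * ((geo9Y x).holder ε (Sum.inl f) + (geo9Y x).supNorm (Sum.inl f)) := by
    rw [hN]
    have h1 : M₂ * (geo9Y x).supNorm (Sum.inl f) ≤ M₂ * ((geo9Y x).holder ε (Sum.inl f) + (geo9Y x).supNorm (Sum.inl f)) :=
      mul_le_mul_of_nonneg_left (le_add_of_nonneg_left hhol) hM₂
    nlinarith
  calc Sb * (B * (N + M₂ * (geo9Y x).supNorm (Sum.inl f)) * Real.exp (-(4 / 5 * δc * (geo9Y x).dist y y')))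
      = (Sb * B) * (N + M₂ * (geo9Y x).supNorm (Sum.inl f)) * Real.exp (-(4 / 5 * δc * (geo9Y x).dist y y')) := by ring
    _ ≤ (Sb * B) * (M₂ * (Bp * Real.exp (δc * (2 * ((d : ℝ) + 1))) + 1) * ((geo9Y x).holder ε (Sum.inl f) + (geo9Y x).supNorm (Sum.inl f))) *
          Real.exp (-(4 / 5 * δc * (geo9Y x).dist y y')) :=
        mul_le_mul_of_nonneg_right (mul_le_mul_of_nonneg_left hNM (mul_nonneg hSb0 hB)) he0
    _ = wE4₆ (2 * ((d : ℝ) + 1)) Sb M₂ B δc Bε ε * Real.exp (-(4 / 5 * δc * (geo9Y x).dist y y')) *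
          ((geo9Y x).holder ε (Sum.inl f) + (geo9Y x).supNorm (Sum.inl f)) := by rw [wE4₆, ← hBp]; ring

end Transfer

/-! ## §5 ★★ The frame instance over the coded carriers of a subfamily and the (3.44) block-steps -/

section Steps

variable [NormOneClass 𝔸] {J : Type} (f : J → MemberY d ℓ hd hL b₀ b₁ Mstar) [∀ x : MemberY d ℓ hd hL b₀ b₁ Mstar, Fintype (geo9Y x).Site]
  [instDS : ∀ x : MemberY d ℓ hd hL b₀ b₁ Mstar, DecidableEq (geo9Y x).Site] [instNE : ∀ x : MemberY d ℓ hd hL b₀ b₁ Mstar, Nonempty (geo9Y x).Site]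
  (c35 : ℝ) (G : Subgroup 𝔸ˣ) (par : ∀ j : J, SiteParY 𝔸 (f j).toKIdx) (OA : ∀ j : J, BondOpY 𝔸 (f j).toKIdx)
  (parB : ∀ j : J, BondParY 𝔸 (f j).toKIdx) {ι : Type} [Fintype ι] [DecidableEq ι] (b : Module.Basis ι ℝ 𝔸)
  (ιB : ∀ j : J, BlkY (f j).toKIdx → IBondY (f j).toKIdx)
  (C37 C38 : ∀ j : J, ℝ → CfgY 𝔸 (f j).toKIdx → AfldY 𝔸 (f j).toKIdx → Prop)
  (Cinv : ∀ j : J, B9.SiteKernel (geo9Y (f j)) (bg9YC 𝔸 G P (f j)))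

/-- ★★ **THE (3.44) FRAME OVER THE CODED CARRIERS OF A SUBFAMILY, INHABITED FOR `KSC₆`** (root frame `gpFrame₂CodedOn` with `KSC₆`'s dictionaries, writing function
`wE4₆`, rate `4δc∕5`, transfer field `e4_transfer_KSC₆`); no hypothesis beyond the root frame's.
[cite: Balaban1985BackgroundPropagators, Thm 3.4 p.400, (3.44) p.398, p.403 l.2–5, (3.60)–(3.65) pp.402–403; Balaban1984PropagatorsII, Lemma 2.1 p.234, (2.51)–(2.52) p.232] -/
noncomputable def e4Frame₃CodedOn (hι : ∀ (j : J) (s : BlkY (f j).toKIdx), β (f j).toKIdx.hN (f j).toKIdx.D (f j).toKIdx.hk (ιB j s) = s)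
    (hG1 : ∀ u : 𝔸ˣ, u ∈ G → ‖(u : 𝔸)‖ ≤ 1) (hpar : ∀ j (U : CfgY 𝔸 (f j).toKIdx), GVal G (f j).toKIdx U → ∀ z w, par j U z w ∈ G)
    (hunit : ∀ j (U : CfgY 𝔸 (f j).toKIdx), GVal G (f j).toKIdx U → IsUnit (deltaPrimeAY (f j).toKIdx (par j) U))
    (dB : ℕ) (M₂ : ℝ) (hM₂ : 0 ≤ M₂) (hrepr : ∀ (v : 𝔸) (j : ι), |b.repr v j| ≤ M₂ * ‖v‖) (hcR : 0 < M₂ * ∑ j, ‖b j‖)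
    (Cq : ℝ) (hCq : 0 ≤ Cq) (hC37 : ∀ j β' U a, C37 j β' U a → GVal G (f j).toKIdx U ∧ CplxLettersY G (f j) (par j) (ιB j) Cq β' U a)
    (MInv aInv aW : ℝ) (hMInv : 0 < MInv) (haInv : 0 < aInv) (haW : 0 < aW) :
    E4Frame₃ c35 (fun j => geo9Y (f j)) (fun j => (codingYx P G (f j) (C37 j) (C38 j)).bg) (fun j => KSC₆ P G (f j) (par j) (C37 j) (C38 j)) b
      (Fin (d + 1)) (fun j => SiteY (f j).toKIdx) :=
  { gpFrame₂CodedOn P f c35 G b C37 C38 par ιB (fun j => KSC₆ P G (f j) (par j) (C37 j) (C38 j)) hι hG1 hpar hunit dB M₂ hM₂ hrepr Cq hCq hC37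
      (M₂ * ∑ j, ‖b j‖) hcR (fun B _ => (M₂ * ∑ j, ‖b j‖) * B + 1) (fun B _ hB _ => by positivity) (fun δ => δ) (fun δ hδ => hδ)
      MInv aInv aW hMInv haInv haW (fun j => read342Y_KSC₆ P G (f j) (par j) b (ιB j) (C37 j) (C38 j) (hι j) M₂ hM₂ hrepr c35 MInv aInv)
      (fun j => write342Y_KSC₆ P G (f j) (par j) b (ιB j) (C37 j) (C38 j) (hι j) M₂ hM₂ hrepr aW fun β' U a h => (hC37 j β' U a h).1) with
    wE4 := fun B δc Bε => wE4₆ (2 * ((d : ℝ) + 1)) (∑ j, ‖b j‖) M₂ B δc Bε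
    wE4δ := fun δc => 4 / 5 * δc
    wE4δ_pos := fun δc hδc => by positivity
    e4_transfer := fun j α₀ c c' α₁ B₀ B δ δc Bε hM hα₀ hMa hreg hα₁ haW' h37 hB₀ hB hδ hδc hδcδ hE hE4 HV =>
      e4_transfer_KSC₆ P c35 G (f j) (par j) b (ιB j) (C37 j) (C38 j) (hι j) hG1 hM₂ hrepr hcR
        (read342Y_KSC₆ P G (f j) (par j) b (ιB j) (C37 j) (C38 j) (hι j) M₂ hM₂ hrepr c35 MInv aInv)
        α₀ c c' α₁ B₀ B δ δc Bε hM hα₀ hMa hreg hα₁ haW' h37 hB₀ hB hδ hδc hδcδ hE hE4 HV }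

/-- ★★ **`StepE4Pos` OF `KSC₆` OVER THE CODED CARRIERS** (any shared `GA`, `Cinv`). [cite: Balaban1985BackgroundPropagators, Thm 3.4 p.400, (3.44) p.398, p.403 l.2–5; Balaban1984PropagatorsII, Lemma 2.1 p.234] -/
theorem stepE4Pos_KSC₆_on (hι : ∀ (j : J) (s : BlkY (f j).toKIdx), β (f j).toKIdx.hN (f j).toKIdx.D (f j).toKIdx.hk (ιB j s) = s)
    (hG1 : ∀ u : 𝔸ˣ, u ∈ G → ‖(u : 𝔸)‖ ≤ 1) (hpar : ∀ j (U : CfgY 𝔸 (f j).toKIdx), GVal G (f j).toKIdx U → ∀ z w, par j U z w ∈ G)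
    (hunit : ∀ j (U : CfgY 𝔸 (f j).toKIdx), GVal G (f j).toKIdx U → IsUnit (deltaPrimeAY (f j).toKIdx (par j) U))
    (dB : ℕ) (M₂ : ℝ) (hM₂ : 0 ≤ M₂) (hrepr : ∀ (v : 𝔸) (j : ι), |b.repr v j| ≤ M₂ * ‖v‖) (hcR : 0 < M₂ * ∑ j, ‖b j‖)
    (Cq : ℝ) (hCq : 0 ≤ Cq) (hC37 : ∀ j β' U a, C37 j β' U a → GVal G (f j).toKIdx U ∧ CplxLettersY G (f j) (par j) (ιB j) Cq β' U a)
    (MInv aInv aW : ℝ) (hMInv : 0 < MInv) (haInv : 0 < aInv) (haW : 0 < aW)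
    (GA : ∀ j : J, B9.KernelFamily (geo9Y (f j)) (codingYx P G (f j) (C37 j) (C38 j)).bg)
    (CinvC : ∀ j : J, B9.SiteKernel (geo9Y (f j)) (codingYx P G (f j) (C37 j) (C38 j)).bg) :
    StepE4Pos dB c35 (fun j => geo9Y (f j)) (fun j => (codingYx P G (f j) (C37 j) (C38 j)).bg) (fun j => KSC₆ P G (f j) (par j) (C37 j) (C38 j)) GA CinvC
      (fun j => KSC₆ P G (f j) (par j) (C37 j) (C38 j)) :=
  stepE4Pos_of_e4Frame₃ (d := dB)
    (e4Frame₃CodedOn P f c35 G par b ιB C37 C38 hι hG1 hpar hunit dB M₂ hM₂ hrepr hcR Cq hCq hC37 MInv aInv aW hMInv haInv haW) GA CinvC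

omit [NormOneClass 𝔸] [FiniteDimensional ℝ 𝔸] [DecidableEq ι] instDS instNE in
/-- ★ **`hin` FOR `KSC₆` WITH POSITIVE OUTPUT CONSTANTS** (input families `(KSCU, KACU, pullS Cinv)`): g11's `hin_KSCU_on_pos` (output `KSC`) followed by the base
congruence `KSC ↦ KSC₆`. [cite: Balaban1985BackgroundPropagators, Thms 3.1–3.3 (3.42)–(3.48) pp.397–399, (3.35) p.396; Balaban1984PropagatorsII, (2.51) p.232] -/
theorem hin_KSC₆_on_pos (hι : ∀ (j : J) (s : BlkY (f j).toKIdx), β (f j).toKIdx.hN (f j).toKIdx.D (f j).toKIdx.hk (ιB j s) = s)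
    (hG1 : ∀ u : 𝔸ˣ, u ∈ G → ‖(u : 𝔸)‖ ≤ 1) {M₂ : ℝ} (hM₂ : 0 ≤ M₂) (hrepr : ∀ (v : 𝔸) (j : ι), |b.repr v j| ≤ M₂ * ‖v‖) (dC : ℕ) :
    ∀ (B₀ δ₀ : ℝ) (Bβ Bε : ℝ → ℝ) (Bεβ : ℝ → ℝ → ℝ) (B₁ δ₁ : ℝ), 0 < B₀ → 0 < δ₀ → 0 < B₁ → 0 < δ₁ →
      ∃ (Mi ai B₀' δ₀' : ℝ) (Bβ' Bε' : ℝ → ℝ) (Bεβ' : ℝ → ℝ → ℝ) (B₁' δ₁' : ℝ), 0 < ai ∧ 0 < B₀' ∧ 0 < δ₀' ∧ 0 < B₁' ∧ 0 < δ₁' ∧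
        ∀ j : J, Mi ≤ (geo9Y (f j)).M → ∀ α₀ : ℝ, 0 < α₀ → (geo9Y (f j)).M * α₀ ≤ ai →
          ∀ c : (codingYx P G (f j) (C37 j) (C38 j)).bg.Cfg, (codingYx P G (f j) (C37 j) (C38 j)).bg.Reg335 c35 α₀ c →
          B9.Thms31to33IneqAt dC (KSCU P G (f j) (par j) (C37 j) (C38 j)) (KACU P G (f j) (OA j) (parB j) (C37 j) (C38 j))
              (pullS (codingYx P G (f j) (C37 j) (C38 j)) (Cinv j)) B₀ δ₀ Bβ Bε Bεβ B₁ δ₁ c →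
          B9.Thms31to33IneqAt dC (KSC₆ P G (f j) (par j) (C37 j) (C38 j)) (KACU P G (f j) (OA j) (parB j) (C37 j) (C38 j))
              (pullS (codingYx P G (f j) (C37 j) (C38 j)) (Cinv j)) B₀' δ₀' Bβ' Bε' Bεβ' B₁' δ₁' c := by
  intro B₀ δ₀ Bβ Bε Bεβ B₁ δ₁ hB₀ hδ₀ hB₁ hδ₁
  obtain ⟨Mi, ai, B₀', δ₀', Bβ', Bε', Bεβ', B₁', δ₁', hai, hB₀', hδ₀', hB₁', hδ₁', H⟩ :=
    hin_KSCU_on_pos P f c35 G par OA parB b ιB C37 C38 Cinv hι hG1 hM₂ hrepr dC B₀ δ₀ Bβ Bε Bεβ B₁ δ₁ hB₀ hδ₀ hB₁ hδ₁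
  refine ⟨Mi, ai, B₀', δ₀', Bβ', Bε', Bεβ', B₁', δ₁', hai, hB₀', hδ₀', hB₁', hδ₁', fun j hM α₀ hα₀ hMa c hreg hT => ?_⟩
  obtain ⟨U, rfl, -⟩ := (codingYx P G (f j) (C37 j) (C38 j)).exists_of_bg_Reg335 hreg
  obtain ⟨⟨h42, h43⟩, hC, hG⟩ := H j hM α₀ hα₀ hMa _ hreg hT
  obtain ⟨se, sh1, se4, sh2, sl2, sg⟩ := KSC₆_members_base P G (f j) (par j) (C37 j) (C38 j) U
  exact ⟨⟨ineq342_346_347_congr P G (f j) (C37 j) (C38 j) _ _ (fun n => (se n).symm) (fun n => (sl2 n).symm) (fun n => (sg n).symm) _ _ h42,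
    ineq343_345_congr P G (f j) (C37 j) (C38 j) _ _ sh1.symm se4.symm sh2.symm _ _ _ _ h43⟩, hC, hG⟩

/-- ★★ **`StepE4Pos` OF `KSCU` OVER THE CODED CARRIER — THE (3.44) MEMBER OF THE SECT.-B STEP OF RECORD IN PRINT's READING (R13-U1), G′ SIDE** (input
families `(KSCU, KACU, pullS Cinv)`, output `KSCU`'s (3.44) block at the product): `stepE4Pos_KSC₆_on` (with `GA := KACU`, `Cinv := pullS Cinv`) transported
by `stepE4Pos_of_family_pos` — `hin_KSC₆_on_pos`, identity output (`KSC₆.e4 = KSCU.e4`).  Binders = those of `B9SectBStepsKSCUBlocks.stepEPos_KSCU_on`.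
[cite: Balaban1985BackgroundPropagators, Thm 3.4 p.400, (3.44) p.398, p.403 l.2–5, (3.60)–(3.65) pp.402–403, (3.35)–(3.37) p.396; Balaban1984PropagatorsII, Lemma 2.1 p.234, (2.51)–(2.52) p.232] -/
theorem stepE4Pos_KSCU_on (hι : ∀ (j : J) (s : BlkY (f j).toKIdx), β (f j).toKIdx.hN (f j).toKIdx.D (f j).toKIdx.hk (ιB j s) = s)
    (hG1 : ∀ u : 𝔸ˣ, u ∈ G → ‖(u : 𝔸)‖ ≤ 1) (hpar : ∀ j (U : CfgY 𝔸 (f j).toKIdx), GVal G (f j).toKIdx U → ∀ z w, par j U z w ∈ G)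
    (hunit : ∀ j (U : CfgY 𝔸 (f j).toKIdx), GVal G (f j).toKIdx U → IsUnit (deltaPrimeAY (f j).toKIdx (par j) U))
    (dB : ℕ) (M₂ : ℝ) (hM₂ : 0 ≤ M₂) (hrepr : ∀ (v : 𝔸) (j : ι), |b.repr v j| ≤ M₂ * ‖v‖) (hcR : 0 < M₂ * ∑ j, ‖b j‖)
    (Cq : ℝ) (hCq : 0 ≤ Cq) (hC37 : ∀ j β' U a, C37 j β' U a → GVal G (f j).toKIdx U ∧ CplxLettersY G (f j) (par j) (ιB j) Cq β' U a)
    (MInv aInv aW : ℝ) (hMInv : 0 < MInv) (haInv : 0 < aInv) (haW : 0 < aW) :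
    StepE4Pos dB c35 (fun j => geo9Y (f j)) (fun j => (codingYx P G (f j) (C37 j) (C38 j)).bg)
      (fun j => KSCU P G (f j) (par j) (C37 j) (C38 j)) (fun j => KACU P G (f j) (OA j) (parB j) (C37 j) (C38 j))
      (fun j => pullS (codingYx P G (f j) (C37 j) (C38 j)) (Cinv j)) (fun j => KSCU P G (f j) (par j) (C37 j) (C38 j)) :=
  stepE4Pos_of_family_pos dB c35 (fun j => geo9Y (f j)) (fun j => (codingYx P G (f j) (C37 j) (C38 j)).bg)
    (fun j => KSC₆ P G (f j) (par j) (C37 j) (C38 j)) (fun j => KSCU P G (f j) (par j) (C37 j) (C38 j))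
    (fun j => KACU P G (f j) (OA j) (parB j) (C37 j) (C38 j)) (fun j => KACU P G (f j) (OA j) (parB j) (C37 j) (C38 j))
    (fun j => pullS (codingYx P G (f j) (C37 j) (C38 j)) (Cinv j))
    (fun j => KSC₆ P G (f j) (par j) (C37 j) (C38 j)) (fun j => KSCU P G (f j) (par j) (C37 j) (C38 j))
    (hin_KSC₆_on_pos P f c35 G par OA parB b ιB C37 C38 Cinv hι hG1 hM₂ hrepr dB)
    (fun Bε δ a hδ ha => ⟨0, 1, a, Bε, δ, one_pos, ha, le_rfl, hδ, fun j _ _ _ _ _ _ _ _ _ _ _ h => (e4Block_KSC₆_iff P G (f j) (par j) (C37 j) (C38 j) _).1 h⟩)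
    (stepE4Pos_KSC₆_on P f c35 G par b ιB C37 C38 hι hG1 hpar hunit dB M₂ hM₂ hrepr hcR Cq hCq hC37 MInv aInv aW hMInv haInv haW _ _)

end Steps

end Literature.MathematicalPhysics.QuantumFieldTheory.Balaban1983to89.B9SectBE4FrameCodedYR

end

/-!
# `Balaban1983to89.B9SectBE4H2GReadWriteYR` — THE CLASS-PARAMETRIC TWIN of `B9SectBE4H2GReadWriteY` (CASCADE-R, director-ym №279 GO-R; №277 (3) `hunitA` cure; dag-n06-d SOCKET-(α) class question)

statement-level skeleton of published theorems with citation tags; proofs where landed; nothing here is a claim about the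
Yang–Mills mass gap

WHAT THIS FILE IS.  The original module `B9SectBE4H2GReadWriteY` types its objects over MODULE 3's member carrier `bg9Y 𝔸 G x` (MODULE 2's small-cube class (3.35)).  This file RE-DECLARES, with UNCHANGED NAMES inside the namespace `…B9SectBE4H2GReadWriteYR`, exactly its 4 class-dependent declarations over the CLASS-PARAMETRIC carrier `B9SectBCodedClassR.bg9YC 𝔸 G P x` (`P : RegExtraY …` = the two cube conditions of (3.35)∕(3.36) as a parameter; `bg9Y 𝔸 G x = bg9YC 𝔸 G (extraY 𝔸 G) x` by `rfl`, so every declaration here specialises definitionally to its original; at the record's reading of PRINT's class, `P := extraYPb 𝔸 G`, the displayed laws `hreg335P` ((3.35) on plaquettes) and the class-keyed `hunitA` become theorems).  The text is the original's VERBATIM under the token surgery `bg9Y 𝔸 G ↦ bg9YC 𝔸 G P`, `NAME ↦ NAME P` for the class-dependent names (P the first explicit argument), and — №277 — the binder `hunitA` re-keyed from «all G-valued U» to «all (3.35)-regular U of the carrier» (`∀ j α₀ U, (bg9YC 𝔸 G P (f j)).Reg335 c35 α₀ U → IsUnit (deltaAY …)`).  Class-free declarations of the original are NOT copied: they are imported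 and used BY NAME (`open … hiding` the re-declared ones).  Generated by dag-n06-c g16's `gen.py` (HOME `pub-ymgap-dag-n06-c/lean/g16/`); the ORIGINAL MODULE DOCUMENTATION FOLLOWS VERBATIM and describes the mathematics.

HONEST SCOPE.  Re-typing bookkeeping; nothing of [B9] asserted beyond the original; COUNT-NEUTRAL; N06 NOT discharged; nothing continuum ∕ OS ∕ mass gap ∕ Clay.  Cell `pub-ymgap` (D-0062), Track A node N06 [B9], seat `pub-ymgap-dag-n06-c` g16, 2026-08-29.
-/

/-! Module documentation: that of the original `Balaban1983to89.B9SectBE4H2GReadWriteY` applies verbatim to this twin (not repeated here). -/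

noncomputable section

namespace Literature.MathematicalPhysics.QuantumFieldTheory.Balaban1983to89.B9SectBE4H2GReadWriteYR

open Literature.MathematicalPhysics.QuantumFieldTheory.Balaban1983to89.B9SectBCodedClassR (RegExtraY bg9YC)
open Literature.MathematicalPhysics.QuantumFieldTheory.Balaban1983to89.B9SectBE4H2GReadWriteY hiding KACU_e4_inr_eq KACU_e4_inl KACU_h2_inr_eq KACU_h2_off

open LatticeFieldCalculus (supDist)
open B9Eq39Adjoint (R)
open B6GlobalChartV1 (PV blkV1)
open B6Ineq2142KLevelV1 (β)
open B6KLevelCensusIndexV1 (KIdx Adm)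
open B9CoReadingCoords (cdBₗ cdsBₗ cdBₗ_apply cdsBₗ_apply)
open B9CubeLettersInvReadDictB (supInB_le norm_le_supInB supInB_nonneg)
open B9PinMembersKLevelV1 (MemberY geo9Y)
open B9Eq360DeltaPrimeAY (AfldY)
open B9SectBGpFrameCodedYR (codingYx)
open B9SectBGpReadingsY (baseY)
open B9SectBGpLettersY (decY)
open B9SectBCodedReadingsUR (KACU)
open Node00 (SiteY BlkY FBondY IBondY CfgY BallY BondOpY BondParY liftY liftY_apply holderQB supInB cdB cdsB iSup_ball_le)
open Node00.OpsYHolderFar (holderQB_nonneg)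
open B9Thm314WholeExpansionReads (le_iSup_ball_iSup₂)
open B9SectBH1GReadWriteY (probeB norm_probeB norm_probeB_le_holderQB holderQB_le_of_probeB holderQB_liftY_le_sum word_liftY_eq_sum)

variable {d ℓ : ℕ} {hd : 1 ≤ d + 1} {hL : Odd (ℓ + 1) ∧ 1 < ℓ + 1} {b₀ b₁ : ℝ} {Mstar : ℕ}
variable {𝔸 : Type} [NormedRing 𝔸] (P : RegExtraY d ℓ hd hL b₀ b₁ Mstar 𝔸) [NormedAlgebra ℂ 𝔸] [CompleteSpace 𝔸]
variable (i : KIdx d ℓ hd hL b₀ b₁)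

/-! ## §1 The two readings and their bridges to `KACU` -/

section KACUFaces

variable (G : Subgroup 𝔸ˣ) (x : MemberY d ℓ hd hL b₀ b₁ Mstar) (OA : BondOpY 𝔸 x.toKIdx) (parB : BondParY 𝔸 x.toKIdx)
  (C37 C38 : ℝ → CfgY 𝔸 x.toKIdx → AfldY 𝔸 x.toKIdx → Prop)

/-- ★ the (3.44) member of `KACU` at a coded configuration: the reading of `OA (dec c)` in the letters of `base c` on the block of `y` (`rfl`).
[cite: Balaban1985BackgroundPropagators, (3.44) p.398, Thm 3.4 p.400, bookkeeping] -/
theorem KACU_e4_inr_eq (c : (codingYx P G x C37 C38).bg.Cfg) (J : FBondY x.toKIdx → ℝ) (y : IBondY x.toKIdx) :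
    (KACU P G x OA parB C37 C38).e4 c (.inr J) y =
      e4ReadB x.toKIdx (OA (decY x.toKIdx c)) (baseY x.toKIdx c) J (β x.toKIdx.hN x.toKIdx.D x.toKIdx.hk y) := rfl

/-- the (3.44) member of `KACU` vanishes on site-sector arguments (`rfl`). [cite: Balaban1985BackgroundPropagators, (3.44) p.398, bookkeeping] -/
theorem KACU_e4_inl (c : (codingYx P G x C37 C38).bg.Cfg) (f : SiteY x.toKIdx → ℝ) (y : IBondY x.toKIdx) : (KACU P G x OA parB C37 C38).e4 c (.inl f) y = 0 := rfl

/-- ★ the (3.45) member of `KACU` at a coded configuration: the reading of `OA (dec c)` with the transporter and letters of `base c` (`rfl`).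
[cite: Balaban1985BackgroundPropagators, (3.45) p.398, Thm 3.4 p.400, bookkeeping] -/
theorem KACU_h2_inr_eq (c : (codingYx P G x C37 C38).bg.Cfg) (J : FBondY x.toKIdx → ℝ) (α : ℝ) (z : FBondY x.toKIdx → ℝ) :
    (KACU P G x OA parB C37 C38).h2 c (.inr J) α (.inr z) =
      h2ReadB x.toKIdx (OA (decY x.toKIdx c)) (parB (baseY x.toKIdx c)) (baseY x.toKIdx c) J α z := rfl

/-- the (3.45) member of `KACU` vanishes OFF the (bond argument, bond cut-off) sector (`rfl` ×3). [cite: Balaban1985BackgroundPropagators, (3.45) p.398, bookkeeping] -/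
theorem KACU_h2_off (c : (codingYx P G x C37 C38).bg.Cfg) (α : ℝ) :
    (∀ (J : FBondY x.toKIdx → ℝ) (zs : SiteY x.toKIdx → ℝ), (KACU P G x OA parB C37 C38).h2 c (.inr J) α (.inl zs) = 0) ∧
    (∀ (f : SiteY x.toKIdx → ℝ) (ζ : (geo9Y x).Cut), (KACU P G x OA parB C37 C38).h2 c (.inl f) α ζ = 0) := by
  refine ⟨fun J zs => rfl, fun f ζ => ?_⟩
  rcases ζ with z | z <;> rfl

end KACUFaces

/-! ## §2 The double word as a real-linear map; uniform bounds over the unit ball -/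

section Word

variable {ι : Type} [Fintype ι] (b : Module.Basis ι ℝ 𝔸) (T : (FBondY i → 𝔸) →ₗ[ℂ] (FBondY i → 𝔸)) (U : CfgY 𝔸 i)

variable (par : Site (PV d ℓ i.m i.K hd hL) 0 → Site (PV d ℓ i.m i.K hd hL) 0 → 𝔸ˣ)

/-! ## §3 READ -/

end Word

/-! ## §4 WRITE -/

end Literature.MathematicalPhysics.QuantumFieldTheory.Balaban1983to89.B9SectBE4H2GReadWriteYR

end
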